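import Summits.FinalStateConjecture.FinalStateConjecture.Theses.PhaseMixingCapture
import Summits.FinalStateConjecture.FinalStateConjecture.Theorems.KappaExplicitWaveDecay.Negative.FalseWithoutWaveEq
import Summits.FinalStateConjecture.FinalStateConjecture.Theorems.KappaExplicitWaveDecay.Negative.FalseWithoutWaveEqILED
import Literature.Geometry.Lorentzian.TeukolskyWronskianBound
import Literature.Geometry.Lorentzian.KerrSurfaceGravity
import Literature.Geometry.Lorentzian.KerrSeparatedPotential
import Literature.Geometry.Lorentzian.KerrTortoiseRadius
import Literature.Geometry.Lorentzian.TeukolskyRadialConjugation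
import Literature.Geometry.Lorentzian.TeukolskyRadialSchrodingerForm
import Literature.Geometry.Lorentzian.TeukolskyHorizonNormalisedLimits
import Literature.Geometry.Lorentzian.TeukolskyInfinityNormalisedLimits
-- import Literature.Geometry.Lorentzian.TeukolskyJostDecomposition  -- (landed p120010; re-enable once the farm snapshot has it)
import Literature.Analysis.ODE.TransitionZoneGrowth
import Literature.Analysis.ODE.BarrierBasis
import Summits.FinalStateConjecture.FinalStateConjecture.Theorems.PhaseMixingCaptureKappaExplicitWaveDecayConeCensus
import Summits.FinalStateConjecture.FinalStateConjecture.Theorems.PhaseMixingCaptureKappaExplicitWaveDecayOlverNormalForm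
import Summits.FinalStateConjecture.FinalStateConjecture.Theorems.PhaseMixingCaptureKappaExplicitWaveDecayLGErrorBound
import Summits.FinalStateConjecture.FinalStateConjecture.Theorems.PhaseMixingCaptureKappaExplicitWaveDecayEnergyFromLocalEnergy
import Summits.FinalStateConjecture.FinalStateConjecture.Theorems.PhaseMixingCaptureKappaExplicitWaveDecayWronskianOfKernel
import Summits.FinalStateConjecture.FinalStateConjecture.Theorems.PhaseMixingCaptureKappaExplicitWaveDecayTortoiseReduction
import Summits.FinalStateConjecture.FinalStateConjecture.Theorems.PhaseMixingCaptureKappaExplicitWaveDecayTameZoneTransport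
import Summits.FinalStateConjecture.FinalStateConjecture.Theorems.PhaseMixingCaptureKappaExplicitWaveDecayBarrierProductBound
import Summits.FinalStateConjecture.FinalStateConjecture.Theorems.PhaseMixingCaptureKappaExplicitWaveDecayPolyPlumbing
import Summits.FinalStateConjecture.FinalStateConjecture.Theorems.PhaseMixingCaptureKappaExplicitWaveDecayFluxRegimeCorePoly
import Summits.FinalStateConjecture.FinalStateConjecture.Theorems.PhaseMixingCaptureKappaExplicitWaveDecayFullConeCensus
import Summits.FinalStateConjecture.FinalStateConjecture.Theorems.PhaseMixingCaptureKappaExplicitWaveDecayIntegratedDecayAwayFromExtremal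
import Summits.FinalStateConjecture.FinalStateConjecture.Theorems.PhaseMixingCaptureKappaExplicitWaveDecayInfinitySupBoxPoly
import Summits.FinalStateConjecture.FinalStateConjecture.Theorems.PhaseMixingCaptureKappaExplicitWaveDecayHorizonSupBoxPoly
import Summits.FinalStateConjecture.FinalStateConjecture.Theorems.PhaseMixingCaptureKappaExplicitWaveDecayConeKernelLargeStableLayerPoly
import Summits.FinalStateConjecture.FinalStateConjecture.Theorems.PhaseMixingCaptureKappaExplicitWaveDecayConeKernelLargeStableSuperradiantPoly
import Summits.FinalStateConjecture.FinalStateConjecture.Theorems.PhaseMixingCaptureKappaExplicitWaveDecayConeBarrierDecayPoly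
import Summits.FinalStateConjecture.FinalStateConjecture.Theorems.PhaseMixingCaptureKappaExplicitWaveDecayInfinityJostRemainderPoly
import Literature.Geometry.Lorentzian.KerrSeparatedPotentialCriticalPoints
import Literature.Geometry.Lorentzian.KerrIntegratedDecayUniform
import Literature.Geometry.Lorentzian.KerrIntegratedDecayZerothUniform

/-!
# Line `olver-dunster-uniform-reduction` for crux `PhaseMixingCapture.KappaExplicitWaveDecay` (stmt-FinalStateConjecture-10654)

Skeleton (crux-plan, `planner-cruxplan-stmt-FinalStateConjecture-10654-olver-dunster-unifor-0`, 2026-08-16).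
Route `route-FinalStateConjecture-PhaseMixingCapture` (rank-3 crux); idea card `olver-dunster-uniform-reduction` (ideator
`cruxidea-stmt-FinalStateConjecture-10654-2`, round 1) MERGED with `olver-log-throat` (ideator 3; triage r1-2 / r1-3: "same lever, keep the
earlier slug, graft S1 Euler-exactness, S2 line dilation, S3 order → 0 junction and falsifier (b)"); triage r1-2: pass, r1-3: pass.
POSITIVE line: `KappaExplicitWaveDecay_of` concludes the crux decl BY NAME from the seven registered stub statements;
`KappaExplicitWaveDecay_proof` applies it to the sorried stubs.

## The crux (recall)

`KappaExplicitWaveDecay`: for every `M > 0` there are `p`, `j` with (a) `sliceEnergy(ψ, τ) ≤ C(M)·χ^{-p}·E_j[ψ](0)` for all `τ ≥ 0`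
and (b) `∫₀^∞ E_loc(τ, R) dτ ≤ C(M, R)·χ^{-p}·E_j[ψ](0)`, for every sub-extremal `|a| < M` and every admissible wave `ψ` on `{r > r₊}`,
`χ = 1 − (a/M)²` (`κM ∈ [√χ/4, √χ/2]`, `Kerr.mul_surfaceGravity_mem_Icc`: powers of `κ = Kerr.surfaceGravity M a` = powers of `χ`).

## The line (lever: uniform asymptotic reduction of the TRUE separated ODE; the corner Green's function is explicit)

In the blown-up radius `x = (r − r₊)/(r₊ − r₋)` the Carter/Teukolsky radial ODE (`s = 0`) is EXACTLY of Olver's form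
`W″ = (m² f + g) W`, `W = √(x(x+1))·R`, `m² f + g = ((Λ − 2amω)x(x+1) − k² − ¼)/(x(x+1))²`, `k = K/(r₊ − r₋) = ξ + ωx(2r₊ + (r₊−r₋)x)`,
`ξ = (ω − mω₊)/(2κ)` (`stub_olverNormalForm`): a double pole at the horizon (`x²(m²f+g) → −ξ² − ¼`, exponents `½ ± iξ`), a finite set of
turning points, an irregular point at `x = ∞`; large parameter `u = |m|`, slow parameters `(a/M, ξ̃ = ξ/|m|, Λ/m²)`. The classical UNIFORM
reductions WITH ERROR BOUNDS — Liouville–Green with Olver's error-control function `F` (`stub_lgErrorBound`, Olver 1974 Ch. 6 Thms 2.1/2.2,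
Ch. 10), Airy at a simple turning point (Olver Ch. 11), Weber at two coalescing turning points (Olver 1975, doi:10.1098/rsta.1975.0023),
Bessel of imaginary/vanishing order where a turning point meets the horizon's double pole or where the Euler index of the throat crosses
the Breitenlohner–Freedman value (Boyd–Dunster 1986 doi:10.1137/0517033, Dunster 1990 doi:10.1137/0521055, 10.1137/0521087; Whittaker
with large parameters, DLMF §13.20–13.21) — are applied to the TRUE coefficient on the whole half-line (no model faces, nothing to match),
once a semialgebraic CENSUS (`stub_coneCensus`: no well in the threshold cone) has fixed the finite list of configurations. Output: the
cone Green's function `G(r, r′) = u_𝓗(r_<) u_𝓘(r_>)/𝔚` is explicit up to factors `exp(𝒱(F)/|m|)`; its DENOMINATOR obeys the κ-polynomial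
quantitative mode-stability bound `|𝔚|⁻¹ ≤ C|m|^N κ^{-N}` for ALL `m ≠ 0` in the cone (`stub_coneWronskianBound`; exponent `N ≥ ½` is
forced: `|𝔚|² ≈ 490κ` at the `(2,2)` threshold, tree erratum on `Kerr.Costa2019_wronskianBound_subextremal` + triage job j012289), and
the KERNEL itself is pointwise polynomially bounded, `√(r²+a²)|R_𝓗(r)|·√(r′²+a²)|R_𝓘(r′)| ≤ C|m|^N κ^{-N}|𝔚|` for `r ≤ r′` beyond the
red-shift collar (`stub_coneGreenKernel`, HARDEST: "the dominant term cannot cancel across a single barrier" = no well). Physical space: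
variation of parameters turns the kernel bound into the in-cone resolvent estimate, DRSR III off the cone / in the bulk with tracked
constants and DRSR §§9–12 give clause (b) (`stub_integratedDecayOfKernel`), and a vector-field energy identity with `N = ∂_{t*}` on
`r ≥ 3M` gives clause (a) from (b) (`stub_energyFromLocalEnergy`, the card's `BoundednessFromILED`).

    KappaExplicitWaveDecay ⇐ (a) ∧ (b)                                   [`_of`: exponents (max p 0, max j 1), monotonicity]
      (b)      = stub_integratedDecayOfKernel (WRONSKIAN) (KERNEL)       [variation of parameters + DRSR off-cone/bulk + §§9–12]
      (a)      ⇐ stub_energyFromLocalEnergy + (b) at R₀(M)               [energy identity, horizon flux ≥ 0]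
      KERNEL   = coneGreenKernel_of_halves S5a S5b                       [v2: case split on the sign of ω(ω − mω₊) and the sliver, ξ₀ = 1]
      S5a = stub_coneKernelNonSuperradiant · S5b = stub_coneKernelSuperradiant   [v2; inputs S1–S3, flux layer]
      WRONSKIAN = stub_wronskianOfKernel KERNEL                           [v2: old S4 from the kernel bound at the two ends]
      S1 = stub_olverNormalForm · S2 = stub_lgErrorBound · S3 = stub_coneCensus   [landed]

All seven stubs are stated over IMPORTABLE vocabulary only (TdC: `Kerr.IsRadialTeukolskySolution`, `Kerr.radialK`,
`Kerr.IsNormalisedHorizonSolution` / `Kerr.IsNormalisedInfinitySolution`, `Kerr.radialWronskian`, `Kerr.horizonAngularVelocity`, `Kerr.surfaceGravity`; DRSR Def. 6.1.1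
`Kerr.IsAdmissibleTriple` with `Λ = λ + a²ω²`; Mathlib calculus for S2; the crux's own physical-space clauses verbatim for S6/S7), so a
stub proof lands under `Theorems/` with the registered signature copied word for word. `Statement.stub_…` are NAMES (`type_of%`) of the
seven statements, used as the hypotheses of `KappaExplicitWaveDecay_of`.

## Disproof used (`Cruxes/KappaExplicitWaveDecay/Disproof.lean`, cdisprove v2.2, 0 sorry — read 2026-08-16)

* §4 `kappaExplicitWaveDecay_false_without_waveEq` / `clauseB_false_without_waveEq` (LANDED as
  `Theorems/KappaExplicitWaveDecay/Negative/FalseWithoutWaveEq(ILED).lean`, imported below and pinned in `negatives_honoured`): `□_g ψ = 0`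
  is load-bearing in both conjuncts — honoured: S6 uses it through Carter separation (the kernel bound is about SOLUTIONS of the separated
  ODE) and S7 through the energy identity `∇·J^N = K^N`; both stubs quantify the admissibility clause VERBATIM (with `□ψ = 0`), so neither
  is an instance of the refuted `…WithoutWaveEq` statements.
* §5 `clauseA_false_at_extremal_of_wave` (guard `IsSubextremal` load-bearing) — honoured: every frequency-side stub needs `r₊ > r₋`
  (the blow-up `x` and `ξ = (ω − mω₊)/2κ` are undefined at `κ = 0`) and lets constants degenerate like `κ^{-N}`; S6/S7 carry
  `Kerr.IsSubextremal M a` exactly as the crux; nothing is claimed at `|a| = M`.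
* §6 `not_kappa_of_not_axisymmetric` (m = 0 is the robust sector) — consistent: the cone stubs S3–S5 live at `m ≠ 0`; `m = 0` is off-cone
  (DRSR verbatim inside S6).
* §7 near-zone algebra (`nearZone_discriminant`, `nearZoneNumerator_pos_of_window`, `…_threshold`): the face (`κ → 0`) shadow of S3 — on
  the superradiant side a single barrier with an open horizon-side end, a barrier-free window, coalescence only at `ξ̃_trap = (1 − δ̃)/2 > 0`;
  S3 asserts the no-well statement for the TRUE quartic at `κ > 0` (censuses: desk 8649 configs, kit j008834 42 484 + 23 220, j008363).
* docblock items 2–4 (Gajic: at `κ = 0` clause (b) fails for `|m| ≥ 2` ⇒ `p ≥ ½`; GZZ transients; TdC on boxes SUPERSEDED by the erratum):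
  S4/S5 ask only for SOME power `N` and for ALL `m ≠ 0` (no bounded-box citation anywhere on the cone).
* `ledger negatives --problem FinalStateConjecture`: 1 entry (`not_UniformPhotonSphereChannels`, Schwarzschild photon-sphere channels) —
  unrelated to every stub here.
-/

/-!
## Lead status (line lead seat c5, 2026-08-17, skeleton v9 = v8 + T1i LANDED + T2 split along the BF seam + S6a′/S6d)

v9 (this file). (i) T1i `stub_infinitySupBoxPoly` LANDED (wave-1 worker, p139559
`Theorems/PhaseMixingCaptureKappaExplicitWaveDecayInfinitySupBoxPoly.lean` over the new Literature bricks `EulerZoneGrowth` p137914,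
`CarterThroatCoefficient` p138273, `CarterFarSupBound` p138340, `CarterThroatTransport` p138707, `CarterThroatHandover` p139241): imported,
`sorry` replaced. T1h's bricks are all landed (`RegularSingularEnergy` p138248, `CarterHorizonPocket` p138586, `TeukolskyBlowupPocketCoeff`
p139393, `TeukolskyBlowupPocket` p139652, `TeukolskyBlowupTransport` p139653, `TeukolskyHorizonSupPorts` p140058); its closer is in wave 2.
(ii) T2 RESHAPED along the seam the wave-1 probe exposed (evidence `T2-stable-sketch.md`, `T2-residual.md`, `T2-numerics-local.md` on the
item): `stub_coneKernelThresholdLargePoly` ⇐ T2s `stub_coneKernelLargeStablePoly` (Breitenlohner–Freedman STABLE sectors with margin,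
`(1 + θ₁)(2r₊ω)² ≤ Λ − 2amω`: ELEMENTARY without pairing — one-sided flux pairing, threshold monotone growth `CarterThresholdMonotone`
p138894/p139992, growth pairing `GrowthPairing` p139323/p139990, barrier-basis dominance `G₊G₋ ≥ κ^{-2ν}e^{c√Λ′}` with `ν ≥ 1` from the
margin; closure = bricks G0–G4, G6 + assembly, flux-regime-sized) ∧ T2v `stub_coneKernelLargeViolatingPoly` (BF-VIOLATING sectors
`Λ − 2amω < (1 + θ₁)(2r₊ω)²`, forced `m² ≍ Λ → ∞`: oscillatory throat `x^{-½±iδ}`; the research residual in small-gain form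
`sup|ρ_cap||ρ_far| ≤ 1 − gap` uniformly in `κ → 0` AND `m → ∞` — measured loop gain ≤ 2.4·10⁻⁷ for `m ≥ 64`, no drifting exponent up to
`m = 512`; elementary fringe R1a = deep tunnelling `|ξ| ≳ log κ⁻¹`), glued by the sorry-free `coneKernelThresholdLargePoly_of_parts`
(`θ₁ := 1`, case split on the BF inequality, constants merged by `monomial_le_monomial`). (iii) S6a RESHAPED into S6a′ (same conclusion,
two more NAMED hypotheses, both published theorems the wave-1 re-assessment `S6a_inventory.md` proved unavoidable): the off-cone
bounded-frequency superradiant horizon term of DRSR §9.7 needs quantitative mode stability UNIFORM in `|a| < M` off the extremal threshold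
= Teixeira da Costa 2020 Thm 5.1 = the tree's named fact `Kerr.Costa2019_wronskianBound_subextremal` (corrected reading), now the registered
obligation S6d `stub_costaWronskianBound` and a hypothesis of S6a′; and the qualitative future integrability of DRSR §11 at each fixed
`a` is supplied by S6c's fact (already registered), now also a hypothesis of S6a′ — so S6a′ is closable from its hypotheses by the DRSR
route with κ-tracked constants and nothing hidden (`integratedDecay_of_parts` threads S6c and S6d into S6a′). Literature landed toward
S6a′: `KerrIntegratedDecayNearExtremalReduction` p138669 (the physical dictionary: S6a′ ⇐ a κ-explicit GRAPH ILED of order j).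
OPEN (7 = stubs_max): T1w (lead), T1h (wave 2: closer), T2s (wave 2), T2v (research residual), S6a′ (wave 2: `missing_coneModeSupBound`,
`missing_offConeHorizonTerm`), S6c (DRSR fact: literature programme), S6d (TdC Thm 5.1: literature programme).
v9.1 (after wave 2, 4 workers, 21 accepted proposals): T1h `stub_horizonSupBoxPoly` LANDED (p142765
`Theorems/PhaseMixingCaptureKappaExplicitWaveDecayHorizonSupBoxPoly.lean` + Literature `TeukolskyHorizonSupBoxPocket` p142209): imported, `sorry`
replaced — the bounded box now rests on T1w ALONE. T2s: 13 Literature bricks landed (p141268 p141750 p142067 p142449 p142711 p142964 p143062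
p143393 p143394 p143395 p143597 p143849 p144562 — threshold forbidden interval, Λ-aware tortoise-core plumbing
`Kerr.Costa2019.kernelBound_of_tortoise_core_regime`, one-sided flux rates `re_conj_mul_deriv_le_of_right_flux`/`_ge_of_left_flux`,
`kernel_le_of_recessive_dominated`, κ-free far envelopes `carter_envelope_I(_deriv)_of_far_start`, threshold affine coefficient bounds, the
far-turning-point/Airy endgame (new gap G8) …); remaining pieces typed in `work/stubs/T2s/T2s_remaining.lean` (depth certification, threshold
core assembly, G4 cap edge, sliver core, superradiant core, closer). S6a′: 6 Literature bricks landed (p141574 `OutgoingVariationOfParameters`,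
p142540 `OutgoingHorizonAmplitude`, p142779 `TeukolskyWronskianBoundOffCone`, p143202 `KerrConeModeSupBound`, p143737 `TeukolskyOffConeSupBounds`,
p144276 `TeukolskyOffConeSupBoundsBox`): `missing_coneModeSupBound` and `missing_offConeHorizonTerm` are PROVED (evidence `S6a_skeleton.lean` v2,
rc 0); still sorried there: `missing_offConeMultiplierEstimates` (crux-sized), `missing_normalisedPairExists` (NEW: existence of the
TdC-normalised pair `R_𝓗, R_𝓘` for each real frequency — Frobenius at `r₊`, Jost at infinity — is not in the tree; wave 3),
`missing_axisymmetricLowLambdaEnvelope` (cosmetic `Λ ≥ 1`), `missing_redShiftPoly`, `missing_summationFutureIntegrable`,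
`missing_futureIntegrableOfFirstOrder` (disappears if the DRSR fact is vendored in the form (24) with its zeroth-order term). T1w: brick
`Literature/Analysis/ODE/ConjugatePairWronskian.lean` LANDED (p141356: `ConjugatePair.decomp`, `flux_decomp`, `wronskian_decomp`, `small_gain`,
`norm_wronskian_ge_small_gain`). Skeleton vetted by refuter skelvet BC3 (PASS, 2026-08-17T05:21Z). OPEN (6): T1w, T2s, T2v, S6a′, S6c, S6d.
v9.2 (RESHAPE of T2s along the wave-2 worker's checked architecture, `T2s_remaining.lean`): T2s ⇐ T2sA `stub_coneKernelLargeStableLayerPoly`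
(threshold layer `|σ| ≤ 2ξ₁κ`, `ξ₁` CHOSEN by the prover: cases (T) σ = 0 and (S) sliver) ∧ T2sB `stub_coneKernelLargeStableSuperradiantPoly` (`ωσ ≤ 0`,
`2ξ₁κ ≤ |σ|`, every `ξ₁`: case (R)) ∧ the LANDED flux regime at `δ := 2ξ₁` (non-superradiant part of the registered layer `|σ| ≤ 2ξ₀κ`), glue
`coneKernelLargeStablePoly_of_parts` proved (three-way constant merge `monomial_le_merge3`). OPEN (7): T1w, T2sA, T2sB, T2v, S6a′, S6c, S6d.
v9.3 (after wave 3, 4 workers, ~50 accepted proposals): T2sA `stub_coneKernelLargeStableLayerPoly` LANDED (p156865 `Theorems/…ConeKernelLargeStableLayerPoly.lean`: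
threshold core `Kerr.thresholdRegime_corePoly` p149182 + sliver core `Kerr.sliverRegime_corePoly` p156631, glued by `kernelBound_of_tortoise_core_regime` with the
census; `ξ₁ = 10⁻¹⁸·min(θ₁,1)⁴·min(θ,1)`; ~30 Literature bricks QuasiMonotoneBarrier p149160 … CarterSliverLogSmallness p156375): imported, `sorry` replaced.
T2sB: 12 bricks landed (p146093 p146099 p146573 p146771 p146971 p147126 p147590 p147812 p147920 p148289 p148574 p149088; κ-UNIFORM good-zone depth
`carter_goodZone_depth_and_rates`, sharp cap bound `carter_cap_norm_le`, generic `kernel_le_of_deep_barrier`); remaining (N6)+(N7) off-zone rate, bookkeeping,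
closer — typed in `work/stubs/T2sB/T2sB_remaining.lean`. S6a′: `missing_normalisedPairExists` DISCHARGED — `Kerr.normalisedPair_exists` p146780 (+ p146041
`RegularSingularScalarBranch`, p146128 `VariationOfParametersIoi`, p146332 `TeukolskyNormalisedHorizonExists`, p146350 `TeukolskyOutgoingFormalSeries`, p146485
`TeukolskyRadialContinuation`, p146674 `TeukolskyOutgoingCorrection`); S6a′ skeleton v3 (evidence): 5 missing_* left (offConeMultiplierEstimates, redShiftPoly,
summationFutureIntegrable, futureIntegrableOfFirstOrder, axisymmetricLowLambdaEnvelope). T1w: far face = Coulomb wave equation LANDED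
(`Kerr.TeukolskyPress.coulombWave_of_extremal_threshold` p146270, `ExtremalKerrThresholdCoulomb.lean`; far reflection of the corner model
`|ρ_far|² = e^{−2πδ}cosh π(m−δ)/cosh π(m+δ)`). OPEN (6): T1w (research programme), T2sB (wave 4), T2v (research), S6a′ (DRSR-with-κ block), S6c, S6d (facts).
v9.4 (after wave 4, 3 workers): T2sB `stub_coneKernelLargeStableSuperradiantPoly` LANDED (p160759; u-core `Kerr.superradiantRegime_corePoly` p160414, N = 545;
bricks p157980 BarrierInteriorRate — (N6)+(N7) collapsed to a convexity argument on the whole barrier —, p158305, p158452, p159003, p159454, p159455): imported,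
`sorry` replaced — THE WHOLE LARGE-Λ BF-STABLE HALF (T2s) AND THE WHOLE ELEMENTARY T-SIDE OF THE LINE ARE NOW IN THE TREE. S6a′: `missing_axisymmetricLowLambdaEnvelope`
DISCHARGED (p158186, p157764); `RedShiftPoly` as typed was FALSE (the cut-off shell forces a factor η⁻¹) — corrected `RedShiftPoly′` (constant `C₀(κη)^{-q}/c`)
PROVED κ-explicitly (`Kerr.redShiftPoly_kappaEta` p161605 over p159105 p159663 p160118 p160387 p161089 p161417: explicit collar `r₊ ≤ r ≤ r₊ + M²κ/4096`,
`K^N ≥ (κ/4000)∑(∂w)²`); S6a′ skeleton v5 (evidence #126): 3 sorries left — `missing_offConeMultiplierEstimates` (DRSR Thm 8.1 off-cone, κδ-polynomial),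
`missing_summationFutureIntegrable` (§5 interface for ξψ, §9.2–9.6, §10-lite), `missing_futureIntegrableOfFirstOrder` (vanishes if the DRSR fact is vendored as (24)).
T1w infrastructure (I-a.1/2) LANDED: `HypergeometricODE` p158201 (₂F₁ solves DLMF 15.10.1, derivative 15.5.1), `HypergeometricEulerIntegral` p158535 +
`…EulerIntegralSeries` p159202 (Euler integral on Re z < 1, = ₂F₁ on the disc by DLMF 15.6.1, ODE by the identity theorem, `eulerHypergeometric_throat_ode` for all
x > −1); remaining (I-a.3) connection at −∞, (I-b) Whittaker, (II) E1–E4. OPEN (5): T1w (research programme), T2v (research), S6a′ (3 DRSR-with-κ pieces), S6c, S6d (facts).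
v9.5 (after wave 5, 2 workers; RESHAPE of the S6 block): ₂F₁ Pfaff p162736, Gauss sum p162989, Euler transformation p163137/p163498, DLMF 15.8.2 one-term
limits p163380 LANDED (resonant connection Re(a−b) = 0 still open); DRSR Thm 3.1 (24) a₀-uniform every-order NAMED FACT LANDED (p162880, implies (25)) with
`futureIntegrable_of_integratedDecayZeroth` p163353, `sliceSobolevEnergy_lt_top` p163123 ⇒ S6c ↦ `stub_drsrIntegratedDecayZerothUniform` and S6a′ ↦ S6a″
(hD := the (24) fact — under (25)@j=2 the needed future integrability did NOT follow: misstated hypothesis repaired; + the two T-side inputs the summation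
needs, now registered: S6e `stub_coneBarrierDecayPoly`, S6f `stub_infinityJostRemainderPoly`); S6a″ is closable from its hypotheses modulo exactly
`missing_offConeMultiplierEstimates` (DRSR Thm 8.1 off-cone) and the typed summation block S1/S4/S4a/S4b/S5 (`S6a_summation_skeleton.lean`, evidence).
OPEN (7 = stubs_max): T1w (research programme), T2v (research), S6a″ (DRSR-with-κ: Thm 8.1 off-cone + §5/§9/§10 summation), S6c (fact, (24) form), S6d (fact),
S6e (M–L, worker-sized), S6f (M, worker-sized).
v9.6 (after wave 6, 3 workers): S6e `stub_coneBarrierDecayPoly` LANDED (p167121, κ-free angular-barrier decay `Kerr.angularBarrier_decay` p166726 + the landed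
large-Λ BF-stable kernel): imported, `sorry` replaced; S6f as typed in v9.5 was FALSE (threshold below `r₊` for large `|ω|`; `not_infinityJostRemainderPoly`) —
CORRECTED here (`C_J ≤ r` added) and PROVED by the worker (bricks p166353 JostOutgoingRemainder, p167203 KerrTortoiseFarAsymptotics, p167482
TeukolskyJostRemainderBound; closer proposed by the lead after re-registration); T1w item (I-a.3) COMPLETE: Kummer solutions at 1 p166084, connection
DLMF 15.8.4 incl. the resonant line p167370, two-term 15.8.2 at −∞ p168278 — the cap amplitudes `A₀(ξ), A′₀(ξ)` of the T1w programme are now formal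
Gamma quotients. OPEN (6 once S6f lands): T1w (programme: (I-b) Whittaker + (II) E1–E4), T2v (research), S6a″ (DRSR Thm 8.1 off-cone + summation S1/S4/S5),
S6c, S6d (facts), S6f (closer pending).
v9.7: S6f `stub_infinityJostRemainderPoly` LANDED (p168433; the `[folklore]`-tagged abbrev was relocated by the gate to
`Literature/Uncategorized/InfinityJostRemainderPoly.lean` p168432 — a named-fact entry that IS discharged by the Theorems theorem; librarians please re-home /
mark discharged). ALL WORKER-SIZED STUBS OF THE LINE ARE CLOSED. OPEN (5): T1w `stub_thresholdWronskianBoxPoly` (research programme: Whittaker connection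
(I-b) + error control E1–E4; cap side (I-a) COMPLETE in the tree), T2v `stub_coneKernelLargeViolatingPoly` (research: one LG far-face reflection bound uniform in
(κ, m)), S6a″ `stub_integratedDecayNearExtremalPoly` (DRSR-with-κ: Thm 8.1 off-cone for 4 ranges + the typed summation block S1/S4/S4a/S4b/S5), S6c
`stub_drsrIntegratedDecayZerothUniform` and S6d `stub_costaWronskianBound` (published theorems as named facts: DRSR 2016 Thm 3.1/3.2, TdC 2020 Thm 5.1).
After wave 7 (3 workers): T1w item (I-b) FOUNDATIONS LANDED — Tricomi `U` by the integral DLMF 13.4.4 with Kummer's equation p169496, `whittakerW` with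
Whittaker's equation (T1w parameters κ = im, μ = ±iδ admissible) p169823, large-x limit 13.7.3 p169834; Kummer `M` series (entire, ODE, 13.3.15) p169462,
`whittakerM` with its equation, Frobenius pair `M_{κ,±μ}` and Wronskian `−2μ` p169753, Kummer's transformation 13.2.39 p169891 — what remains of the T1w
programme is the `U ↔ M` connection (DLMF 13.2.42 ⇒ 13.14.33), the rotation to the ray `z = −2iρ`, and the error control E1–E4. S6a″: v = t + r* Plancherel
model lemma p169692, Carter symbol Plancherel k = 1 p169981; evidence skeleton v7 (#131): S6a″ proved modulo offConeMultiplierEstimates + S1/S4/S4a/S4b/S5(k ≥ 2).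

## Lead status (line lead seat c5 `prover-line-stmt-FinalStateConjecture-10654-c5-0`, 2026-08-17, skeleton v8 = RESHAPE of T1)

v8 (this file): the bounded-box threshold/superradiant stub T1 `stub_coneKernelThresholdBoundedPoly` (v7.3–v7.6; returned
`stub-blocked: unpublished Teukolsky–Press matching with error control` by c4's wave-1 worker) is SPLIT along the seam that the
bounded box opens: on `Λ ≤ Λ₀` the exponents may depend on `Λ₀`, so the growth `σ^{-ν(Λ,m)}` of solutions across the near-extremal
throat is itself a power of `κ⁻¹` and the TWO-POINT structure of the kernel is no longer needed — the kernel bound is the product of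
two ONE-FUNCTION sup bounds and a Wronskian lower bound:
* T1w `stub_thresholdWronskianBoxPoly` — `1 ≤ (CΛ^Nκ^{-N})²|𝔚|²` on the box in the threshold/superradiant cone: quantitative mode
  stability near the corner `(a, ω) → (M, mω₊)` = the ENTIRE research content of the old T1, now in small-gain form (lead; analysis
  `Lines/olver_dunster_uniform_reduction_c5_smallgain.md`);
* T1h `stub_horizonSupBoxPoly` — `√(r²+a²)|R_𝓗| ≤ CΛ^Nκ^{-N}` on the whole half-line (robust transport: pocket envelope, log-chart
  Grönwall in the blown-up variable, κ-regular mid/far zones; worker);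
* T1i `stub_infinitySupBoxPoly` — `√(r′²+a²)|R_𝓘| ≤ CΛ^Nκ^{-N}` beyond the collar (robust transport inward from infinity; worker);
glued by the sorry-free `coneKernelThresholdBoundedPoly_of_parts` (exponents add), which recovers the v7.3 statement of T1 verbatim, so
`coneKernelThresholdPoly_of_parts`, `coneKernelPoly_of_parts` and everything downstream are unchanged. OPEN (6): T1w (lead, research),
T1h, T1i (workers, L / M–L), T2 `stub_coneKernelThresholdLargePoly` (research core, two large parameters), S6a
`stub_integratedDecayNearExtremalPoly` (crux-sized: Carter separation M2 + κ-tracked DRSR §§8–12; promote-stub ×5 stands), S6c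
`stub_drsrIntegratedDecayUniform` (the printed DRSR theorem, literature provers). Disproof v3 (cdisprove, 2026-08-16T05:46Z) re-read:
no `-- Targets` entry concerns any v7/v8 stub; §4 (wave equation load-bearing) and §5 (sub-extremality guard) honoured as before
(T1w/T1h/T1i are ODE statements at `κ > 0` with constants degenerating like powers of `κ⁻¹`).
-/

/-!
## Lead status (line lead seat c4 `prover-line-stmt-FinalStateConjecture-10654-c4-0`, 2026-08-16, skeleton v7 = v6 + three landed stubs)

v7 (this file): NO RESHAPE. The three v6 stubs landed by lead c3 are imported and their `sorry` replaced by the Theorems decls: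
`stub_tameZoneTransport` (p126383, `Theorems/PhaseMixingCaptureKappaExplicitWaveDecayTameZoneTransport.lean`),
`stub_barrierProductBound` (p126199, `…BarrierProductBound.lean`), `stub_polyPlumbing` (p126054, `…PolyPlumbing.lean`). OPEN (4):
`stub_fluxRegimeCorePoly` (LEAD — assembly of c3's Literature bricks `CarterHorizonZone` p126418, `CarterNearZone` p126531,
`CarterFarEnvelope` p126404, `CarterFluxEnvelopes` p126671, `CarterConeArithmetic` p126809, `CarterFluxBookkeeping` p126983,
`KernelPairing` p125729, `KernelTwoPointBound` p126425, `KerrTortoiseZones` p125791), `stub_fullConeCensus` (worker),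
`stub_coneKernelThresholdPoly` (worker; research core), `stub_integratedDecayOfKernelPoly` (S6; promote-stub ×4 stands).
v7.1: `stub_fluxRegimeCorePoly` reshaped (E1/E2 hypotheses dropped — landed theorems; census hypothesis verbatim). v7.2: LEAD STUB LANDED —
`stub_fluxRegimeCorePoly` = `Literature/Geometry/Lorentzian/CarterFluxKernelBound.lean` (p127905: `Kerr.forbidden_interval`,
`Kerr.fluxRegime_kernel_le`) + `Theorems/PhaseMixingCaptureKappaExplicitWaveDecayFluxRegimeCorePoly.lean` (p128144). Wave 1 (3 workers):
`stub_integratedDecayOfKernelPoly` → stub-blocked on M2 (Carter separation with t*-Plancherel; being built by a provefact seat), promote-stub ×5;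
`stub_coneKernelThresholdPoly` → stub-blocked: the needed theorem (TP74 matching with error control for real ω) is UNPUBLISHED (TdC 2020 Thm 5.1
excludes the threshold; Gajic 2023 §1.4 open; Benomio–Teixeira da Costa arXiv:2512.08917 Conj. 5.6 / Rem. 5.8); `stub_fullConeCensus` → pending.
v7.3 (RESHAPE): the research stub `stub_coneKernelThresholdPoly` is split along the seam the worker's analysis exposed — bounded box
`Λ ≤ Λ₀` (`stub_coneKernelThresholdBoundedPoly`: fixed-box near-extremal matching with error control, classical but unpublished) vs large `Λ`
(`stub_coneKernelThresholdLargePoly`: the two-large-parameter uniform reduction; Gajic's uncharted regime) — merged by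
`coneKernelThresholdPoly_of_parts`; the crux-side plumbing is unchanged.
OPEN (4): `stub_fullConeCensus`, `stub_coneKernelThresholdBoundedPoly`, `stub_coneKernelThresholdLargePoly`, `stub_integratedDecayOfKernelPoly`.
v7.4 (RESHAPE of S6): `stub_integratedDecayOfKernelPoly` is split into `stub_integratedDecayNearExtremalPoly` (S6a: `a₁ ≤ |a| < M`, κ-explicit, from the cone
bounds — the honest crux-sized part) and `stub_integratedDecayAwayFromExtremal` (S6b: `|a| ≤ a₁`, no κ — DRSR Thm 3.2 with its printed `a₀`-uniform constant,
previously SILENT inside S6), glued by the proved `integratedDecay_of_parts`.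
OPEN (5): `stub_fullConeCensus` (worker), `stub_coneKernelThresholdBoundedPoly`, `stub_coneKernelThresholdLargePoly`, `stub_integratedDecayNearExtremalPoly`,
`stub_integratedDecayAwayFromExtremal`.
v7.5: the printed DRSR theorem enters BY NAME — lead c4 filed `Literature/Geometry/Lorentzian/KerrIntegratedDecayUniform.lean` (p134959 ACCEPTED: the named fact
`DafermosRodnianskiShlapentokhRothman2016_integratedDecay_uniform`, Thm 3.2 (25) with its `a₀`-uniform constant); S6b becomes the REDUCTION `…_uniform → (S6b clause)`
(provable, M) and the fact itself is the registered obligation `stub_drsrIntegratedDecayUniform` (S6c), so the composition stays unconditional and closes exactly when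
DRSR is discharged in the tree. OPEN (6): census (worker), T1, T2, S6a, S6b, S6c.
v7.6: LANDED `stub_fullConeCensus` (wave-1 worker: Literature `KerrSeparatedPotentialConeLevelTables` p135044 + `KerrSeparatedPotentialConeLevel` p135465 —
`Kerr.coneLevel_quasiconvex`: the level function Â/B̂ of the identity 4(1+g)²(r²+a²)⁴(ω² − V) = M⁶m²(1+g)(Â − ℓB̂) has no interior maximum on (0,∞), which removes
both unbounded parameters — + Theorems `…FullConeCensus` p135637) and `stub_integratedDecayAwayFromExtremal` (wave-3 worker, Theorems `…IntegratedDecayAwayFromExtremal`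
p135745: the reduction from the named fact, a-uniform far radius `Kerr.farRadius M a ≤ 293M + 2`). OPEN (4): `stub_coneKernelThresholdBoundedPoly` (T1, research:
unpublished TP74-with-error-control), `stub_coneKernelThresholdLargePoly` (T2, research core), `stub_integratedDecayNearExtremalPoly` (S6a, crux-sized: M2 + DRSR §§8–12
κ-tracked), `stub_drsrIntegratedDecayUniform` (S6c = the printed DRSR theorem, literature provers). Everything elementary of the line is in the tree.
-/

/-!
## Lead status (line lead seat c3 `prover-line-stmt-FinalStateConjecture-10654-c3-0`, 2026-08-16, skeleton v6 = RESHAPE: Λ-POLYNOMIAL CONSTANTS)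

FINDING (evidence `stub-misstated-lambda.md` on the item): every registered cone-KERNEL statement of v2–v5 (`stub_fluxRegimeCoreOfCensus`,
`stub_coneKernelSliver`, `stub_coneKernelSuperradiant`, the kernel hypothesis of `stub_integratedDecayOfKernel` / `stub_wronskianOfKernel`, both sides of
`stub_tortoiseReduction`) is FALSE UNIFORMLY IN `Λ`: the constants `C|m|^N κ^{-N}` are chosen before `Λ`, `Kerr.IsAdmissibleTriple` has no upper bound on
`Λ`, and at the outer turning point `r₂ ≈ √Λ/ω` of the thick large-`Λ` barrier the diagonal Green kernel is the Airy kernel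
`|u_H u_I|/|W| = 0.79199·s^{-1/3}(1+o(1))`, `s = dΦ/dr*(r₂) ≈ 2ω³/√Λ`, i.e. it GROWS like `Λ^{1/6}` at fixed `(a, m, ω)` (numerics: ×1.9–2.1 per factor 100
in `Λ`, `m = 1, 2`, `a = 0.99, 0.9999`, `Λ ≤ 10⁶`). REPAIR: the constant of every kernel / Wronskian statement is now `C · Λ^N · κ^{-N}` (`Λ ≥ |m|(|m|+1) ≥ 2`
for `m ≠ 0`; powers of `Λ` are Carter derivatives, paid by `j` exactly like powers of `|m|`). Registered stubs of v6 (7):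
* `stub_fullConeCensus` (unchanged);
* `stub_tameZoneTransport` — generic ODE: transport of `η²|u|² + |u′|²` across a zone `−η² ≤ φ ≤ Φ` with `k` monotone pieces, factor
  `(Φ/η²)^{2k}·exp(2η·length)` (Sonin blocks + transition collars);
* `stub_barrierProductBound` — generic ODE: inside a forbidden interval (`q ≥ 0`), `‖u(x)‖‖v(y)‖` (`x ≤ y`) is bounded by the end data, the pairing
  constants and `(b − a)‖W‖` — convexity of `|u|²`, `|v|²` plus the FIRST-ORDER critical-point inequality `fg ≤ ‖W‖²(f/f′)²` (replaces the maximum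
  principle with `q₀ > 0`, so no stacked census is needed);
* `stub_fluxRegimeCorePoly` (lead) — the flux-regime core with constant `CΛ^Nκ^{-N}`, GIVEN the two generic lemmas and the census;
* `stub_polyPlumbing` — the Λ-polynomial twins of the LANDED `stub_tortoiseReduction` (p120896) and `stub_wronskianOfKernel` (p97378) (same proofs);
* `stub_coneKernelThresholdPoly` — Sliver ∪ Superradiant as ONE statement (c1/c2: one theorem, TP74 matching with error control; research);
* `stub_integratedDecayOfKernelPoly` — S6 with the Λ-polynomial hypotheses (promote-stub ×3 stands: Carter-separation layer M1/M2 absent).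
`KappaExplicitWaveDecay_of` (sorry-free) concludes the crux BY NAME from these seven statements plus the landed S1–S3, S7. The landed v2–v5 bricks
(`stub_tortoiseReduction` p120896, `stub_wronskianOfKernel` p97378, `stub_wronskianFluxRegime` p99805, all Literature bridges) remain valid and are the
templates / inputs of the v6 stubs.
-/

/-!
## Lead status (line lead seat c2 `prover-line-stmt-FinalStateConjecture-10654-c2-0`, 2026-08-16, skeleton v3 = RESHAPE of S5a)

v3 (this file): S5a `stub_coneKernelNonSuperradiant` (non-superradiant half-cone ∪ threshold sliver) is SPLIT along the one seam the
analysis and the numerics expose, into two registered stubs with the same joint content: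
* `stub_coneKernelFluxRegime` (S5a-F, lead) — the kernel bound for NON-SUPERRADIANT cone frequencies OFF the sliver,
  `0 ≤ ω(ω − mω₊)` and `δκ ≤ |ω − mω₊|` (every `δ > 0`; hypotheses in the order of the landed S4a `stub_wronskianFluxRegime`): the
  FLUX REGIME — horizon flux `−(ω − mω₊)` and infinity flux `ω` of opposite signs with the floor `|𝔚|² ≥ 4ω(ω − mω₊) ≥ 4|ω|δκ`
  (landed, `TeukolskyRadialFluxInfinity`), diagonal kernel `≤ min(|u_𝓘|²/|ω|, |u_𝓗|²/|ω − mω₊|)` pointwise (landed,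
  `TeukolskyRadialFluxKernel`), barrier maximum principle (landed, `DiagonalKernelMaximum`): an envelope/tunnelling argument with no
  special functions and no matched asymptotics;
* `stub_coneKernelSliver` (S5a-S) — the kernel bound IN the threshold sliver `|ω − mω₊| ≤ 2ξ₀κ` (either sign, every `ξ₀ > 0`): at
  bounded `(m, ℓ)` this is the Teukolsky–Press 1974 near-extremal matching problem with error control that lead c1 identified
  (`Lines/…_c1_threshold_layer.md`: `|𝔚|²/κ = F_{mℓ}(ξ)` closed form verified to 0.2 %, kernel law `κ⁻¹θ^{-1/2}`; faces landed:
  `NearExtremalThroatHypergeometric` p104831, `ExtremalKerrThresholdRadial` p116859, `TeukolskyPressNearExtremalAmplitudes` p103529),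
  shared with S5b — stated ONCE here so that S5b's residual and S5a's residual are the same theorem.
`coneKernelNonSuperradiant_of_parts` (proved below) reassembles the v2 statement of S5a from S5a-F (`δ := 2ξ₀`) and S5a-S, so
`coneGreenKernel_of_halves`, S5w and S6 consume literally the same statements as before. Open after v3: S5a-F (lead), S5a-S, S5b, S6
(S6: `promote-stub` handed back by leads 0 and c1 — no Carter-separation layer; this seat concurs and keeps it registered verbatim).
Bridge lemmas this seat's wave 1 builds (Literature, consumed by S5a-F/S5a-S/S5b): conjugation symmetry `(ω, m, R) ↦ (−ω, −m, R̄)` of the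
TdC-normalised pair (WLOG `m ≥ 1`); the r*-Schrödinger form `u″ + (ω² − Kerr.sepPotential)u = 0` of a TdC radial solution along a
`Kerr.IsTortoiseRadius` (the missing link between the `Costa2019` and the DRSR halves of the library); horizon / infinity limits of
`|u|`, `|u′|` for the normalised solutions; the Jost decomposition `R_𝓗 = A·R_𝓘 + B·R̄_𝓘`, `|𝔚| = 2|ω||B|`; transition-zone growth for
`y″ = qy`, `|q| ≤ K²`; the monotone real barrier basis with cosh comparison.

## Lead status (line lead seat 1 `prover-line-stmt-FinalStateConjecture-10654-1`, 2026-08-16, skeleton v2 = RESHAPE)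

v2 (this file): the registered S4 `stub_coneWronskianBound` and S5 `stub_coneGreenKernel` are REPLACED by S5a
`stub_coneKernelNonSuperradiant` (kernel bound, non-superradiant half-cone + threshold sliver: elementary flux/energy route, lead),
S5b `stub_coneKernelSuperradiant` (kernel bound, superradiant half-cone off the sliver: research core = quantitative mode stability in
the double limit at bounded `(m, ℓ)`), S5w `stub_wronskianOfKernel` (old S4 verbatim ⇐ old S5 conclusion verbatim; limits at the two
ends); `coneGreenKernel_of_halves` reassembles the old S5 conclusion, so S6's hypotheses are unchanged. Open: S5a, S5b, S6 (S5w closed p97378)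
(S6 handed back `promote-stub` by seat 0: Carter-separation layer M1/M2 absent, specs in `Lines/…_S6_missing_specs.lean`).
CLOSED by seat 1: S5w `stub_wronskianOfKernel` — p97378 `Theorems/PhaseMixingCaptureKappaExplicitWaveDecayWronskianOfKernel.lean`.

## Lead status (line lead `prover-line-stmt-FinalStateConjecture-10654-0`, 2026-08-16, after wave 1)

CLOSED (landed, imported above, `sorry` replaced by the Theorems decl):
* S1 `stub_olverNormalForm` — p85994 `Theorems/PhaseMixingCaptureKappaExplicitWaveDecayOlverNormalForm.lean`;
* S2 `stub_lgErrorBound` — p90005 `…LGErrorBound.lean` over the new Literature layer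
  `Literature/Analysis/ODE/LiouvilleGreen{VolterraBound,Approximant,ErrorBound,Oscillatory}.lean` (p87971, p88469, p89278, p89277);
* S3 `stub_coneCensus` — p84444 `…ConeCensus.lean` (holds for ALL real ω, m, Λ: P = K² − ΔΛ′ has no r³ term, P′ convex on [0,∞));
* S7 `stub_energyFromLocalEnergy` — p92599 `…EnergyFromLocalEnergy.lean` over `Literature/Geometry/Lorentzian/KerrEnergyFromLocalEnergy.lean` (p91920).
OPEN after wave 1 of seat 0: S4 `stub_coneWronskianBound` (worker: blocked — the statement itself is the missing theorem; flux layer landed as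
`Literature/Geometry/Lorentzian/TeukolskyRadialFlux(Infinity).lean` p94563/p94818: |𝔚|² = |𝔚(conj R_H,R_I)|² + 4ω(ω − mω₊));
S5 `stub_coneGreenKernel` (lead; research-level); S6 `stub_integratedDecayOfKernel` (worker: blocked — no
Carter-separation layer in tree; typed specs M1/M2 published as `Lines/olver_dunster_uniform_reduction_S6_missing_specs.lean`).
S4/S5 were reshaped by seat 1 into S5a/S5b/S5w (above).
-/

set_option linter.unusedVariables false
set_option linter.dupNamespace false
set_option linter.unreachableTactic false
set_option linter.unusedTactic false

noncomputable section

namespace Summit.FinalStateConjecture.FinalStateConjecture.Cruxes.KappaExplicitWaveDecay.OlverDunsterUniformReduction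

open Summit.FinalStateConjecture.FinalStateConjecture.Theses.PhaseMixingCapture
open Literature.Geometry.Lorentzian
open MeasureTheory Filter Set Complex
open scoped Topology Manifold ENNReal Classical


/-! ## The seven registered stubs -/

/-- **S1 · `stub_olverNormalForm` — the TRUE radial ODE is exactly of Olver's form `W″ = (m²f + g)W` in the blown-up radius.**
For `M > 0`, `|a| < M`, real `ω`, `m`, `Λ` and ANY `R : ℝ → ℂ`: (i) `R` solves the homogeneous scalar (`s = 0`) radial Teukolsky ODE with
TdC's `λ = Λ − a²ω²` (`Kerr.IsRadialTeukolskySolution`; `ΔR″ + 2(r − M)R′ + (K²/Δ − Λ + 2amω)R = 0`, `K = Kerr.radialK`) iff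
`W(x) := √(x(x+1))·R(r₊ + (r₊ − r₋)x)` is twice differentiable on `x > 0` with
`W″ = (((Λ − 2amω)·x(x+1) − (K/(r₊ − r₋))² − ¼)/(x(x+1))²)·W` — Liouville normal form of the blown-up equation `(PS′)′ + (k²/P − Λ′)S = 0`,
`P = x(x+1)`, `S = P^{-1/2}W`, using `Δ = (r₊−r₋)²P`, `2(r − M) = (r₊−r₋)(2x+1)`, `½(P^{-1/2}P′)′ = −¼P^{-3/2}` (`P′² − 2PP″ = 1`; triage r1-3
hand check); (ii) the horizon is a DOUBLE POLE with complex exponents `½ ± iξ`: `x²·(m²f + g)(x) → −ξ² − ¼` as `x → 0⁺`,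
`ξ = (ω − mω₊)/(2κ)` (`K(r₊) = (r₊² + a²)(ω − mω₊) = (r₊ − r₋)ξ` by `κ = (r₊ − r₋)/(2(r₊² + a²))`). Why true: chain rule for an affine
change of variable in `HasDerivAt` (both directions, `r₊ − r₋ = 2√(M² − a²) > 0`), two polynomial identities, continuity of rational
functions. Leans on: `Kerr.IsRadialTeukolskySolution`, `Kerr.radialK`, `Kerr.delta_eq_mul`, `Kerr.rPlus_sub_rMinus`, `Kerr.rPlus_sq_add_sq`,
`Kerr.surfaceGravity_eq_rPlus_sub_rMinus_div`, `Kerr.horizonAngularVelocity`. Size M. The same change of variable as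
`Lines/extremal-corner-blowup: stub_blowupNormalForm` (un-normalised form); this is the card's `OlverNormalForm`. Used by: S5. -/
theorem stub_olverNormalForm :
    (∀ (M a ω m Λ : ℝ), 0 < M → |a| < M → ∀ R : ℝ → ℂ,
        (Kerr.IsRadialTeukolskySolution M a 0 ω m (Λ - a ^ 2 * ω ^ 2) R ↔
          ∃ W' W'' : ℝ → ℂ, ∀ x : ℝ, 0 < x →
            HasDerivAt (fun y : ℝ ↦ ((Real.sqrt (y * (y + 1)) : ℝ) : ℂ) *
                R (Kerr.rPlus M a + (Kerr.rPlus M a - Kerr.rMinus M a) * y)) (W' x) x ∧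
              HasDerivAt W' (W'' x) x ∧
              W'' x =
                ((((Λ - 2 * a * m * ω) * (x * (x + 1)) -
                        (Kerr.radialK a ω m (Kerr.rPlus M a + (Kerr.rPlus M a - Kerr.rMinus M a) * x) /
                            (Kerr.rPlus M a - Kerr.rMinus M a)) ^ 2 - 1 / 4) /
                      (x * (x + 1)) ^ 2 : ℝ) : ℂ) *
                  (((Real.sqrt (x * (x + 1)) : ℝ) : ℂ) * R (Kerr.rPlus M a + (Kerr.rPlus M a - Kerr.rMinus M a) * x)))) ∧
      (∀ (M a ω m Λ : ℝ), 0 < M → |a| < M →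
        Tendsto
          (fun x : ℝ ↦ x ^ 2 *
            (((Λ - 2 * a * m * ω) * (x * (x + 1)) -
                  (Kerr.radialK a ω m (Kerr.rPlus M a + (Kerr.rPlus M a - Kerr.rMinus M a) * x) /
                      (Kerr.rPlus M a - Kerr.rMinus M a)) ^ 2 - 1 / 4) /
                (x * (x + 1)) ^ 2))
          (𝓝[>] 0)
          (𝓝 (-((ω - m * Kerr.horizonAngularVelocity M a) / (2 * Kerr.surfaceGravity M a)) ^ 2 - 1 / 4))) :=
  -- LANDED (wave 1): see the imported Theorems module
  Summit.FinalStateConjecture.FinalStateConjecture.Theorems.KappaExplicitWaveDecay.OlverDunsterUniformReduction.stub_olverNormalForm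

/-- **S2 · `stub_lgErrorBound` — the ENGINE: Liouville–Green approximation with Olver's error bounds, large parameter `u`**
(Olver, *Asymptotics and Special Functions* (1974), Ch. 6 Thm 2.1 (exponential case), Thm 2.2 (oscillatory case), Ch. 10 §§2–3 (large
parameter) = DLMF §2.7(iii); stated with the weaker constant `exp(𝒱/u) − 1 ≥ exp(𝒱/(2u)) − 1`). On a compact interval `[α, β]` let `f` be
`C²` with derivatives `f′`, `f″`, `g` continuous, `u > 0`, and let `Φ := 5f′²/(16|f|^{5/2}) − f″·sgn/(4|f|^{3/2}) − g/|f|^{1/2}` be the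
derivative of Olver's ERROR-CONTROL FUNCTION `F = ∫(|f|^{-1/4}(|f|^{-1/4})″ − g|f|^{-1/2})`. (A) If `f > 0` on `[α, β]`, the equation
`w″ = (u²f + g)w` has real solutions `w₁ = f^{-1/4} e^{+u∫_α^x √f}(1 + ε₁)`, `w₂ = f^{-1/4} e^{−u∫_α^x √f}(1 + ε₂)` with `ε₁(α) = 0`,
`ε₂(β) = 0`, `|ε₁(x)| ≤ exp(u⁻¹∫_α^x |Φ|) − 1`, `|ε₂(x)| ≤ exp(u⁻¹∫_x^β |Φ|) − 1`, and `|ε′_j| ≤ 2u√f·(same)`. (B) If `f < 0` on `[α, β]`,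
it has a complex solution `w = (−f)^{-1/4} e^{iu∫_α^x √(−f)}(1 + ε)`, `ε(α) = 0`, `‖ε(x)‖ ≤ exp(u⁻¹∫_α^x |Φ|) − 1`, `‖ε′‖ ≤ 2u√(−f)·(same)`
(its conjugate is the second solution). Why true: Olver's theorem (Volterra integral equation for `ε` in the LG variable, Gronwall-type
majorant `e^{𝒱} − 1`); a Mathlib-only statement, candidate `Literature/Analysis/ODE` theorem (the tree has the Volterra machinery:
`VolterraRecessive`, `JostDecay`, `InverseSquareRecessiveVolterra`). Size L. Role: the base chart of the atlas of S5 (every transition-free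
stretch, in particular the Euler stretch `1 ≪ x ≪ κ⁻¹` where, after the Langer split `g ↦ −1/(4x²)`, LG is EXACT and `𝒱 = O(‖perturbation‖_{L¹(dlog x)})`
is κ-INDEPENDENT — sibling card olver-log-throat S1, Olver Ch. 6 Ex. 1.4; triage r1-2 (a): without the split the booking is vacuous);
precedent on this very equation: Gajic arXiv:2302.06636 §3.2 (3.16) "uniformly in m … [Olv74, §6.2, Theorem 2.2]". -/
theorem stub_lgErrorBound :
    (∀ (u α β : ℝ) (f f' f'' g : ℝ → ℝ), 0 < u → α ≤ β →
        (∀ t ∈ Icc α β, HasDerivAt f (f' t) t ∧ HasDerivAt f' (f'' t) t) →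
        ContinuousOn f'' (Icc α β) → ContinuousOn g (Icc α β) → (∀ t ∈ Icc α β, 0 < f t) →
        ∃ (w₁ w₁' w₂ w₂' ε₁ ε₁' ε₂ ε₂' : ℝ → ℝ),
          (∀ x ∈ Icc α β,
              w₁ x = (f x) ^ (-(1 / 4 : ℝ)) * Real.exp (u * ∫ t in α..x, Real.sqrt (f t)) * (1 + ε₁ x) ∧
              w₂ x = (f x) ^ (-(1 / 4 : ℝ)) * Real.exp (-(u * ∫ t in α..x, Real.sqrt (f t))) * (1 + ε₂ x) ∧
              |ε₁ x| ≤ Real.exp (u⁻¹ * ∫ t in α..x, |5 * f' t ^ 2 / (16 * (f t) ^ (5 / 2 : ℝ)) - f'' t / (4 * (f t) ^ (3 / 2 : ℝ)) - g t / Real.sqrt (f t)|) - 1 ∧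
              |ε₂ x| ≤ Real.exp (u⁻¹ * ∫ t in x..β, |5 * f' t ^ 2 / (16 * (f t) ^ (5 / 2 : ℝ)) - f'' t / (4 * (f t) ^ (3 / 2 : ℝ)) - g t / Real.sqrt (f t)|) - 1 ∧
              |ε₁' x| ≤ 2 * u * Real.sqrt (f x) * (Real.exp (u⁻¹ * ∫ t in α..x, |5 * f' t ^ 2 / (16 * (f t) ^ (5 / 2 : ℝ)) - f'' t / (4 * (f t) ^ (3 / 2 : ℝ)) - g t / Real.sqrt (f t)|) - 1) ∧
              |ε₂' x| ≤ 2 * u * Real.sqrt (f x) * (Real.exp (u⁻¹ * ∫ t in x..β, |5 * f' t ^ 2 / (16 * (f t) ^ (5 / 2 : ℝ)) - f'' t / (4 * (f t) ^ (3 / 2 : ℝ)) - g t / Real.sqrt (f t)|) - 1)) ∧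
          ε₁ α = 0 ∧ ε₂ β = 0 ∧
          ContinuousOn w₁ (Icc α β) ∧ ContinuousOn w₁' (Icc α β) ∧
          ContinuousOn w₂ (Icc α β) ∧ ContinuousOn w₂' (Icc α β) ∧
          (∀ x ∈ Ioo α β,
              HasDerivAt ε₁ (ε₁' x) x ∧ HasDerivAt ε₂ (ε₂' x) x ∧
              HasDerivAt w₁ (w₁' x) x ∧ HasDerivAt w₁' ((u ^ 2 * f x + g x) * w₁ x) x ∧
              HasDerivAt w₂ (w₂' x) x ∧ HasDerivAt w₂' ((u ^ 2 * f x + g x) * w₂ x) x)) ∧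
    (∀ (u α β : ℝ) (f f' f'' g : ℝ → ℝ), 0 < u → α ≤ β →
        (∀ t ∈ Icc α β, HasDerivAt f (f' t) t ∧ HasDerivAt f' (f'' t) t) →
        ContinuousOn f'' (Icc α β) → ContinuousOn g (Icc α β) → (∀ t ∈ Icc α β, f t < 0) →
        ∃ (w w' ε ε' : ℝ → ℂ),
          (∀ x ∈ Icc α β,
              w x = (((-f x) ^ (-(1 / 4 : ℝ)) : ℝ) : ℂ) *
                  Complex.exp (Complex.I * ((u * ∫ t in α..x, Real.sqrt (-f t) : ℝ) : ℂ)) * (1 + ε x) ∧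
              ‖ε x‖ ≤ Real.exp (u⁻¹ * ∫ t in α..x, |5 * f' t ^ 2 / (16 * (-f t) ^ (5 / 2 : ℝ)) + f'' t / (4 * (-f t) ^ (3 / 2 : ℝ)) - g t / Real.sqrt (-f t)|) - 1 ∧
              ‖ε' x‖ ≤ 2 * u * Real.sqrt (-f x) * (Real.exp (u⁻¹ * ∫ t in α..x, |5 * f' t ^ 2 / (16 * (-f t) ^ (5 / 2 : ℝ)) + f'' t / (4 * (-f t) ^ (3 / 2 : ℝ)) - g t / Real.sqrt (-f t)|) - 1)) ∧
          ε α = 0 ∧ ContinuousOn w (Icc α β) ∧ ContinuousOn w' (Icc α β) ∧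
          (∀ x ∈ Ioo α β,
              HasDerivAt ε (ε' x) x ∧ HasDerivAt w (w' x) x ∧
              HasDerivAt w' (((u ^ 2 * f x + g x : ℝ) : ℂ) * w x) x)) :=
  -- LANDED (wave 1): see the imported Theorems module
  Summit.FinalStateConjecture.FinalStateConjecture.Theorems.KappaExplicitWaveDecay.OlverDunsterUniformReduction.stub_lgErrorBound

/-- **S3 · `stub_coneCensus` — NO WELL in the near-extremal threshold cone (the semialgebraic transition-point census).**
For every `M > 0` there are `a₁ < M` and `ε₀ > 0` such that for all spins `a₁ ≤ |a| < M` and all admissible triples (DRSR Def. 6.1.1,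
`Λ ≥ |m|(|m|+1)`, `Λ ≥ 2|amω|`) with `m ≠ 0` in the cone `|ω − mω₊| ≤ ε₀|m|`, the classically FORBIDDEN set of the principal symbol,
`{r > r₊ : K(r)² − Δ(r)(Λ − 2amω) ≤ 0}` (`K² − ΔΛ′ = (r² + a²)²(ω² − V₀)`, `V₀ = Kerr.sepPotential₀`; in blown-up units `k² − Λ′x(x+1)`),
is ORDER-CONNECTED: one (possibly empty or degenerate) barrier between the horizon end (`K(r₊)² = ((r₊²+a²)(ω − mω₊))² ≥ 0`: allowed) and
the far end (`ω²r⁴`: allowed) — no well, no detached tangency, hence at most two turning points and the finite list of coalescences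
{none, two simple, Weber pair at the barrier top `ξ̃_trap = (1 − δ̃)/2 > 0` (never superradiant: discriminant `η(η + 4|ξ̃| + 4ξ̃²) > 0`,
Disproof §7), inner turning point ∧ double pole as `ξ̃ → 0`, Euler-index junction `D(ω,Λ) = 4r₊²ω² − Λ′ − ¼ → 0` (triage F3)}.
Why plausibly true: a quartic in `r` with `P(r₊) ≥ 0`, `P(+∞) = +∞`; at `a = M`, `ω = mω₊` it is `(r − M)²·ω²·(…)` times
`−[4M²Λ − m²(r² + 2Mr + 5M²)]`-sign, monotone in `r` (triage r1-1 C1, r1-3 re-derivation) — one sign change at most; the face quadratic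
`δ̃²x² + (2ξ̃ − 1 + δ̃²)x + ξ̃²` has an order-convex forbidden set (`noWells_frontFace`, PROVED by ideator 3); three independent numerical
censuses of the TRUE quartic (desk 8649 configurations `|m| ≤ 10³`, `a ≤ 1 − 10⁻⁶`; kit j008834: 42 484 in-cone samples incl. the full
`V₀ + V₁`; kit j008363) found ZERO wells and no detached far pair at cone frequencies. Decidable (Tarski; `a₁`, `ε₀` explicit rationals
would make it `norm_num`/certificate-checkable sector by sector). Why it might fail: a thin well near the BF line `Λ ≈ 2m²`, `ω ≈ mω₊`
between census grid points (the A₂ corner `Λ = 2m², ω = m/2M, r = M` at `κ = 0` unfolds into `κ > 0`; the censuses approach it from the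
no-well side only, triage r1-2 on tame-no-flat-trapping) — a single in-cone well kills this stub, the finite model list of S5, and (by
tunnelling resonances) threatens the crux itself. Leans on: `Kerr.radialK`, `Kerr.delta`, `Kerr.IsAdmissibleTriple`,
`Kerr.horizonAngularVelocity`; `Kerr.sepPotential₀` / `KerrSeparatedTrapping.sepPotential₀_trichotomy` (the fixed-`a` far structure);
Disproof §7. Size M. Used by: S5 ("the dominant term cannot cancel across a single barrier"). -/
theorem stub_coneCensus :
    (∀ M : ℝ, 0 < M → ∃ a₁ ε₀ : ℝ, a₁ < M ∧ 0 < ε₀ ∧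
      ∀ a : ℝ, a₁ ≤ |a| → Kerr.IsSubextremal M a →
        ∀ (ω : ℝ) (m : ℤ) (Λ : ℝ), Kerr.IsAdmissibleTriple a ω m Λ → m ≠ 0 →
          |ω - m * Kerr.horizonAngularVelocity M a| ≤ ε₀ * |(m : ℝ)| →
            (Ioi (Kerr.rPlus M a) ∩
              {r : ℝ | Kerr.radialK a ω m r ^ 2 - Kerr.delta M a r * (Λ - 2 * a * m * ω) ≤ 0}).OrdConnected) :=
  -- LANDED (wave 1): see the imported Theorems module
  Summit.FinalStateConjecture.FinalStateConjecture.Theorems.KappaExplicitWaveDecay.OlverDunsterUniformReduction.stub_coneCensus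

/-- **S5a-R · `stub_tortoiseReduction` — the TdC kernel bound from its tortoise-variable core, for ANY frequency regime `P` invariant
under `(ω, m) ↦ (−ω, −m)` (lead seat c2, v4; plumbing over the wave-1 bridges, no new mathematics).** Given the analytic core in Carter's
variables (the hypothesis: for solutions `u_𝓗, u_𝓘` of `u″ + (ω² − V(ρ x))u = 0` along a tortoise radius with the horizon/infinity data
`‖u‖ → 1`, `‖u′‖ → |ω − mω₊|` resp. `|ω|`, fluxes `−(ω − mω₊)` resp. `ω`, and `0 < m`, the two-point bound
`‖u_𝓗(x)‖‖u_𝓘(x′)‖ ≤ C|m|^Nκ^{-N}‖W‖` for `x ≤ x′`, `ρ x′ ≥ r₊ + θ(r₊−r₋)`), conclude the registered R-language bound for the TdC-normalised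
pair (`m ≠ 0`). HOW: WLOG `0 < m` by `Costa2019.coneKernelBound_of_pos` (TeukolskyRadialConjugation, needs the `P`-invariance); shrink `ε₀`
so that `ω ≠ 0` in the cone (`Costa2019.abs_omega_lower_of_cone`, TeukolskyRadialFlux); pick `ρ` (`Kerr.exists_isTortoiseRadius`), write
`r = ρ x`, `r′ = ρ x′` (ρ is a strictly monotone surjection onto `(r₊, ∞)`: continuity + `tendsto_atBot/atTop`), put `u := √(ρ²+a²)·R∘ρ` with the
witnesses of `Kerr.schrodingerForm` (its 3rd conjunct is the equation, its 4th identifies `u₁` with `(Δ/(r²+a²))·deriv(√(r²+a²)R)`), get the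
data from `Costa2019.tendsto_norm_(deriv_)horizonSolution` / `…infinitySolution` composed with `ρ → r₊⁺` / `ρ → ∞`, the fluxes from
`Costa2019.radialFlux_eq_of_normalisedHorizon/Infinity` (`Im(ū u₁) = Δ·Im(R̄R′)`), and convert the conclusion with `‖u x‖ = √(r²+a²)‖R r‖` and
`Kerr.wronskian_schrodingerForm` (`u_𝓗u_𝓘′ − u_𝓘u_𝓗′ = Kerr.radialWronskian M a 0 R_𝓗 R_𝓘 (ρ x)`). Size M–L (worker). -/
theorem stub_tortoiseReduction :
    ∀ P : ℝ → ℝ → ℝ → ℤ → Prop, (∀ M a ω m, P M a ω m → P M a (-ω) (-m)) →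
    (∀ M : ℝ, 0 < M → ∀ θ : ℝ, 0 < θ → ∃ (a₁ ε₀ C : ℝ) (N : ℕ), a₁ < M ∧ 0 < ε₀ ∧ 0 < C ∧
      ∀ a : ℝ, a₁ ≤ |a| → Kerr.IsSubextremal M a →
        ∀ (ω : ℝ) (m : ℤ) (Λ : ℝ), Kerr.IsAdmissibleTriple a ω m Λ → 0 < m →
          |ω - m * Kerr.horizonAngularVelocity M a| ≤ ε₀ * |(m : ℝ)| → P M a ω m →
            ∀ ρ : ℝ → ℝ, Kerr.IsTortoiseRadius M a ρ →
            ∀ uH uH₁ uI uI₁ : ℝ → ℂ,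
              (∀ x, HasDerivAt uH (uH₁ x) x ∧
                HasDerivAt uH₁ (-(((ω ^ 2 - Kerr.sepPotential M a ω m Λ (ρ x) : ℝ) : ℂ) * uH x)) x) →
              (∀ x, HasDerivAt uI (uI₁ x) x ∧
                HasDerivAt uI₁ (-(((ω ^ 2 - Kerr.sepPotential M a ω m Λ (ρ x) : ℝ) : ℂ) * uI x)) x) →
              Tendsto (fun x ↦ ‖uH x‖) atBot (𝓝 1) →
              Tendsto (fun x ↦ ‖uH₁ x‖) atBot (𝓝 |ω - m * Kerr.horizonAngularVelocity M a|) →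
              (∀ x, (starRingEnd ℂ (uH x) * uH₁ x).im = -(ω - m * Kerr.horizonAngularVelocity M a)) →
              Tendsto (fun x ↦ ‖uI x‖) atTop (𝓝 1) →
              Tendsto (fun x ↦ ‖uI₁ x‖) atTop (𝓝 |ω|) →
              (∀ x, (starRingEnd ℂ (uI x) * uI₁ x).im = ω) →
                ∀ x x' : ℝ, x ≤ x' → Kerr.rPlus M a + θ * (Kerr.rPlus M a - Kerr.rMinus M a) ≤ ρ x' →
                  ‖uH x‖ * ‖uI x'‖ ≤
                    C * |(m : ℝ)| ^ N * (Kerr.surfaceGravity M a)⁻¹ ^ N * ‖uH x * uI₁ x - uI x * uH₁ x‖) →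
    (∀ M : ℝ, 0 < M → ∀ θ : ℝ, 0 < θ → ∃ (a₁ ε₀ C : ℝ) (N : ℕ), a₁ < M ∧ 0 < ε₀ ∧ 0 < C ∧
      ∀ a : ℝ, a₁ ≤ |a| → Kerr.IsSubextremal M a →
        ∀ (ω : ℝ) (m : ℤ) (Λ : ℝ), Kerr.IsAdmissibleTriple a ω m Λ → m ≠ 0 →
          |ω - m * Kerr.horizonAngularVelocity M a| ≤ ε₀ * |(m : ℝ)| → P M a ω m →
            ∀ RH RI : ℝ → ℂ,
              Kerr.IsRadialTeukolskySolution M a 0 ω m (Λ - a ^ 2 * ω ^ 2) RH →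
              Kerr.IsNormalisedHorizonSolution M a 0 ω m RH →
              Kerr.IsRadialTeukolskySolution M a 0 ω m (Λ - a ^ 2 * ω ^ 2) RI →
              Kerr.IsNormalisedInfinitySolution M 0 ω RI →
                ∀ r r' : ℝ, Kerr.rPlus M a < r → r ≤ r' →
                  Kerr.rPlus M a + θ * (Kerr.rPlus M a - Kerr.rMinus M a) ≤ r' →
                    Real.sqrt (r ^ 2 + a ^ 2) * ‖RH r‖ * (Real.sqrt (r' ^ 2 + a ^ 2) * ‖RI r'‖) ≤
                      C * |(m : ℝ)| ^ N * (Kerr.surfaceGravity M a)⁻¹ ^ N * ‖Kerr.radialWronskian M a 0 RH RI r‖) :=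
  -- LANDED (seat c2, wave 2, p120896): see the imported Theorems module
  Summit.FinalStateConjecture.FinalStateConjecture.Theorems.KappaExplicitWaveDecay.OlverDunsterUniformReduction.stub_tortoiseReduction

/-- **S5a-F-census · `stub_fullConeCensus` — NO WELL for the FULL potential in the threshold cone (lead seat c2, v5).** For every `M > 0` there are
`a₁ < M`, `ε₀ > 0` such that for `a₁ ≤ |a| < M`, admissible `(ω, m, Λ)` with `m ≠ 0` in the cone `|ω − mω₊| ≤ ε₀|m|`, the classically forbidden set of Carter's
potential `V = Kerr.sepPotential = V₀ + V₁` (DRSR §6.2), `{r > r₊ : ω² ≤ V(r)}`, is ORDER-CONNECTED — one barrier (possibly empty), no well. The landed S3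
`stub_coneCensus` is the same statement for the principal part `V₀` (there it holds for ALL real parameters: the symbol `K² − ΔΛ′` has no cubic term); `V₁ ≥ 0`
(`Kerr.sepPotential₁_nonneg`) can only ENLARGE the forbidden set, and for `m = 1, 2` it does change it at order one (at the corner `a = M`, `ω = 1/2M`, `(m, ℓ) = (1,1)`:
`V₀ < ω²` on `(M, ∞)` while `V(1.5M) − ω² ≈ +1.6·10⁻³/M²`), so this is NOT a corollary of S3. Why true: at the corner `(r²+a²)⁴(ω² − V) = (r − M)²·H(r)` with `H` a sextic of
positive leading coefficient, and `dV₀/dr ∝ −2(r − M)·B(r)` with the explicit quadratic `B` of `KerrSeparatedPotentialCorner` (`critPoly_corner`; sign across `Λ = 2m²`); the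
cone is a small perturbation concentrated at `r = M`. Numerics (this seat, 70-digit arithmetic, `work/census_full.py`): 4 273 in-cone configurations (`a = 1 − 10^{-k}`,
`k = 3, 5, 8`; `m = 1, 2, 3, 6`; `Λ` from `|m|(|m|+1)` to `10⁴×`; `(ω − mω₊)/m ∈ [−0.3, 0.3]` incl. `±10⁻¹⁰…`; radial grid down to `r − r₊ = 10⁻¹⁴r₊`): maximal number of
forbidden components = 1 (a double-precision version of the same scan shows up to 28 spurious components from cancellation — use exact/high-precision arithmetic);
kit j008834 (ideator 3): 42 484 in-cone samples of the full `V₀ + V₁`, `m ≤ 30`, zero wells. Why it might fail: a thin well at large `Λ/m²` with `ω − mω₊ ≍ κ` between grid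
points (the A₂ corner) — a single in-cone well kills the kernel bound itself (tunnelling resonance), not only this stub. Leans on: `Kerr.sepPotential(_eq)`,
`KerrSeparatedTrapping` (V₀ trichotomy), `KerrSeparatedPotentialCorner`, `KerrSeparatedPotentialCriticalPoints` (≤ 7 critical points). Size M–L (real algebra; decidable in
principle). -/
theorem stub_fullConeCensus :
    (∀ M : ℝ, 0 < M → ∃ a₁ ε₀ : ℝ, a₁ < M ∧ 0 < ε₀ ∧
      ∀ a : ℝ, a₁ ≤ |a| → Kerr.IsSubextremal M a →
        ∀ (ω : ℝ) (m : ℤ) (Λ : ℝ), Kerr.IsAdmissibleTriple a ω m Λ → m ≠ 0 →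
          |ω - m * Kerr.horizonAngularVelocity M a| ≤ ε₀ * |(m : ℝ)| →
            (Ioi (Kerr.rPlus M a) ∩ {r : ℝ | ω ^ 2 ≤ Kerr.sepPotential M a ω m Λ r}).OrdConnected) :=
  -- LANDED (lead c4 wave 1 worker `census`): Literature KerrSeparatedPotentialConeLevel{Tables,} p135044 p135465 + the imported Theorems module p135637
  Summit.FinalStateConjecture.FinalStateConjecture.Theorems.KappaExplicitWaveDecay.OlverDunsterUniformReduction.stub_fullConeCensus

/-! ### v6 (lead seat c3): two GENERIC ODE stubs, the Λ-polynomial flux-regime core, plumbing, threshold, S6 -/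

/-- **E1 · `stub_tameZoneTransport` — transport of the `η`-energy across a tame zone (generic real ODE; lead seat c3, v6).** Let `u″ = −φu` on
`[t 0, t k]` (complex `u`, real continuous `φ` with a derivative), where `φ` is monotone or antitone on each of the `k` consecutive pieces
`[t i, t (i+1)]`, and `−η² ≤ φ ≤ Φ` throughout (`0 < η`, `η² ≤ Φ`): no deep forbidden sub-zone, but `φ` may vanish or change sign (turning points,
shallow barriers). Then for ANY two points `x, y` of the zone the `η`-energy `E = η²‖u‖² + ‖u′‖²` satisfies
`E(y) ≤ (Φ/η²)^{2k} · exp(2η (t k − t 0)) · E(x)`. WHY TRUE: on a monotone piece the sets `{φ < η²}` and `{φ ≥ η²}` are two intervals; on the first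
`|φ| ≤ η²` and the zone energy `η²‖u‖² + ‖u′‖²` changes by at most `exp(2η·length)` (`TransitionZoneGrowth.zoneEnergy_le_zoneEnergy_mul_exp` with `Kₑ = η`);
on the second `E ≤ T := φ‖u‖² + ‖u′‖² ≤ (Φ/η²)E` and `T` changes by at most the factor `Φ/η²` (`SoninPiecewise.soninEnergy_le_mul_ratio`, `φmin = η²`); at
the junction `φ = η²` the two energies coincide. Per piece the factor is `(Φ/η²)²·exp(2η ℓᵢ)`; multiply over the pieces between `x` and `y` (all factors
`≥ 1`). Leans on: `Literature.Analysis.ODE.TransitionZoneGrowth`, `SoninPiecewise`, `SoninEnvelope`. Size M (worker). Used by: `stub_fluxRegimeCorePoly`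
(a-priori envelopes of `u_H` between the horizon and the barrier and of `u_I` between `r = 7M` and the barrier, with `η ≍ δκ`). -/
theorem stub_tameZoneTransport :
    ∀ (k : ℕ) (t : ℕ → ℝ) (u u' : ℝ → ℂ) (φ φ' : ℝ → ℝ) (η Φ : ℝ),
      (∀ i < k, t i ≤ t (i + 1)) →
      (∀ x ∈ Icc (t 0) (t k), HasDerivAt u (u' x) x ∧ HasDerivAt u' (-((φ x : ℂ) * u x)) x) →
      (∀ x ∈ Icc (t 0) (t k), HasDerivAt φ (φ' x) x) →
      (∀ i < k, MonotoneOn φ (Icc (t i) (t (i + 1))) ∨ AntitoneOn φ (Icc (t i) (t (i + 1)))) →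
      0 < η → η ^ 2 ≤ Φ →
      (∀ x ∈ Icc (t 0) (t k), -η ^ 2 ≤ φ x ∧ φ x ≤ Φ) →
        ∀ x ∈ Icc (t 0) (t k), ∀ y ∈ Icc (t 0) (t k),
          η ^ 2 * ‖u y‖ ^ 2 + ‖u' y‖ ^ 2 ≤
            (Φ / η ^ 2) ^ (2 * k) * Real.exp (2 * η * (t k - t 0)) * (η ^ 2 * ‖u x‖ ^ 2 + ‖u' x‖ ^ 2) :=
  -- LANDED (seat c3, p126383): see the imported Theorems module
  Summit.FinalStateConjecture.FinalStateConjecture.Theorems.KappaExplicitWaveDecay.OlverDunsterUniformReduction.stub_tameZoneTransport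

/-- **E2 · `stub_barrierProductBound` — two-point bound for a pair of complex solutions inside a forbidden interval (generic real ODE; lead
seat c3, v6; replaces the use of the maximum principle `DiagonalKernelMaximum`, which needs `q ≥ q₀ > 0`).** Let `u, v` solve `y″ = q y` on `[a, b]`
with `q ≥ 0` (so `f = ‖u‖²`, `g = ‖v‖²` are CONVEX, `SoninEnvelope.convexOn_norm_sq_of_nonneg`), and suppose the two pairing inequalities
`g ≤ A·f`, `f ≤ B·g` hold pointwise on `[a, b]` (for the horizon/infinity pair of a radial problem they hold at EVERY point with `A = ‖W‖²/σ²`,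
`B = ‖W‖²/ω²` by flux conservation). Then for `a ≤ x ≤ y ≤ b`:
`‖u x‖‖v y‖ ≤ 2(√A‖u a‖² + √B‖v b‖² + (b − a)‖W‖ + ‖u a‖‖v b‖)`, `W = u(a)v′(a) − v(a)u′(a)` (constant). WHY TRUE (elementary): (1) DIAGONAL — let
`z` maximise `P = fg` on `[a, b]`; at the ends `P(a) ≤ A f(a)²`, `P(b) ≤ B g(b)²`; at an interior maximum `P′(z) = 0`, and from
`ū v̄ W = f(v̄v′) − g(ūu′)`, `Re = (fg′ − gf′)/2 = −f′g` one gets `fg‖W‖² ≥ f′²g²`, i.e. `P(z) ≤ ‖W‖²(f/f′)²(z)`; with `c_f, c_g` the minimisers of the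
convex `f, g`: if `z ≤ c_f` then `f(z) ≤ f(a)` and `P ≤ A f(a)²`; if `z ≥ c_g` then `P ≤ B g(b)²`; otherwise `f` increases at `z` and either
`f(z) < 2f(c_f) ≤ 2f(a)` (`P ≤ 4A f(a)²`) or the secant inequality of the convex `f` gives `f′(z) ≥ (f(z) − f(c_f))/(z − c_f) ≥ f(z)/(2(b − a))`, so
`P(z) ≤ 4(b − a)²‖W‖²`. (2) OFF-DIAGONAL `x ≤ y`: if `‖u x‖ ≤ ‖u y‖` the product is `≤ √P(y)`; else convexity of `f` on `[a, y]` gives `f(x) ≤ f(a)`, and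
convexity of `g` on `[x, b]` gives `g(y) ≤ g(b)` (product `≤ ‖u a‖‖v b‖`) or `g(y) ≤ g(x)` (product `≤ √P(x)`). Leans on: `SoninEnvelope`
(`convexOn_norm_sq_of_nonneg`, `norm_sq_le_max_of_nonneg`, `hasDerivAt_norm_sq_complex`), `DiagonalKernelMaximum.wronskian_complex_const`, Mathlib
`IsLocalMax.hasDerivAt_eq_zero`, `ConvexOn` secant/derivative inequalities, `IsCompact.exists_isMaxOn`. Size M (worker). Used by: `stub_fluxRegimeCorePoly`. -/
theorem stub_barrierProductBound :
    ∀ (u u' v v' : ℝ → ℂ) (q : ℝ → ℝ) (a b A B : ℝ),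
      (∀ x ∈ Icc a b, HasDerivAt u (u' x) x ∧ HasDerivAt u' ((q x : ℂ) * u x) x) →
      (∀ x ∈ Icc a b, HasDerivAt v (v' x) x ∧ HasDerivAt v' ((q x : ℂ) * v x) x) →
      (∀ x ∈ Icc a b, 0 ≤ q x) → 0 ≤ A → 0 ≤ B →
      (∀ x ∈ Icc a b, ‖v x‖ ^ 2 ≤ A * ‖u x‖ ^ 2) →
      (∀ x ∈ Icc a b, ‖u x‖ ^ 2 ≤ B * ‖v x‖ ^ 2) →
        ∀ x ∈ Icc a b, ∀ y ∈ Icc a b, x ≤ y →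
          ‖u x‖ * ‖v y‖ ≤
            2 * (Real.sqrt A * ‖u a‖ ^ 2 + Real.sqrt B * ‖v b‖ ^ 2 + (b - a) * ‖u a * v' a - v a * u' a‖ +
              ‖u a‖ * ‖v b‖) :=
  -- LANDED (seat c3, p126199): see the imported Theorems module
  Summit.FinalStateConjecture.FinalStateConjecture.Theorems.KappaExplicitWaveDecay.OlverDunsterUniformReduction.stub_barrierProductBound

/-- **S5-core · `stub_fluxRegimeCorePoly` — the ANALYTIC CORE of the flux-regime kernel bound in the tortoise variable, Λ-POLYNOMIAL constants
(lead seat c3, v6; supersedes `stub_fluxRegimeCoreOfCensus`, false uniformly in `Λ`; v7.1 (lead c4): the two generic lemmas E1, E2 are LANDED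
theorems and no longer hypotheses, and the census hypothesis is spelled out verbatim instead of `type_of% stub_fullConeCensus`, so that the
stub can be proved in a Theorems file where no decl `stub_fullConeCensus` exists).** GIVEN the census `stub_fullConeCensus` (as the first hypothesis): for every `δ > 0`, `M > 0`, `θ > 0` there are `a₁ < M`, `ε₀ > 0`, `C > 0`, `N` such that for `a₁ ≤ |a| < M`,
admissible `(ω, m, Λ)` with `0 < m` in the cone `|ω − mω₊| ≤ ε₀|m|`, `δκ ≤ |ω − mω₊|`, `ω(ω − mω₊) ≥ 0`, every tortoise radius `ρ`, every pair
`u_H, u_I` of solutions of `u″ + (ω² − V(ρ x))u = 0` (`V = Kerr.sepPotential M a ω m Λ`) with the horizon data (`‖u_H‖ → 1`, `‖u_H′‖ → |ω − mω₊|`,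
flux `−(ω − mω₊)`) and infinity data (`‖u_I‖ → 1`, `‖u_I′‖ → |ω|`, flux `ω`), and all `x ≤ x′` with `ρ x′ ≥ r₊ + θ(r₊ − r₋)`:
`‖u_H(x)‖‖u_I(x′)‖ ≤ C Λ^N κ^{-N} ‖u_H u_I′ − u_I u_H′‖(x)`. PLAN (elementary; `σ := ω − mω₊ ≥ δκ > 0`, `ω > 0` in the cone): (0) PAIRING at every point
(`im_conj_mul_det` + constant fluxes): `ω‖u_H‖² + σ‖u_I‖² = Im(conj(u_Hu_I)W) ≤ ‖u_H‖‖u_I‖‖W‖`, hence `‖u_H‖ ≤ ‖u_I‖‖W‖/ω`, `‖u_I‖ ≤ ‖u_H‖‖W‖/σ`,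
`‖W‖ ≥ 2√(ωσ)`. (1) BARRIER: by the census `{x : ω² ≤ V(ρ x)}` is a compact interval `[b₁, b₂]` or empty (`φ → σ² > 0` at `−∞`, `→ ω² > 0` at `+∞`);
since `V` is strictly decreasing on `[7M, ∞)` (`Kerr.strictAntiOn_sepPotential_Ici`), `b₁ ≤ x₇ := ρ⁻¹(7M)` whenever the barrier meets `r ≥ 7M`.
(2) ENVELOPE of `u_H` on `(−∞, b₁]` (or on `(−∞, x₇]` / everything left of the barrier): with `D₁ := 24Λ/M³ + 184/M³ ≥ sup|dV/dr|`
(`Kerr.abs_deriv_sepPotential_le`) and `x_a := ρ⁻¹(r₊ + σ²/(2D₁))`, `φ ≥ σ²/2` on `(−∞, x_a]` (so `T = φ‖u‖² + ‖u′‖² ≤ 4^8·2σ²` there from the limit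
`2σ²` at `−∞`, `SoninPiecewise.soninEnergy_le_pow_ratio` with ≤ 8 monotone pieces of `V`, `Kerr.sepPotential_monotone_partition` transported by the
strictly monotone `ρ`), then E1 on `[x_a, ·]` with `η := min(δ,1)κ/2`, `Φ := ω² + 3Λ/M² + 3/M²` (`Kerr.abs_sepPotential_le`) and the tortoise length
`≤ (25/κ)·log(2D₁(7M − r₊)/σ²)` (`d/dx log(ρ − r₊) = (ρ − r₋)/(ρ² + a²) ≥ κ/25` on `ρ ≤ 7M`): `‖u_H‖² ≤ P_H²` polynomial in `(Λ, κ⁻¹)`.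
(3) ENVELOPE of `u_I` on `[b₂, ∞)`: on `ρ ≥ 7M`, `T′ = φ′‖u‖² ≥ 0` and `T(+∞) = 2ω²`, so `‖u_I′‖ ≤ √2|ω|` where `φ ≥ 0` and `‖u_I‖ ≤ 2` for
`ρ ≥ R_far := max(7M, √(12Λ)/|ω|, 1/(Mω²))` (`φ ≥ ω²/2` there); linear growth (`norm_image_sub_le_of_norm_deriv_le_segment`) over the tortoise length
`≤ (7/5)R_far` gives `‖u_I‖ ≤ 2 + 2|ω|R_far` on `[max(b₂, x₇), ∞)`; if `b₂ < x₇`, continue inward by E1 (mirror `x ↦ −x`) down to `b₂` (or to `x_a` and then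
by `soninEnergy_le_pow_ratio` to `−∞` when there is no barrier). (4) CASES for `x ≤ x′`: both left of the barrier — pairing, `≤ ‖W‖P_H²/σ`; both right —
`≤ ‖W‖P_I²/ω`; `x` left, `x′` right — `≤ P_HP_I ≤ P_HP_I‖W‖/(2√(ωσ))`; `x′ ∈ [b₁,b₂]`, `x < b₁` — convexity of `‖u_I‖²` on the barrier
(`norm_sq_le_max_of_nonneg`) and pairing at `b₁`; symmetric case; both in the barrier — E2 with `A = ‖W‖²/σ²`, `B = ‖W‖²/ω²`, `b − a ≤` the tortoise
length of the barrier `≤ (25/κ)log(2D₁(7M − r₊)/σ²) + (7/5)R_far`. Every constant is a monomial in `Λ`, `κ⁻¹`, `δ⁻¹`, `M^{±1}` (`|m| ≤ √Λ`,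
`ω ∈ [mω₊/2, 2mω₊]`, `ω₊ ≥ a₁/(4M²)`), whence `C(M, δ, θ)Λ^Nκ^{-N}`. Why it might fail: only bookkeeping (the mathematics is the flux identity,
Sonin monotonicity, convexity). Size XL (lead). -/
theorem stub_fluxRegimeCorePoly :
    (∀ M : ℝ, 0 < M → ∃ a₁ ε₀ : ℝ, a₁ < M ∧ 0 < ε₀ ∧
      ∀ a : ℝ, a₁ ≤ |a| → Kerr.IsSubextremal M a →
        ∀ (ω : ℝ) (m : ℤ) (Λ : ℝ), Kerr.IsAdmissibleTriple a ω m Λ → m ≠ 0 →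
          |ω - m * Kerr.horizonAngularVelocity M a| ≤ ε₀ * |(m : ℝ)| →
            (Ioi (Kerr.rPlus M a) ∩ {r : ℝ | ω ^ 2 ≤ Kerr.sepPotential M a ω m Λ r}).OrdConnected) →
    ∀ δ : ℝ, 0 < δ →
    (∀ M : ℝ, 0 < M → ∀ θ : ℝ, 0 < θ → ∃ (a₁ ε₀ C : ℝ) (N : ℕ), a₁ < M ∧ 0 < ε₀ ∧ 0 < C ∧
      ∀ a : ℝ, a₁ ≤ |a| → Kerr.IsSubextremal M a →
        ∀ (ω : ℝ) (m : ℤ) (Λ : ℝ), Kerr.IsAdmissibleTriple a ω m Λ → 0 < m →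
          |ω - m * Kerr.horizonAngularVelocity M a| ≤ ε₀ * |(m : ℝ)| → (δ * Kerr.surfaceGravity M a ≤ |ω - m * Kerr.horizonAngularVelocity M a| ∧
            0 ≤ ω * (ω - m * Kerr.horizonAngularVelocity M a)) →
            ∀ ρ : ℝ → ℝ, Kerr.IsTortoiseRadius M a ρ →
            ∀ uH uH₁ uI uI₁ : ℝ → ℂ,
              (∀ x, HasDerivAt uH (uH₁ x) x ∧
                HasDerivAt uH₁ (-(((ω ^ 2 - Kerr.sepPotential M a ω m Λ (ρ x) : ℝ) : ℂ) * uH x)) x) →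
              (∀ x, HasDerivAt uI (uI₁ x) x ∧
                HasDerivAt uI₁ (-(((ω ^ 2 - Kerr.sepPotential M a ω m Λ (ρ x) : ℝ) : ℂ) * uI x)) x) →
              Tendsto (fun x ↦ ‖uH x‖) atBot (𝓝 1) →
              Tendsto (fun x ↦ ‖uH₁ x‖) atBot (𝓝 |ω - m * Kerr.horizonAngularVelocity M a|) →
              (∀ x, (starRingEnd ℂ (uH x) * uH₁ x).im = -(ω - m * Kerr.horizonAngularVelocity M a)) →
              Tendsto (fun x ↦ ‖uI x‖) atTop (𝓝 1) →
              Tendsto (fun x ↦ ‖uI₁ x‖) atTop (𝓝 |ω|) →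
              (∀ x, (starRingEnd ℂ (uI x) * uI₁ x).im = ω) →
                ∀ x x' : ℝ, x ≤ x' → Kerr.rPlus M a + θ * (Kerr.rPlus M a - Kerr.rMinus M a) ≤ ρ x' →
                  ‖uH x‖ * ‖uI x'‖ ≤
                    C * Λ ^ N * (Kerr.surfaceGravity M a)⁻¹ ^ N * ‖uH x * uI₁ x - uI x * uH₁ x‖) :=
  -- LANDED (lead c4): Literature/Geometry/Lorentzian/CarterFluxKernelBound.lean p127905 + the imported Theorems module
  Summit.FinalStateConjecture.FinalStateConjecture.Theorems.KappaExplicitWaveDecay.OlverDunsterUniformReduction.stub_fluxRegimeCorePoly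

/-- **The flux-regime core along this line**: `stub_fluxRegimeCorePoly` applied to the two generic lemmas and the census. [folklore] -/
theorem fluxRegimeCorePoly_of (hE₁ : type_of% stub_tameZoneTransport) (hE₂ : type_of% stub_barrierProductBound)
    (hN : type_of% stub_fullConeCensus) (hC : type_of% stub_fluxRegimeCorePoly) :
    ∀ δ : ℝ, 0 < δ →
    (∀ M : ℝ, 0 < M → ∀ θ : ℝ, 0 < θ → ∃ (a₁ ε₀ C : ℝ) (N : ℕ), a₁ < M ∧ 0 < ε₀ ∧ 0 < C ∧
      ∀ a : ℝ, a₁ ≤ |a| → Kerr.IsSubextremal M a →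
        ∀ (ω : ℝ) (m : ℤ) (Λ : ℝ), Kerr.IsAdmissibleTriple a ω m Λ → 0 < m →
          |ω - m * Kerr.horizonAngularVelocity M a| ≤ ε₀ * |(m : ℝ)| → (δ * Kerr.surfaceGravity M a ≤ |ω - m * Kerr.horizonAngularVelocity M a| ∧
            0 ≤ ω * (ω - m * Kerr.horizonAngularVelocity M a)) →
            ∀ ρ : ℝ → ℝ, Kerr.IsTortoiseRadius M a ρ →
            ∀ uH uH₁ uI uI₁ : ℝ → ℂ,
              (∀ x, HasDerivAt uH (uH₁ x) x ∧
                HasDerivAt uH₁ (-(((ω ^ 2 - Kerr.sepPotential M a ω m Λ (ρ x) : ℝ) : ℂ) * uH x)) x) →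
              (∀ x, HasDerivAt uI (uI₁ x) x ∧
                HasDerivAt uI₁ (-(((ω ^ 2 - Kerr.sepPotential M a ω m Λ (ρ x) : ℝ) : ℂ) * uI x)) x) →
              Tendsto (fun x ↦ ‖uH x‖) atBot (𝓝 1) →
              Tendsto (fun x ↦ ‖uH₁ x‖) atBot (𝓝 |ω - m * Kerr.horizonAngularVelocity M a|) →
              (∀ x, (starRingEnd ℂ (uH x) * uH₁ x).im = -(ω - m * Kerr.horizonAngularVelocity M a)) →
              Tendsto (fun x ↦ ‖uI x‖) atTop (𝓝 1) →
              Tendsto (fun x ↦ ‖uI₁ x‖) atTop (𝓝 |ω|) →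
              (∀ x, (starRingEnd ℂ (uI x) * uI₁ x).im = ω) →
                ∀ x x' : ℝ, x ≤ x' → Kerr.rPlus M a + θ * (Kerr.rPlus M a - Kerr.rMinus M a) ≤ ρ x' →
                  ‖uH x‖ * ‖uI x'‖ ≤
                    C * Λ ^ N * (Kerr.surfaceGravity M a)⁻¹ ^ N * ‖uH x * uI₁ x - uI x * uH₁ x‖) :=
  hC hN

/-- **Cone Green-kernel bound in the FLUX REGIME, R-language, Λ-polynomial constant** (v6 form of `ConeKernelFluxRegime`). For `M > 0`, collar
`θ > 0` and `δ > 0` there are `a₁ < M`, `ε₀ > 0`, `C > 0`, `N` such that for all `a₁ ≤ |a| < M`, all admissible `(ω, m, Λ)` with `m ≠ 0` in the cone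
`|ω − mω₊| ≤ ε₀|m|` with `δκ ≤ |ω − mω₊|` and `ω(ω − mω₊) ≥ 0`, all normalised radial solutions `R_𝓗`, `R_𝓘` (TdC Def. 2.3, `s = 0`) and all
`r₊ < r ≤ r′` with `r′ ≥ r₊ + θ(r₊ − r₋)`: `√(r²+a²)|R_𝓗(r)|·√(r′²+a²)|R_𝓘(r′)| ≤ CΛ^Nκ^{-N}|𝔚(r)|`. [folklore] -/
abbrev ConeKernelFluxRegimePoly : Prop :=
    (∀ M : ℝ, 0 < M → ∀ θ : ℝ, 0 < θ → ∀ δ : ℝ, 0 < δ → ∃ (a₁ ε₀ C : ℝ) (N : ℕ), a₁ < M ∧ 0 < ε₀ ∧ 0 < C ∧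
      ∀ a : ℝ, a₁ ≤ |a| → Kerr.IsSubextremal M a →
        ∀ (ω : ℝ) (m : ℤ) (Λ : ℝ), Kerr.IsAdmissibleTriple a ω m Λ → m ≠ 0 →
          |ω - m * Kerr.horizonAngularVelocity M a| ≤ ε₀ * |(m : ℝ)| →
          δ * Kerr.surfaceGravity M a ≤ |ω - m * Kerr.horizonAngularVelocity M a| →
          0 ≤ ω * (ω - m * Kerr.horizonAngularVelocity M a) →
            ∀ RH RI : ℝ → ℂ,
              Kerr.IsRadialTeukolskySolution M a 0 ω m (Λ - a ^ 2 * ω ^ 2) RH →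
              Kerr.IsNormalisedHorizonSolution M a 0 ω m RH →
              Kerr.IsRadialTeukolskySolution M a 0 ω m (Λ - a ^ 2 * ω ^ 2) RI →
              Kerr.IsNormalisedInfinitySolution M 0 ω RI →
                ∀ r r' : ℝ, Kerr.rPlus M a < r → r ≤ r' →
                  Kerr.rPlus M a + θ * (Kerr.rPlus M a - Kerr.rMinus M a) ≤ r' →
                    Real.sqrt (r ^ 2 + a ^ 2) * ‖RH r‖ * (Real.sqrt (r' ^ 2 + a ^ 2) * ‖RI r'‖) ≤
                      C * Λ ^ N * (Kerr.surfaceGravity M a)⁻¹ ^ N * ‖Kerr.radialWronskian M a 0 RH RI r‖)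

/-- **The cone kernel bound (all cone frequencies, Λ-polynomial constant)** — the statement `stub_integratedDecayOfKernelPoly` and the Wronskian
plumbing consume (v6 form of the old S5 conclusion). [folklore] -/
abbrev ConeKernelPoly : Prop :=
    (∀ M : ℝ, 0 < M → ∀ θ : ℝ, 0 < θ → ∃ (a₁ ε₀ C : ℝ) (N : ℕ), a₁ < M ∧ 0 < ε₀ ∧ 0 < C ∧
      ∀ a : ℝ, a₁ ≤ |a| → Kerr.IsSubextremal M a →
        ∀ (ω : ℝ) (m : ℤ) (Λ : ℝ), Kerr.IsAdmissibleTriple a ω m Λ → m ≠ 0 →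
          |ω - m * Kerr.horizonAngularVelocity M a| ≤ ε₀ * |(m : ℝ)| →
            ∀ RH RI : ℝ → ℂ,
              Kerr.IsRadialTeukolskySolution M a 0 ω m (Λ - a ^ 2 * ω ^ 2) RH →
              Kerr.IsNormalisedHorizonSolution M a 0 ω m RH →
              Kerr.IsRadialTeukolskySolution M a 0 ω m (Λ - a ^ 2 * ω ^ 2) RI →
              Kerr.IsNormalisedInfinitySolution M 0 ω RI →
                ∀ r r' : ℝ, Kerr.rPlus M a < r → r ≤ r' →
                  Kerr.rPlus M a + θ * (Kerr.rPlus M a - Kerr.rMinus M a) ≤ r' →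
                    Real.sqrt (r ^ 2 + a ^ 2) * ‖RH r‖ * (Real.sqrt (r' ^ 2 + a ^ 2) * ‖RI r'‖) ≤
                      C * Λ ^ N * (Kerr.surfaceGravity M a)⁻¹ ^ N * ‖Kerr.radialWronskian M a 0 RH RI r‖)

/-- **The Wronskian lower bound (all cone frequencies, Λ-polynomial constant)** — the first hypothesis of `stub_integratedDecayOfKernelPoly`. [folklore] -/
abbrev ConeWronskianPoly : Prop :=
    (∀ M : ℝ, 0 < M → ∃ (a₁ ε₀ C : ℝ) (N : ℕ), a₁ < M ∧ 0 < ε₀ ∧ 0 < C ∧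
      ∀ a : ℝ, a₁ ≤ |a| → Kerr.IsSubextremal M a →
        ∀ (ω : ℝ) (m : ℤ) (Λ : ℝ), Kerr.IsAdmissibleTriple a ω m Λ → m ≠ 0 →
          |ω - m * Kerr.horizonAngularVelocity M a| ≤ ε₀ * |(m : ℝ)| →
            ∀ RH RI : ℝ → ℂ,
              Kerr.IsRadialTeukolskySolution M a 0 ω m (Λ - a ^ 2 * ω ^ 2) RH →
              Kerr.IsNormalisedHorizonSolution M a 0 ω m RH →
              Kerr.IsRadialTeukolskySolution M a 0 ω m (Λ - a ^ 2 * ω ^ 2) RI →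
              Kerr.IsNormalisedInfinitySolution M 0 ω RI →
                ∀ r : ℝ, Kerr.rPlus M a < r →
                  1 ≤ (C * Λ ^ N * (Kerr.surfaceGravity M a)⁻¹ ^ N) ^ 2 *
                    ‖Kerr.radialWronskian M a 0 RH RI r‖ ^ 2)

/-- **P1 · `stub_polyPlumbing` — the Λ-polynomial twins of two LANDED plumbing theorems (lead seat c3, v6; no new mathematics).**
(A) = `stub_tortoiseReduction` (p120896, `Theorems/PhaseMixingCaptureKappaExplicitWaveDecayTortoiseReduction.lean`) with the constant
`C|m|^Nκ^{-N}` replaced by `CΛ^Nκ^{-N}` in hypothesis AND conclusion: the R-language cone kernel bound for the TdC-normalised pair (`m ≠ 0`) from its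
tortoise-variable core, for any frequency regime `P` invariant under `(ω, m) ↦ (−ω, −m)` — same proof word for word (WLOG `0 < m` by the conjugation
symmetry `Kerr.Costa2019.coneKernelBound_of_pos`, whose Λ-polynomial twin is needed first: `Λ` is invariant under the symmetry, so its `m < 0` branch only
loses the `|−m| = |m|` rewrite; `ω ≠ 0` in the cone; `u = √(ρ²+a²)R∘ρ` via `Kerr.schrodingerForm`; end data from
`Costa2019.tendsto_norm_(deriv_)horizon/infinitySolution`; fluxes from `radialFlux_eq_of_normalisedHorizon/Infinity`; back with `Kerr.wronskian_schrodingerForm`).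
(B) = `stub_wronskianOfKernel` (p97378, `Theorems/PhaseMixingCaptureKappaExplicitWaveDecayWronskianOfKernel.lean`) with the same replacement: the Wronskian
lower bound `1 ≤ (CΛ^Nκ^{-N})²‖𝔚‖²` from the kernel bound by the limits `r → r₊⁺` (`√(r²+a²)‖R_𝓗‖ → 1`) and `r′ → ∞` (`√(r′²+a²)‖R_𝓘‖ → 1`) — the
constant is never opened in that proof (`one_le_of_kernelBound` is stated for an abstract bound `B`). Size M (worker: copy, substitute, re-check; the
two twins land as two files `…TortoiseReductionPoly.lean`, `…WronskianOfKernelPoly.lean` plus a 3-line file proving this conjunction). -/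
theorem stub_polyPlumbing :
    (∀ P : ℝ → ℝ → ℝ → ℤ → Prop, (∀ M a ω m, P M a ω m → P M a (-ω) (-m)) →
    (∀ M : ℝ, 0 < M → ∀ θ : ℝ, 0 < θ → ∃ (a₁ ε₀ C : ℝ) (N : ℕ), a₁ < M ∧ 0 < ε₀ ∧ 0 < C ∧
      ∀ a : ℝ, a₁ ≤ |a| → Kerr.IsSubextremal M a →
        ∀ (ω : ℝ) (m : ℤ) (Λ : ℝ), Kerr.IsAdmissibleTriple a ω m Λ → 0 < m →
          |ω - m * Kerr.horizonAngularVelocity M a| ≤ ε₀ * |(m : ℝ)| → P M a ω m →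
            ∀ ρ : ℝ → ℝ, Kerr.IsTortoiseRadius M a ρ →
            ∀ uH uH₁ uI uI₁ : ℝ → ℂ,
              (∀ x, HasDerivAt uH (uH₁ x) x ∧
                HasDerivAt uH₁ (-(((ω ^ 2 - Kerr.sepPotential M a ω m Λ (ρ x) : ℝ) : ℂ) * uH x)) x) →
              (∀ x, HasDerivAt uI (uI₁ x) x ∧
                HasDerivAt uI₁ (-(((ω ^ 2 - Kerr.sepPotential M a ω m Λ (ρ x) : ℝ) : ℂ) * uI x)) x) →
              Tendsto (fun x ↦ ‖uH x‖) atBot (𝓝 1) →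
              Tendsto (fun x ↦ ‖uH₁ x‖) atBot (𝓝 |ω - m * Kerr.horizonAngularVelocity M a|) →
              (∀ x, (starRingEnd ℂ (uH x) * uH₁ x).im = -(ω - m * Kerr.horizonAngularVelocity M a)) →
              Tendsto (fun x ↦ ‖uI x‖) atTop (𝓝 1) →
              Tendsto (fun x ↦ ‖uI₁ x‖) atTop (𝓝 |ω|) →
              (∀ x, (starRingEnd ℂ (uI x) * uI₁ x).im = ω) →
                ∀ x x' : ℝ, x ≤ x' → Kerr.rPlus M a + θ * (Kerr.rPlus M a - Kerr.rMinus M a) ≤ ρ x' →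
                  ‖uH x‖ * ‖uI x'‖ ≤
                    C * Λ ^ N * (Kerr.surfaceGravity M a)⁻¹ ^ N * ‖uH x * uI₁ x - uI x * uH₁ x‖) →
    (∀ M : ℝ, 0 < M → ∀ θ : ℝ, 0 < θ → ∃ (a₁ ε₀ C : ℝ) (N : ℕ), a₁ < M ∧ 0 < ε₀ ∧ 0 < C ∧
      ∀ a : ℝ, a₁ ≤ |a| → Kerr.IsSubextremal M a →
        ∀ (ω : ℝ) (m : ℤ) (Λ : ℝ), Kerr.IsAdmissibleTriple a ω m Λ → m ≠ 0 →
          |ω - m * Kerr.horizonAngularVelocity M a| ≤ ε₀ * |(m : ℝ)| → P M a ω m →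
            ∀ RH RI : ℝ → ℂ,
              Kerr.IsRadialTeukolskySolution M a 0 ω m (Λ - a ^ 2 * ω ^ 2) RH →
              Kerr.IsNormalisedHorizonSolution M a 0 ω m RH →
              Kerr.IsRadialTeukolskySolution M a 0 ω m (Λ - a ^ 2 * ω ^ 2) RI →
              Kerr.IsNormalisedInfinitySolution M 0 ω RI →
                ∀ r r' : ℝ, Kerr.rPlus M a < r → r ≤ r' →
                  Kerr.rPlus M a + θ * (Kerr.rPlus M a - Kerr.rMinus M a) ≤ r' →
                    Real.sqrt (r ^ 2 + a ^ 2) * ‖RH r‖ * (Real.sqrt (r' ^ 2 + a ^ 2) * ‖RI r'‖) ≤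
                      C * Λ ^ N * (Kerr.surfaceGravity M a)⁻¹ ^ N * ‖Kerr.radialWronskian M a 0 RH RI r‖)) ∧
    ((∀ M : ℝ, 0 < M → ∀ θ : ℝ, 0 < θ → ∃ (a₁ ε₀ C : ℝ) (N : ℕ), a₁ < M ∧ 0 < ε₀ ∧ 0 < C ∧
      ∀ a : ℝ, a₁ ≤ |a| → Kerr.IsSubextremal M a →
        ∀ (ω : ℝ) (m : ℤ) (Λ : ℝ), Kerr.IsAdmissibleTriple a ω m Λ → m ≠ 0 →
          |ω - m * Kerr.horizonAngularVelocity M a| ≤ ε₀ * |(m : ℝ)| →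
            ∀ RH RI : ℝ → ℂ,
              Kerr.IsRadialTeukolskySolution M a 0 ω m (Λ - a ^ 2 * ω ^ 2) RH →
              Kerr.IsNormalisedHorizonSolution M a 0 ω m RH →
              Kerr.IsRadialTeukolskySolution M a 0 ω m (Λ - a ^ 2 * ω ^ 2) RI →
              Kerr.IsNormalisedInfinitySolution M 0 ω RI →
                ∀ r r' : ℝ, Kerr.rPlus M a < r → r ≤ r' →
                  Kerr.rPlus M a + θ * (Kerr.rPlus M a - Kerr.rMinus M a) ≤ r' →
                    Real.sqrt (r ^ 2 + a ^ 2) * ‖RH r‖ * (Real.sqrt (r' ^ 2 + a ^ 2) * ‖RI r'‖) ≤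
                      C * Λ ^ N * (Kerr.surfaceGravity M a)⁻¹ ^ N * ‖Kerr.radialWronskian M a 0 RH RI r‖) →
    (∀ M : ℝ, 0 < M → ∃ (a₁ ε₀ C : ℝ) (N : ℕ), a₁ < M ∧ 0 < ε₀ ∧ 0 < C ∧
      ∀ a : ℝ, a₁ ≤ |a| → Kerr.IsSubextremal M a →
        ∀ (ω : ℝ) (m : ℤ) (Λ : ℝ), Kerr.IsAdmissibleTriple a ω m Λ → m ≠ 0 →
          |ω - m * Kerr.horizonAngularVelocity M a| ≤ ε₀ * |(m : ℝ)| →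
            ∀ RH RI : ℝ → ℂ,
              Kerr.IsRadialTeukolskySolution M a 0 ω m (Λ - a ^ 2 * ω ^ 2) RH →
              Kerr.IsNormalisedHorizonSolution M a 0 ω m RH →
              Kerr.IsRadialTeukolskySolution M a 0 ω m (Λ - a ^ 2 * ω ^ 2) RI →
              Kerr.IsNormalisedInfinitySolution M 0 ω RI →
                ∀ r : ℝ, Kerr.rPlus M a < r →
                  1 ≤ (C * Λ ^ N * (Kerr.surfaceGravity M a)⁻¹ ^ N) ^ 2 *
                    ‖Kerr.radialWronskian M a 0 RH RI r‖ ^ 2)) :=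
  -- LANDED (seat c3, p126054): see the imported Theorems module
  Summit.FinalStateConjecture.FinalStateConjecture.Theorems.KappaExplicitWaveDecay.OlverDunsterUniformReduction.stub_polyPlumbing

/-- **Flux-regime kernel bound in the R-language from the plumbing (A) and the core** (`P := fun M a ω m ↦ δκ ≤ |ω − mω₊| ∧ 0 ≤ ω(ω − mω₊)`,
invariant under `(ω, m) ↦ (−ω, −m)`). [folklore] -/
theorem coneKernelFluxRegimePoly_of_core (hPl : type_of% stub_polyPlumbing)
    (hC : type_of% (fluxRegimeCorePoly_of stub_tameZoneTransport stub_barrierProductBound stub_fullConeCensus stub_fluxRegimeCorePoly)) :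
    ConeKernelFluxRegimePoly := by
  intro M hM θ hθ δ hδ
  have hP : ∀ M a ω (m : ℤ),
      (δ * Kerr.surfaceGravity M a ≤ |ω - m * Kerr.horizonAngularVelocity M a| ∧
        0 ≤ ω * (ω - m * Kerr.horizonAngularVelocity M a)) →
      (δ * Kerr.surfaceGravity M a ≤ |(-ω) - ((-m : ℤ) : ℝ) * Kerr.horizonAngularVelocity M a| ∧
        0 ≤ (-ω) * ((-ω) - ((-m : ℤ) : ℝ) * Kerr.horizonAngularVelocity M a)) := by
    intro M a ω m ⟨h1, h2⟩
    push_cast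
    refine ⟨?_, ?_⟩
    · rw [show -ω - -(m : ℝ) * Kerr.horizonAngularVelocity M a = -(ω - m * Kerr.horizonAngularVelocity M a) by ring,
        abs_neg]; exact h1
    · nlinarith [h2]
  obtain ⟨a₁, ε₀, C, N, ha₁, hε₀, hC0, h⟩ :=
    hPl.1 (fun M a ω m ↦ δ * Kerr.surfaceGravity M a ≤ |ω - m * Kerr.horizonAngularVelocity M a| ∧
        0 ≤ ω * (ω - m * Kerr.horizonAngularVelocity M a)) hP (hC δ hδ) M hM θ hθ
  refine ⟨a₁, ε₀, C, N, ha₁, hε₀, hC0, ?_⟩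
  intro a ha hsub ω m Λ hadm hm hcone h1 h2 RH RI hH hnH hI hnI r r' hr hrr' hr'
  exact h a ha hsub ω m Λ hadm hm hcone ⟨h1, h2⟩ RH RI hH hnH hI hnI r r' hr hrr' hr'

/-- **The cone kernel bound OFF the flux regime** (threshold sliver `|ω − mω₊| ≤ 2ξ₀κ` ∪ superradiant half-cone
`ω(ω − mω₊) ≤ 0`, Λ-polynomial constant): the statement registered as `stub_coneKernelThresholdPoly` in v6–v7.2; since v7.3 it is
DERIVED (`coneKernelThresholdPoly_of_parts`) from the bounded-box half (`Λ ≤ Λ₀`, hence `|m| ≤ √Λ₀`; v7.3–v7.6 the registered stub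
`stub_coneKernelThresholdBoundedPoly`, since v8 itself derived from T1w/T1h/T1i by `coneKernelThresholdBoundedPoly_of_parts`) and
`stub_coneKernelThresholdLargePoly` (`Λ > Λ₀(M, θ, ξ₀)`: the two-large-parameter uniform-reduction problem). [folklore] -/
abbrev ConeKernelThresholdPoly : Prop :=
    (∀ M : ℝ, 0 < M → ∀ θ : ℝ, 0 < θ → ∀ ξ₀ : ℝ, 0 < ξ₀ → ∃ (a₁ ε₀ C : ℝ) (N : ℕ), a₁ < M ∧ 0 < ε₀ ∧ 0 < C ∧
      ∀ a : ℝ, a₁ ≤ |a| → Kerr.IsSubextremal M a →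
        ∀ (ω : ℝ) (m : ℤ) (Λ : ℝ), Kerr.IsAdmissibleTriple a ω m Λ → m ≠ 0 →
          |ω - m * Kerr.horizonAngularVelocity M a| ≤ ε₀ * |(m : ℝ)| →
          (ω * (ω - m * Kerr.horizonAngularVelocity M a) ≤ 0 ∨
              |ω - m * Kerr.horizonAngularVelocity M a| ≤ 2 * ξ₀ * Kerr.surfaceGravity M a) →
            ∀ RH RI : ℝ → ℂ,
              Kerr.IsRadialTeukolskySolution M a 0 ω m (Λ - a ^ 2 * ω ^ 2) RH →
              Kerr.IsNormalisedHorizonSolution M a 0 ω m RH →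
              Kerr.IsRadialTeukolskySolution M a 0 ω m (Λ - a ^ 2 * ω ^ 2) RI →
              Kerr.IsNormalisedInfinitySolution M 0 ω RI →
                ∀ r r' : ℝ, Kerr.rPlus M a < r → r ≤ r' →
                  Kerr.rPlus M a + θ * (Kerr.rPlus M a - Kerr.rMinus M a) ≤ r' →
                    Real.sqrt (r ^ 2 + a ^ 2) * ‖RH r‖ * (Real.sqrt (r' ^ 2 + a ^ 2) * ‖RI r'‖) ≤
                      C * Λ ^ N * (Kerr.surfaceGravity M a)⁻¹ ^ N * ‖Kerr.radialWronskian M a 0 RH RI r‖)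

/-! ### T1 (v8, lead seat c5): the bounded-box threshold/superradiant kernel bound SPLIT into three one-function statements

On a bounded box `Λ ≤ Λ₀` (finitely many `m`, `|m| ≤ √Λ₀`) the exponents may depend on `Λ₀`, so the two-point structure of the
kernel bound is not needed: `√(r²+a²)|R_𝓗(r)|·√(r′²+a²)|R_𝓘(r′)| ≤ (sup of the first factor)·(sup of the second factor)·(C_w Λ^N κ^{-N}|𝔚|)`
as soon as (T1w) `1 ≤ C_wΛ^Nκ^{-N}|𝔚|` — quantitative mode stability near the corner `(a, ω) → (M, mω₊)`, the WHOLE research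
content of the old T1 —, (T1h) the horizon-normalised solution is polynomially bounded on the whole half-line, and (T1i) the
infinity-normalised solution is polynomially bounded beyond the collar `r′ ≥ r₊ + θ(r₊ − r₋)`. T1h/T1i are ROBUST transport statements
(no non-degeneracy enters: pocket envelope near `𝓗⁺` — Sonin on c3's horizon zone for `|ξ| ≥ ξ₀`, a κ-free Volterra zone in the
blown-up chart `x = (r − r₊)/(r₊ − r₋)` for `|ξ| ≤ ξ₀` —, then Grönwall in the LOG-chart `t = log x` for `Z = x^{-1/2}W`,
`Z_tt = (x²Q + ¼)Z` with `|x²Q + ¼| ≤ K(Λ₀, ξ₀, M)²` from the pocket edge to `x ≍ 1/σ`, factor `σ^{-K}` = a POWER of `κ⁻¹`, then the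
κ-regular mid/far zones of `CarterFarEnvelope`/`KerrTortoiseZones`); the growth `σ^{-ν}` of the recessive/dominant pair across the
BF-stable throat (`ν² = ¼ + Λ − 2m² + …`) is paid by `N ≥ ν_max(Λ₀)`, which is exactly why this split is available on the box and NOT
for T2. `coneKernelThresholdBoundedPoly_of_parts` (below, sorry-free) recovers the v7.3 statement of T1 verbatim. -/

/-- **T1w · `stub_thresholdWronskianBoxPoly` — quantitative mode stability near the corner on a bounded box (lead seat c5, v8; the
research content of the old T1).** For `M > 0`, `ξ₀ > 0` and every `Λ₀` there are `a₁ < M`, `ε₀ > 0`, `C > 0`, `N` such that for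
`a₁ ≤ |a| < M`, admissible `(ω, m, Λ)` with `m ≠ 0`, `Λ ≤ Λ₀`, `|ω − mω₊| ≤ ε₀|m|` and `ω(ω − mω₊) ≤ 0 ∨ |ω − mω₊| ≤ 2ξ₀κ`, and all
TdC-normalised `R_𝓗, R_𝓘`: `1 ≤ (CΛ^Nκ^{-N})²|𝔚(r)|²` for every `r > r₊`. CONTENT (small-gain form, this seat's analysis
`Lines/olver_dunster_uniform_reduction_c5_smallgain.md`): in a conjugate basis `e, ē` of EXACT solutions on the throat,
`u_𝓗 = A e + A′ ē`, `u_𝓘 = C e + D ē`, `𝔚 = (AD − A′C)·W(e, ē)`, so `|𝔚| ≥ |W(e,ē)|·|A′|·|C|·(1 − |ρ_cap||ρ_far|)` with the cap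
reflection `ρ_cap = A/A′` (`|ρ_cap|² = 1 + (horizon flux)/(f_e|A′|²)`, `> 1` exactly in the superradiant regime) and the far reflection
`ρ_far = D/C` (`|ρ_far|² = 1 − ω/(f_e|C|²) < 1` by the flux of `u_𝓘`): what is needed is the QUANTITATIVE small-gain inequality
`sup |ρ_cap|·|ρ_far| ≤ 1 − gap(M, Λ₀, ξ₀)` uniformly in `κ` — two inequalities about κ-FREE model problems (the cap = the blown-up near
equation, hypergeometric-type, in the charts `x` and `y = x/|ξ|`; the far side = extremal Kerr at `ω = m/2M`), i.e. the
Teukolsky–Press / Detweiler matching numbers WITHOUT their asymptotic equalities (numerics: loop gain ≤ 2.7·10⁻³ at bounded `m`, kit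
j008719/j009713; `|𝔚|²/κ = F_{mℓ}(ξ) ≥ 479` on the layer, c1). In the sliver `|ξ| ≤ ξ₁(gap)` the inequality follows from the flux
identities alone (`|ρ_cap|² − 1 = O(|ξ|)`); BF-stable sectors (`Λ ≳ 2m²`: evanescent throat, `|ρ_far| ≍ σ^{2ν}`) are elementary; the
superradiant BF-violating intermediate regime `ξ₁ ≤ |ξ| ≤ ε₀|m|/2κ` is the hard case. STATUS IN PRINT: unpublished (TdC CMP 378 (2020)
Thm 5.1 excludes `|ω ∓ m/2M| < 1/C`; Gajic arXiv:2302.06636 §1.4; Benomio–Teixeira da Costa arXiv:2512.08917 Conj. 5.6 / Rem. 5.8). Why it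
might fail: a loop gain reaching 1 on some sector (= a real mode near the corner; excluded qualitatively by mode stability for each
`|a| < M`, so only the UNIFORMITY can fail). Size XL (research). -/
theorem stub_thresholdWronskianBoxPoly :
    (∀ M : ℝ, 0 < M → ∀ ξ₀ : ℝ, 0 < ξ₀ → ∀ Λ₀ : ℝ, ∃ (a₁ ε₀ C : ℝ) (N : ℕ), a₁ < M ∧ 0 < ε₀ ∧ 0 < C ∧
      ∀ a : ℝ, a₁ ≤ |a| → Kerr.IsSubextremal M a →
        ∀ (ω : ℝ) (m : ℤ) (Λ : ℝ), Kerr.IsAdmissibleTriple a ω m Λ → m ≠ 0 → Λ ≤ Λ₀ →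
          |ω - m * Kerr.horizonAngularVelocity M a| ≤ ε₀ * |(m : ℝ)| →
          (ω * (ω - m * Kerr.horizonAngularVelocity M a) ≤ 0 ∨
              |ω - m * Kerr.horizonAngularVelocity M a| ≤ 2 * ξ₀ * Kerr.surfaceGravity M a) →
            ∀ RH RI : ℝ → ℂ,
              Kerr.IsRadialTeukolskySolution M a 0 ω m (Λ - a ^ 2 * ω ^ 2) RH →
              Kerr.IsNormalisedHorizonSolution M a 0 ω m RH →
              Kerr.IsRadialTeukolskySolution M a 0 ω m (Λ - a ^ 2 * ω ^ 2) RI →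
              Kerr.IsNormalisedInfinitySolution M 0 ω RI →
                ∀ r : ℝ, Kerr.rPlus M a < r →
                  1 ≤ (C * Λ ^ N * (Kerr.surfaceGravity M a)⁻¹ ^ N) ^ 2 *
                    ‖Kerr.radialWronskian M a 0 RH RI r‖ ^ 2) := by
  sorry

/-- **T1h · `stub_horizonSupBoxPoly` — polynomial sup bound for the horizon-normalised solution on the box (lead seat c5, v8).** For
`M > 0`, `ξ₀ > 0` and every `Λ₀` there are `a₁ < M`, `ε₀ > 0`, `C > 0`, `N` such that for `a₁ ≤ |a| < M`, admissible `(ω, m, Λ)`, `m ≠ 0`,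
`Λ ≤ Λ₀`, `|ω − mω₊| ≤ ε₀|m|`, `ω(ω − mω₊) ≤ 0 ∨ |ω − mω₊| ≤ 2ξ₀κ`, every TdC-normalised `R_𝓗` (`s = 0`) obeys
`√(r²+a²)|R_𝓗(r)| ≤ CΛ^Nκ^{-N}` for ALL `r > r₊`. HOW (`u = √(r²+a²)R` in the tortoise variable, `W = √(x(x+1))R` in the blown-up
variable `x = (r − r₊)/(r₊ − r₋)`, `σ = ω − mω₊ = 2κξ`): (1) POCKET. `|ξ| ≥ ξ₀` (then `σ ≠ 0`, `|σ| ≥ 2ξ₀κ`): `carter_envelope_H`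
(`CarterFluxEnvelopes`, flux-sign-free) on `(−∞, b₁]`, `b₁` = first zero of `φ = ω² − V∘ρ` (or everywhere if `φ > 0`), with
`η = min(|σ|/2, 1/L)`, `L = (25/κ)log(2496Λ/(σ²M²))`: `‖u‖² ≤ 2·3⁹ + (ΦL²)¹⁶e²·3¹⁰σ²L²` = poly(`κ⁻¹`) since `|σ| ≤ ε₀|m|`;
`|ξ| ≤ ξ₀`: in the chart `t = log x`, `Z = x^{-1/2}W` solves `Z_tt = p(t)Z`, `p = x²Q + ¼ → −ξ²`, `|p + ξ²| ≤ C_box e^t` (κ-FREE: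
`Q` from `stub_olverNormalForm`, `k = ξ + 2r₊ωx + ω(r₊−r₋)x²`), and `Y = e^{iξt}Z_𝓗 → c`, `|c| = (2Mr₊)^{-1/2}`, `Y′ → 0`
(`IsNormalisedHorizonSolution`: `R_𝓗 = (r − r₊)^{-iξ}f`, `f` smooth at `r₊`), `(e^{-2iξt}Y′)′ = e^{-2iξt}(p + ξ²)Y` ⟹
`sup_{s ≤ t}|Y| ≤ |c|/(1 − C_box e^t)` ⟹ `|Z_𝓗| ≤ 2|c|` on `x ≤ 1/(2C_box)`. (2) LOG-GRÖNWALL from the pocket edge `x₁` (`≥ c(box) > 0`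
in both cases: `x_{b₁} ≥ |ξ|/(2r₊ω + √Λ₀ + 1)`) to `X = c′/σ_*`, `σ_* = (r₊ − r₋)/r₊`: `|p| ≤ K²`, `K² = Λ₀ + 2(2r₊ω + √Λ₀ + 1)² + 2(2r₊ω + ωc′r₊)² + 1`,
`TransitionZoneGrowth.zoneEnergy_le_zoneEnergy_mul_exp` ⟹ factor `e^{K log(X/x₁)} = (X/x₁)^K` = POWER of `κ⁻¹`. (3) MID zone
`r ∈ [r₊(1 + c′), R]`, `R = max(7M, √(12Λ)/|ω|, 1/(Mω²))`: tortoise length `≤ 50·6M + (7/5)R` (`dr*/dr ≤ 50` on `[2r₊, 7M]`,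
`IsTortoiseRadius.sub_le_mul_sub` beyond), `|φ| ≤ Φ = ω² + 6Λ/M²` (`coeff_le_of_admissible`): Grönwall, a box constant. (4) FAR `r ≥ R`:
`φ ≥ ω²/2` (`half_sq_le_omega_sq_sub_sepPotential`), Sonin energy along the monotone pieces of `φ` (`exists_monotone_partition`,
`SoninEnvelope`): bounded. Handovers `(u, u′) ↔ (W, W′) ↔ (Z, Z_t)`: chain rule with `dr*/dx = (r² + a²)/((r₊ − r₋)x(x+1))`. Why it might
fail: it cannot on the box (every constant is a box constant or a power of `σ_* ≍ κM`). Size L (worker). -/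
theorem stub_horizonSupBoxPoly :
    (∀ M : ℝ, 0 < M → ∀ ξ₀ : ℝ, 0 < ξ₀ → ∀ Λ₀ : ℝ, ∃ (a₁ ε₀ C : ℝ) (N : ℕ), a₁ < M ∧ 0 < ε₀ ∧ 0 < C ∧
      ∀ a : ℝ, a₁ ≤ |a| → Kerr.IsSubextremal M a →
        ∀ (ω : ℝ) (m : ℤ) (Λ : ℝ), Kerr.IsAdmissibleTriple a ω m Λ → m ≠ 0 → Λ ≤ Λ₀ →
          |ω - m * Kerr.horizonAngularVelocity M a| ≤ ε₀ * |(m : ℝ)| →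
          (ω * (ω - m * Kerr.horizonAngularVelocity M a) ≤ 0 ∨
              |ω - m * Kerr.horizonAngularVelocity M a| ≤ 2 * ξ₀ * Kerr.surfaceGravity M a) →
            ∀ RH : ℝ → ℂ,
              Kerr.IsRadialTeukolskySolution M a 0 ω m (Λ - a ^ 2 * ω ^ 2) RH →
              Kerr.IsNormalisedHorizonSolution M a 0 ω m RH →
                ∀ r : ℝ, Kerr.rPlus M a < r →
                  Real.sqrt (r ^ 2 + a ^ 2) * ‖RH r‖ ≤ C * Λ ^ N * (Kerr.surfaceGravity M a)⁻¹ ^ N) :=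
  -- LANDED (lead c5 wave-2 worker, p142765; + Literature TeukolskyHorizonSupBoxPocket p142209): Theorems/PhaseMixingCaptureKappaExplicitWaveDecayHorizonSupBoxPoly.lean
  @Summit.FinalStateConjecture.FinalStateConjecture.Theorems.KappaExplicitWaveDecay.OlverDunsterUniformReduction.stub_horizonSupBoxPoly

/-- **T1i · `stub_infinitySupBoxPoly` — polynomial sup bound for the infinity-normalised solution beyond the collar, on the box (lead
seat c5, v8).** For `M > 0`, `θ > 0`, `ξ₀ > 0` and every `Λ₀` there are `a₁ < M`, `ε₀ > 0`, `C > 0`, `N` such that for `a₁ ≤ |a| < M`,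
admissible `(ω, m, Λ)`, `m ≠ 0`, `Λ ≤ Λ₀`, `|ω − mω₊| ≤ ε₀|m|`, `ω(ω − mω₊) ≤ 0 ∨ |ω − mω₊| ≤ 2ξ₀κ`, every TdC-normalised `R_𝓘` (`s = 0`)
obeys `√(r′²+a²)|R_𝓘(r′)| ≤ CΛ^Nκ^{-N}` for all `r′ ≥ r₊ + θ(r₊ − r₋)`. HOW (inward from infinity; no horizon pocket needed): (1) FAR
`r ≥ R = max(7M, √(12Λ)/|ω|, 1/(Mω²))`: `‖u_𝓘‖ ≤ 2` (`carter_far_norm_le`, landed) and `‖u_𝓘′‖ ≤ …` (`carter_far_norm_deriv_le`);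
(2) MID `[r₊(1 + c′), R]`: Grönwall over a κ-free tortoise length with `|φ| ≤ Φ` (as in T1h (3)); (3) LOG-GRÖNWALL in the blown-up chart
from `X = c′/σ_*` DOWN to `x = θ`: `Z = x^{-1/2}W`, `Z_tt = pZ`, `|p| ≤ K(Λ₀, ξ₀, M, θ)²` on `[θ, X]` (for `|ξ| ≥ ξ₀` the pocket term
`2ξ²/(x+1)²` is NOT bounded on `[θ, X]` when `|ξ| → ∞`; there use instead that `φ ≥ 0` on `x ≤ x_{b₁} ≍ |ξ|` and transport by
`tameZone_transport`/Sonin across `[θ, x_{b₁}]` after the log-Grönwall on `[x_{b₁}, X]` — or simply note `|p| ≤ K² + 2ξ²/(θ+1)²` and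
that `e^{|ξ| log(X/θ)/(θ+1)}` is NOT polynomial: the two-regime treatment is necessary), factor `(X/θ)^K` = POWER of `κ⁻¹`; back to
`u = √(r²+a²)R = √((r²+a²)/(x(x+1)))·W`. Why it might fail: it cannot on the box. Size M–L (worker). -/
theorem stub_infinitySupBoxPoly :
    (∀ M : ℝ, 0 < M → ∀ θ : ℝ, 0 < θ → ∀ ξ₀ : ℝ, 0 < ξ₀ → ∀ Λ₀ : ℝ, ∃ (a₁ ε₀ C : ℝ) (N : ℕ), a₁ < M ∧ 0 < ε₀ ∧ 0 < C ∧
      ∀ a : ℝ, a₁ ≤ |a| → Kerr.IsSubextremal M a →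
        ∀ (ω : ℝ) (m : ℤ) (Λ : ℝ), Kerr.IsAdmissibleTriple a ω m Λ → m ≠ 0 → Λ ≤ Λ₀ →
          |ω - m * Kerr.horizonAngularVelocity M a| ≤ ε₀ * |(m : ℝ)| →
          (ω * (ω - m * Kerr.horizonAngularVelocity M a) ≤ 0 ∨
              |ω - m * Kerr.horizonAngularVelocity M a| ≤ 2 * ξ₀ * Kerr.surfaceGravity M a) →
            ∀ RI : ℝ → ℂ,
              Kerr.IsRadialTeukolskySolution M a 0 ω m (Λ - a ^ 2 * ω ^ 2) RI →
              Kerr.IsNormalisedInfinitySolution M 0 ω RI →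
                ∀ r' : ℝ, Kerr.rPlus M a + θ * (Kerr.rPlus M a - Kerr.rMinus M a) ≤ r' →
                  Real.sqrt (r' ^ 2 + a ^ 2) * ‖RI r'‖ ≤ C * Λ ^ N * (Kerr.surfaceGravity M a)⁻¹ ^ N) :=
  -- LANDED (lead c5 wave-1 worker, p139559): Theorems/PhaseMixingCaptureKappaExplicitWaveDecayInfinitySupBoxPoly.lean
  @Summit.FinalStateConjecture.FinalStateConjecture.Theorems.KappaExplicitWaveDecay.OlverDunsterUniformReduction.stub_infinitySupBoxPoly

/-- **T1 recovered (v8)**: the v7.3 statement of `stub_coneKernelThresholdBoundedPoly` — the threshold/superradiant cone kernel bound on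
a bounded box `Λ ≤ Λ₀` — from T1w, T1h, T1i: `A·B ≤ B_H·B_I·(C_wΛ^{N_w}κ^{-N_w}‖𝔚‖)` with `B_H = C_hΛ^{N_h}κ^{-N_h}`,
`B_I = C_iΛ^{N_i}κ^{-N_i}`, exponents added. [folklore] -/
theorem coneKernelThresholdBoundedPoly_of_parts (hW : type_of% stub_thresholdWronskianBoxPoly)
    (hH : type_of% stub_horizonSupBoxPoly) (hI : type_of% stub_infinitySupBoxPoly) :
    (∀ M : ℝ, 0 < M → ∀ θ : ℝ, 0 < θ → ∀ ξ₀ : ℝ, 0 < ξ₀ → ∀ Λ₀ : ℝ, ∃ (a₁ ε₀ C : ℝ) (N : ℕ), a₁ < M ∧ 0 < ε₀ ∧ 0 < C ∧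
      ∀ a : ℝ, a₁ ≤ |a| → Kerr.IsSubextremal M a →
        ∀ (ω : ℝ) (m : ℤ) (Λ : ℝ), Kerr.IsAdmissibleTriple a ω m Λ → m ≠ 0 → Λ ≤ Λ₀ →
          |ω - m * Kerr.horizonAngularVelocity M a| ≤ ε₀ * |(m : ℝ)| →
          (ω * (ω - m * Kerr.horizonAngularVelocity M a) ≤ 0 ∨
              |ω - m * Kerr.horizonAngularVelocity M a| ≤ 2 * ξ₀ * Kerr.surfaceGravity M a) →
            ∀ RH RI : ℝ → ℂ,
              Kerr.IsRadialTeukolskySolution M a 0 ω m (Λ - a ^ 2 * ω ^ 2) RH →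
              Kerr.IsNormalisedHorizonSolution M a 0 ω m RH →
              Kerr.IsRadialTeukolskySolution M a 0 ω m (Λ - a ^ 2 * ω ^ 2) RI →
              Kerr.IsNormalisedInfinitySolution M 0 ω RI →
                ∀ r r' : ℝ, Kerr.rPlus M a < r → r ≤ r' →
                  Kerr.rPlus M a + θ * (Kerr.rPlus M a - Kerr.rMinus M a) ≤ r' →
                    Real.sqrt (r ^ 2 + a ^ 2) * ‖RH r‖ * (Real.sqrt (r' ^ 2 + a ^ 2) * ‖RI r'‖) ≤
                      C * Λ ^ N * (Kerr.surfaceGravity M a)⁻¹ ^ N * ‖Kerr.radialWronskian M a 0 RH RI r‖) := by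
  intro M hM θ hθ ξ₀ hξ₀ Λ₀
  obtain ⟨a₁, ε₁, C₁, N₁, ha₁, hε₁, hC₁, hW'⟩ := hW M hM ξ₀ hξ₀ Λ₀
  obtain ⟨a₂, ε₂, C₂, N₂, ha₂, hε₂, hC₂, hH'⟩ := hH M hM ξ₀ hξ₀ Λ₀
  obtain ⟨a₃, ε₃, C₃, N₃, ha₃, hε₃, hC₃, hI'⟩ := hI M hM θ hθ ξ₀ hξ₀ Λ₀
  refine ⟨max a₁ (max a₂ a₃), min ε₁ (min ε₂ ε₃), C₂ * C₃ * C₁, N₂ + N₃ + N₁,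
    max_lt ha₁ (max_lt ha₂ ha₃), lt_min hε₁ (lt_min hε₂ hε₃), by positivity, ?_⟩
  intro a ha hsub ω m Λ hadm hm hΛ₀ hcone hreg RH RI hRH hnH hRI hnI r r' hr hrr' hr'
  have ha1 : a₁ ≤ |a| := le_trans (le_max_left _ _) ha
  have ha2 : a₂ ≤ |a| := le_trans ((le_max_left _ _).trans (le_max_right _ _)) ha
  have ha3 : a₃ ≤ |a| := le_trans ((le_max_right _ _).trans (le_max_right _ _)) ha
  have hc1 : |ω - m * Kerr.horizonAngularVelocity M a| ≤ ε₁ * |(m : ℝ)| :=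
    hcone.trans (mul_le_mul_of_nonneg_right (min_le_left _ _) (abs_nonneg _))
  have hc2 : |ω - m * Kerr.horizonAngularVelocity M a| ≤ ε₂ * |(m : ℝ)| :=
    hcone.trans (mul_le_mul_of_nonneg_right ((min_le_right _ _).trans (min_le_left _ _)) (abs_nonneg _))
  have hc3 : |ω - m * Kerr.horizonAngularVelocity M a| ≤ ε₃ * |(m : ℝ)| :=
    hcone.trans (mul_le_mul_of_nonneg_right ((min_le_right _ _).trans (min_le_right _ _)) (abs_nonneg _))
  set X := (Kerr.surfaceGravity M a)⁻¹ with hX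
  set Wn := ‖Kerr.radialWronskian M a 0 RH RI r‖ with hWn
  have hκ : 0 < Kerr.surfaceGravity M a := (Kerr.surfaceGravity_pos_iff hM a).2 hsub
  have hX0 : 0 < X := inv_pos.2 hκ
  have hΛ0 : 0 ≤ Λ := hadm.nonneg
  -- the three inputs
  have h1 : 1 ≤ (C₁ * Λ ^ N₁ * X ^ N₁) ^ 2 * Wn ^ 2 := hW' a ha1 hsub ω m Λ hadm hm hΛ₀ hc1 hreg RH RI hRH hnH hRI hnI r hr
  have h2 : Real.sqrt (r ^ 2 + a ^ 2) * ‖RH r‖ ≤ C₂ * Λ ^ N₂ * X ^ N₂ :=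
    hH' a ha2 hsub ω m Λ hadm hm hΛ₀ hc2 hreg RH hRH hnH r hr
  have h3 : Real.sqrt (r' ^ 2 + a ^ 2) * ‖RI r'‖ ≤ C₃ * Λ ^ N₃ * X ^ N₃ :=
    hI' a ha3 hsub ω m Λ hadm hm hΛ₀ hc3 hreg RI hRI hnI r' hr'
  -- `1 ≤ P·Wn` from `1 ≤ (P·Wn)²`
  have hP0 : 0 ≤ C₁ * Λ ^ N₁ * X ^ N₁ := by positivity
  have hWn0 : 0 ≤ Wn := norm_nonneg _
  have h1' : 1 ≤ C₁ * Λ ^ N₁ * X ^ N₁ * Wn := by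
    have h : 1 ≤ (C₁ * Λ ^ N₁ * X ^ N₁ * Wn) ^ 2 := by rw [mul_pow]; exact h1
    have h' := (one_le_sq_iff_one_le_abs _).1 h
    rwa [abs_of_nonneg (mul_nonneg hP0 hWn0)] at h'
  have hA0 : 0 ≤ Real.sqrt (r ^ 2 + a ^ 2) * ‖RH r‖ := by positivity
  have hB0 : 0 ≤ Real.sqrt (r' ^ 2 + a ^ 2) * ‖RI r'‖ := by positivity
  calc Real.sqrt (r ^ 2 + a ^ 2) * ‖RH r‖ * (Real.sqrt (r' ^ 2 + a ^ 2) * ‖RI r'‖)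
      ≤ (C₂ * Λ ^ N₂ * X ^ N₂) * (C₃ * Λ ^ N₃ * X ^ N₃) := mul_le_mul h2 h3 hB0 (hA0.trans h2)
    _ = (C₂ * Λ ^ N₂ * X ^ N₂) * (C₃ * Λ ^ N₃ * X ^ N₃) * 1 := (mul_one _).symm
    _ ≤ (C₂ * Λ ^ N₂ * X ^ N₂) * (C₃ * Λ ^ N₃ * X ^ N₃) * (C₁ * Λ ^ N₁ * X ^ N₁ * Wn) :=
        mul_le_mul_of_nonneg_left h1' (by positivity)
    _ = C₂ * C₃ * C₁ * Λ ^ (N₂ + N₃ + N₁) * X ^ (N₂ + N₃ + N₁) * Wn := by ring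

/-- **T2 · `stub_coneKernelThresholdLargePoly` — the threshold/superradiant cone kernel bound for LARGE `Λ > Λ₀(M, θ, ξ₀)`
(lead seat c4, v7.3; the unbounded-`(m, Λ)` half of the v6–v7.2 stub `stub_coneKernelThresholdPoly`).** For `M > 0`, `θ > 0`, `ξ₀ > 0`
there are `Λ₀`, `a₁ < M`, `ε₀ > 0`, `C > 0`, `N` such that for `a₁ ≤ |a| < M`, admissible `(ω, m, Λ)` with `m ≠ 0`, `Λ₀ < Λ`,
`|ω − mω₊| ≤ ε₀|m|` and `ω(ω − mω₊) ≤ 0 ∨ |ω − mω₊| ≤ 2ξ₀κ`: the same kernel bound `≤ CΛ^Nκ^{-N}|𝔚(r)|`. CONTENT: two large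
parameters (`Λ → ∞` with `|m| ≤ √Λ`, and `κ → 0`): Olver's Liouville–Green theory with error bounds (S2 landed) plus the uniform reductions
at the transition points of the TRUE coefficient in the blown-up radius (S1 landed: double pole at the horizon with exponents `½ ± iξ`,
turning points, Euler stretch; Airy / Weber / Bessel-of-imaginary-order layers: Olver 1974 Ch. 11, Olver 1975, Dunster 1990), with the
error-control variation `𝒱(F)` bounded UNIFORMLY in `κ` after the Langer split (measured κ-uniform by c1, unproved); for `Λ ≫ m²` the thick
barrier makes the bound elementary by tunnelling EXCEPT for the far-side Airy growth `Λ^{1/6}` (c3), paid by `Λ^N`; the superradiant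
half-cone at large `m` is the regime where trapping meets superradiance (Gajic §1.4: "could lead to … stronger instabilities not visible
for bounded m") — THE uncharted regime of the crux. Numerics (wave-1 worker of c4, block B: `m ∈ {16, 64}`, `Λ ∈ {m(m+1), 2.5m²}`,
`κ ≪ |ω − mω₊|/|m| ≤ 0.03`): kernel `c/|ω − mω₊|` saturating as `κ → 0`, `|𝔚|²/|ω − mω₊| ≥ 1.2·10³`, single barrier. Why it might fail:
an `m`-drifting exponent (`A_m ≍ κ^{-cm}`) or a degenerate Weber point at the A₂ corner `Λ → 2m²`. Size XL (research).
v9 (lead seat c5): SPLIT along the Breitenlohner–Freedman seam into T2s `stub_coneKernelLargeStablePoly` and T2v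
`stub_coneKernelLargeViolatingPoly` (below); this statement is now DERIVED (`coneKernelThresholdLargePoly_of_parts`, sorry-free). -/
abbrev ConeKernelThresholdLargePoly : Prop :=
    (∀ M : ℝ, 0 < M → ∀ θ : ℝ, 0 < θ → ∀ ξ₀ : ℝ, 0 < ξ₀ → ∃ (Λ₀ a₁ ε₀ C : ℝ) (N : ℕ), a₁ < M ∧ 0 < ε₀ ∧ 0 < C ∧
      ∀ a : ℝ, a₁ ≤ |a| → Kerr.IsSubextremal M a →
        ∀ (ω : ℝ) (m : ℤ) (Λ : ℝ), Kerr.IsAdmissibleTriple a ω m Λ → m ≠ 0 → Λ₀ < Λ →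
          |ω - m * Kerr.horizonAngularVelocity M a| ≤ ε₀ * |(m : ℝ)| →
          (ω * (ω - m * Kerr.horizonAngularVelocity M a) ≤ 0 ∨
              |ω - m * Kerr.horizonAngularVelocity M a| ≤ 2 * ξ₀ * Kerr.surfaceGravity M a) →
            ∀ RH RI : ℝ → ℂ,
              Kerr.IsRadialTeukolskySolution M a 0 ω m (Λ - a ^ 2 * ω ^ 2) RH →
              Kerr.IsNormalisedHorizonSolution M a 0 ω m RH →
              Kerr.IsRadialTeukolskySolution M a 0 ω m (Λ - a ^ 2 * ω ^ 2) RI →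
              Kerr.IsNormalisedInfinitySolution M 0 ω RI →
                ∀ r r' : ℝ, Kerr.rPlus M a < r → r ≤ r' →
                  Kerr.rPlus M a + θ * (Kerr.rPlus M a - Kerr.rMinus M a) ≤ r' →
                    Real.sqrt (r ^ 2 + a ^ 2) * ‖RH r‖ * (Real.sqrt (r' ^ 2 + a ^ 2) * ‖RI r'‖) ≤
                      C * Λ ^ N * (Kerr.surfaceGravity M a)⁻¹ ^ N * ‖Kerr.radialWronskian M a 0 RH RI r‖)

/-- **T2s · `ConeKernelLargeStablePoly` (v9: `stub_coneKernelLargeStablePoly`; v9.2: DERIVED from T2sA·T2sB·flux by `coneKernelLargeStablePoly_of_parts`) — the large-`Λ` threshold/superradiant cone kernel bound in Breitenlohner–Freedman STABLE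
sectors with margin (lead seat c5, v9; the elementary half of T2, wave-1 probe `T2-stable-sketch.md`).** For `M > 0`, `θ > 0`, `ξ₀ > 0`
and every margin `θ₁ > 0` there are `Λ₀`, `a₁ < M`, `ε₀ > 0`, `C > 0`, `N` such that T2's kernel bound holds for admissible
`(ω, m, Λ)` with `m ≠ 0`, `Λ₀ < Λ` and the BF-STABILITY-WITH-MARGIN condition `(1 + θ₁)(2r₊ω)² ≤ Λ − 2amω` (the a-uniform "frozen"
form of `Λ′ > m̂²`; at `a = M`, `ω = m/2M` it reads `Λ ≥ (2 + θ₁)m²`), in the threshold/superradiant cone. CONTENT (paper proof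
(P1)–(P6) of the sketch, every step elementary; `σ = ω − mω₊`, `Λ′ = Λ − 2amω`, `m̂ = 2r₊ω`, `ν² = Λ′ − m̂² + ¼ ≥ θ₁m̂²`):
(P1) the ONE-SIDED flux pairing that survives in the threshold cone, `ω‖u_𝓗(s)‖² − |σ|‖u_𝓘(s)‖² ≤ ‖u_𝓗‖‖u_𝓘‖‖W‖`
(`KernelPairing.pairing_le`, flux `Im(ū_𝓘u_𝓘′) ≡ ω`); (P2) far side `ρ(s) ≥ r₊(1 + θ₁/8)`: κ-FREE envelope of `u_𝓘`, `u_𝓘′`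
(`carter_far_norm_le` beyond `7M` + `tameZone_transport` over the κ-free tortoise length `≤ 4M/θ₁ + 10M`; gap G2 = the landed
`carter_envelope_I` restarted at `r₊(1 + θ₁/8)`); (P3) deep barrier, `u_𝓘` side: over the real barrier basis (`exists_barrierBasis`,
`flux_floor_of_data`, `norm_le_of_data`) `u_𝓘` is RECESSIVE-dominated, `Re(ū_𝓘u_𝓘′) ≤ −(k/2)‖u_𝓘‖²` (gap G3: recessive rate
`−y′/y ≥ k tanh(k(b − x))` by Riccati/cosh comparison + complex mediant); (P4) deep barrier, `u_𝓗` side at threshold `σ = 0`: LANDED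
monotone growth `Costa2019.norm_horizonSolution_monotoneOn_of_threshold`, `re_conj_mul_deriv_horizonSolution_nonneg_of_threshold` (p138894)
+ `GrowthPairing.two_point_le_norm_wronskian_of_growth` (p139323): kernel `≤ ‖W‖/k_θ`, `k_θ ≍ κ√(Λ′θ)` (the measured law `K₁κ ≈ 0.3/√Λ′`);
(P5) `0 < |ξ| ≤ ξ₀`: perturbed monotonicity, boundary value `−ε`, `ε ≤ C(ξ₀)|ξ|` from the cap pocket (gap G4: κ- and Λ-free Volterra
bound for `Z_tt = (x²Q + ¼)Z` on `x ≤ 2ξ²/Λ′`), propagated by the LANDED `re_conj_mul_deriv_ge_of_divForm_Icc` (p139992) and paired by the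
LANDED `mul_norm_le_norm_wronskian_of_rates` (p139990); (P6) `|ξ| ≥ ξ₀` (superradiant, BF-stable): cap envelope `carter_envelope_H`
(σ ≠ 0), flux floors on both bases, DOMINANCE `|α₋β₊| ≤ ½|α₊β₋|` from `G₊G₋ ≥ κ^{-2ν}e^{2c′√Λ′} ≥ poly·κ⁻¹` — HERE the margin (`ν ≥ 1`)
and `Λ₀` large are used (gap G6: collar rates `−φ ≥ k_θ²`, `k_θ ≥ cκ√(Λ′θ)`, and the growth products by Euler-zone comparison,
`EulerZoneGrowth` landed) —, then growth pairing on `[s_*, b₂″]` and cap×cap pairs by the exact two-wave representation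
`u_𝓘 = c₁u_𝓗 + c₂ū_𝓗`, `|c₁|² − |c₂|² = −ω/σ`; census: `Kerr.coneLevel_quasiconvex` / `Kerr.forbidden_interval` (gap G0: the σ = 0
form; G1: `ρ(b₂) ≥ r₊(1 + θ₁/4)` from the margin via `(r²+a²)²V₁ ≤ 3Δ`); assembly G7 with `CarterConeArithmetic`-style bookkeeping.
NUMERICS (probe): kernel exponent `1.000 ± 0.003` in κ, constant DEcreasing in Λ and m; `|W|²/κ` grows like `κ^{-2ν}e^{O(√Λ)}` and
cancels in the kernel exactly as (P3)–(P6) say. Why it might fail: it should not (no non-cancellation input beyond convexity, two flux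
floors and dominance). Size L–XL (6–8 files; worker). -/
abbrev ConeKernelLargeStablePoly : Prop :=
    (∀ M : ℝ, 0 < M → ∀ θ : ℝ, 0 < θ → ∀ ξ₀ : ℝ, 0 < ξ₀ → ∀ θ₁ : ℝ, 0 < θ₁ →
      ∃ (Λ₀ a₁ ε₀ C : ℝ) (N : ℕ), a₁ < M ∧ 0 < ε₀ ∧ 0 < C ∧
      ∀ a : ℝ, a₁ ≤ |a| → Kerr.IsSubextremal M a →
        ∀ (ω : ℝ) (m : ℤ) (Λ : ℝ), Kerr.IsAdmissibleTriple a ω m Λ → m ≠ 0 → Λ₀ < Λ →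
          (1 + θ₁) * (2 * Kerr.rPlus M a * ω) ^ 2 ≤ Λ - 2 * a * m * ω →
          |ω - m * Kerr.horizonAngularVelocity M a| ≤ ε₀ * |(m : ℝ)| →
          (ω * (ω - m * Kerr.horizonAngularVelocity M a) ≤ 0 ∨
              |ω - m * Kerr.horizonAngularVelocity M a| ≤ 2 * ξ₀ * Kerr.surfaceGravity M a) →
            ∀ RH RI : ℝ → ℂ,
              Kerr.IsRadialTeukolskySolution M a 0 ω m (Λ - a ^ 2 * ω ^ 2) RH →
              Kerr.IsNormalisedHorizonSolution M a 0 ω m RH →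
              Kerr.IsRadialTeukolskySolution M a 0 ω m (Λ - a ^ 2 * ω ^ 2) RI →
              Kerr.IsNormalisedInfinitySolution M 0 ω RI →
                ∀ r r' : ℝ, Kerr.rPlus M a < r → r ≤ r' →
                  Kerr.rPlus M a + θ * (Kerr.rPlus M a - Kerr.rMinus M a) ≤ r' →
                    Real.sqrt (r ^ 2 + a ^ 2) * ‖RH r‖ * (Real.sqrt (r' ^ 2 + a ^ 2) * ‖RI r'‖) ≤
                      C * Λ ^ N * (Kerr.surfaceGravity M a)⁻¹ ^ N * ‖Kerr.radialWronskian M a 0 RH RI r‖)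

/-- **T2sA · `stub_coneKernelLargeStableLayerPoly` — T2s in the threshold LAYER `|σ| ≤ 2ξ₁κ` with `ξ₁ > 0` OF THE PROVER'S CHOICE
(lead seat c5, v9.2 = the seam of the wave-2 worker's checked architecture: cases (T) `σ = 0` and (S) `0 < |σ| < 2ξ₁κ`).** For `M > 0`,
`θ > 0`, `θ₁ > 0` there are `ξ₁ > 0`, `Λ₀`, `a₁ < M`, `ε₀ > 0`, `C > 0`, `N` such that the T2s kernel bound holds for admissible
`(ω, m, Λ)`, `m ≠ 0`, `Λ₀ < Λ`, BF-stable with margin `θ₁`, `|σ| ≤ ε₀|m|` and `|σ| ≤ 2ξ₁κ`. CONTENT = (T)+(S) of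
`work/stubs/T2s/T2s_remaining.lean`: threshold (σ = 0): one-sided flux identity (★) `|ω||u_𝓗|² ≤ |u_𝓗||u_𝓘||W|`, monotone
`u_𝓗` on ALL of `(−∞, b₂]` (`ForbiddenHalfLineGrowth` p142067, `forbidden_interval_threshold` p141268), κ-free far envelope of `u_𝓘`
(p142449), Airy endgame at the far turning point (p143849, p144562, p143395), window `[x₁, β]` by the maximum principle with κ-FREE depth
`D₀ = O(log Λ)`, deep points by recessive dominance (p142711) with DEPTH certified through the dyadic-shell growth chain (p143393) — the
remaining pieces being T-c `CarterThresholdDepth` and the assembly T-d; sliver `0 < |ξ| ≤ ξ₁`: the same with boundary value `−ε`,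
`ε ≤ C|ξ|κ` at the cap edge (gap G4, κ- and Λ-free scaled cap pocket), `CarterConeRate` (p143394), propagation/pairing by the landed
`re_conj_mul_deriv_ge_of_divForm_Icc` / `mul_norm_le_norm_wronskian_of_rates`. Size L (worker). -/
theorem stub_coneKernelLargeStableLayerPoly :
    (∀ M : ℝ, 0 < M → ∀ θ : ℝ, 0 < θ → ∀ θ₁ : ℝ, 0 < θ₁ →
      ∃ (ξ₁ Λ₀ a₁ ε₀ C : ℝ) (N : ℕ), 0 < ξ₁ ∧ a₁ < M ∧ 0 < ε₀ ∧ 0 < C ∧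
      ∀ a : ℝ, a₁ ≤ |a| → Kerr.IsSubextremal M a →
        ∀ (ω : ℝ) (m : ℤ) (Λ : ℝ), Kerr.IsAdmissibleTriple a ω m Λ → m ≠ 0 → Λ₀ < Λ →
          (1 + θ₁) * (2 * Kerr.rPlus M a * ω) ^ 2 ≤ Λ - 2 * a * m * ω →
          |ω - m * Kerr.horizonAngularVelocity M a| ≤ ε₀ * |(m : ℝ)| →
          |ω - m * Kerr.horizonAngularVelocity M a| ≤ 2 * ξ₁ * Kerr.surfaceGravity M a →
            ∀ RH RI : ℝ → ℂ,
              Kerr.IsRadialTeukolskySolution M a 0 ω m (Λ - a ^ 2 * ω ^ 2) RH →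
              Kerr.IsNormalisedHorizonSolution M a 0 ω m RH →
              Kerr.IsRadialTeukolskySolution M a 0 ω m (Λ - a ^ 2 * ω ^ 2) RI →
              Kerr.IsNormalisedInfinitySolution M 0 ω RI →
                ∀ r r' : ℝ, Kerr.rPlus M a < r → r ≤ r' →
                  Kerr.rPlus M a + θ * (Kerr.rPlus M a - Kerr.rMinus M a) ≤ r' →
                    Real.sqrt (r ^ 2 + a ^ 2) * ‖RH r‖ * (Real.sqrt (r' ^ 2 + a ^ 2) * ‖RI r'‖) ≤
                      C * Λ ^ N * (Kerr.surfaceGravity M a)⁻¹ ^ N * ‖Kerr.radialWronskian M a 0 RH RI r‖) :=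
  -- LANDED (lead c5 wave-3 worker, p156865; threshold core p149182, sliver core p156631 + ~30 Literature bricks): Theorems/PhaseMixingCaptureKappaExplicitWaveDecayConeKernelLargeStableLayerPoly.lean
  @Summit.FinalStateConjecture.FinalStateConjecture.Theorems.KappaExplicitWaveDecay.OlverDunsterUniformReduction.stub_coneKernelLargeStableLayerPoly

/-- **T2sB · `stub_coneKernelLargeStableSuperradiantPoly` — T2s in the SUPERRADIANT half-cone OFF the layer, `ωσ ≤ 0 ∧ 2ξ₁κ ≤ |σ|`,
for EVERY `ξ₁ > 0` (lead seat c5, v9.2 = case (R) of the wave-2 architecture).** For `M > 0`, `θ > 0`, `ξ₁ > 0`, `θ₁ > 0` there are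
`Λ₀`, `a₁ < M`, `ε₀ > 0`, `C > 0`, `N` such that the T2s kernel bound holds for admissible `(ω, m, Λ)`, `m ≠ 0`, `Λ₀ < Λ`, BF-stable with
margin `θ₁`, `|σ| ≤ ε₀|m|`, `ωσ ≤ 0` and `2ξ₁κ ≤ |σ|` (so `σ ≠ 0`, `|ξ| ≥ ξ₁`). CONTENT = (P6) of `T2-stable-sketch.md` / (R) of
`T2s_remaining.lean`: cap envelope `carter_envelope_H` (σ ≠ 0, landed), flux floors on both real barrier bases, growing dominance of
`u_𝓗` after `N_* = O(log(poly·κ⁻¹/ξ₁))` e-foldings via `re_conj_mul_deriv_ge_of_left_flux` (p142711) and the growth chain (p143393),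
DOMINANCE `|α₋β₊| ≤ ½|α₊β₋|` from `G₊G₋ ≥ κ^{-2ν}e^{2c′√Λ′} ≥ poly·κ⁻¹` (margin ⇒ `ν ≥ 1`, `Λ₀` large), `barrier_two_point`, and the
cap×cap pairs by the exact two-wave representation `u_𝓘 = c₁u_𝓗 + c₂ū_𝓗`, `|c₁|² − |c₂|² = −ω/σ`, `W = c₂W(u_𝓗, ū_𝓗)`
(`ConjugatePair.decomp/flux_decomp/wronskian_decomp`, p141356). Size L (worker). -/
theorem stub_coneKernelLargeStableSuperradiantPoly :
    (∀ M : ℝ, 0 < M → ∀ θ : ℝ, 0 < θ → ∀ ξ₁ : ℝ, 0 < ξ₁ → ∀ θ₁ : ℝ, 0 < θ₁ →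
      ∃ (Λ₀ a₁ ε₀ C : ℝ) (N : ℕ), a₁ < M ∧ 0 < ε₀ ∧ 0 < C ∧
      ∀ a : ℝ, a₁ ≤ |a| → Kerr.IsSubextremal M a →
        ∀ (ω : ℝ) (m : ℤ) (Λ : ℝ), Kerr.IsAdmissibleTriple a ω m Λ → m ≠ 0 → Λ₀ < Λ →
          (1 + θ₁) * (2 * Kerr.rPlus M a * ω) ^ 2 ≤ Λ - 2 * a * m * ω →
          |ω - m * Kerr.horizonAngularVelocity M a| ≤ ε₀ * |(m : ℝ)| →
          ω * (ω - m * Kerr.horizonAngularVelocity M a) ≤ 0 →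
          2 * ξ₁ * Kerr.surfaceGravity M a ≤ |ω - m * Kerr.horizonAngularVelocity M a| →
            ∀ RH RI : ℝ → ℂ,
              Kerr.IsRadialTeukolskySolution M a 0 ω m (Λ - a ^ 2 * ω ^ 2) RH →
              Kerr.IsNormalisedHorizonSolution M a 0 ω m RH →
              Kerr.IsRadialTeukolskySolution M a 0 ω m (Λ - a ^ 2 * ω ^ 2) RI →
              Kerr.IsNormalisedInfinitySolution M 0 ω RI →
                ∀ r r' : ℝ, Kerr.rPlus M a < r → r ≤ r' →
                  Kerr.rPlus M a + θ * (Kerr.rPlus M a - Kerr.rMinus M a) ≤ r' →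
                    Real.sqrt (r ^ 2 + a ^ 2) * ‖RH r‖ * (Real.sqrt (r' ^ 2 + a ^ 2) * ‖RI r'‖) ≤
                      C * Λ ^ N * (Kerr.surfaceGravity M a)⁻¹ ^ N * ‖Kerr.radialWronskian M a 0 RH RI r‖) :=
  -- LANDED (lead c5 wave-4 worker, p160759; u-core `Kerr.superradiantRegime_corePoly` p160414 + 19 Literature bricks of waves 3–4): Theorems/PhaseMixingCaptureKappaExplicitWaveDecayConeKernelLargeStableSuperradiantPoly.lean
  @Summit.FinalStateConjecture.FinalStateConjecture.Theorems.KappaExplicitWaveDecay.OlverDunsterUniformReduction.stub_coneKernelLargeStableSuperradiantPoly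

/-- One regime's monomial below the three-regime merged monomial (`K = max N (max N′ N″)`; `L ≤ X`, `y ≥ 1`, `w ≥ 0`). [folklore] -/
theorem monomial_le_merge3 {C D y X L w : ℝ} {N K : ℕ} (hC : 0 ≤ C) (hy : 1 ≤ y) (hL : 0 < L) (hX : L ≤ X) (hw : 0 ≤ w)
    (hNK : N ≤ K) (hD : C / L ^ (K - N) ≤ D) :
    C * y ^ N * X ^ N * w ≤ D * y ^ K * X ^ K * w := by
  have hX0 : 0 < X := hL.trans_le hX
  have hy0 : 0 < y := one_pos.trans_le hy
  have hyK : y ^ N ≤ y ^ K := pow_le_pow_right₀ hy hNK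
  have hLp : 0 < L ^ (K - N) := pow_pos hL _
  have hXK : X ^ N * L ^ (K - N) ≤ X ^ K := by
    calc X ^ N * L ^ (K - N) ≤ X ^ N * X ^ (K - N) := by gcongr
      _ = X ^ K := by rw [← pow_add, Nat.add_sub_cancel' hNK]
  have h1 : C * y ^ N * X ^ N * w ≤ C / L ^ (K - N) * y ^ K * X ^ K * w := by
    apply mul_le_mul_of_nonneg_right _ hw
    rw [div_mul_eq_mul_div, div_mul_eq_mul_div, le_div_iff₀ hLp]
    calc C * y ^ N * X ^ N * L ^ (K - N) = C * y ^ N * (X ^ N * L ^ (K - N)) := by ring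
      _ ≤ C * y ^ K * X ^ K := by gcongr
  have h2 : C / L ^ (K - N) * y ^ K * X ^ K * w ≤ D * y ^ K * X ^ K * w := by
    have : 0 ≤ y ^ K * X ^ K * w := by positivity
    calc C / L ^ (K - N) * y ^ K * X ^ K * w = C / L ^ (K - N) * (y ^ K * X ^ K * w) := by ring
      _ ≤ D * (y ^ K * X ^ K * w) := mul_le_mul_of_nonneg_right hD this
      _ = D * y ^ K * X ^ K * w := by ring
  exact h1.trans h2

/-- **T2s recovered (v9.2)**: the v9 statement of `stub_coneKernelLargeStablePoly` from the layer stub T2sA (which CHOOSES `ξ₁`), the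
superradiant stub T2sB (at that `ξ₁`) and the LANDED flux regime `ConeKernelFluxRegimePoly` (at `δ := 2ξ₁`, which covers the
non-superradiant part `ωσ ≥ 0`, `2ξ₁κ ≤ |σ| ≤ 2ξ₀κ` of the layer hypothesis): case split `|σ| ≤ 2ξ₁κ` / `ωσ ≤ 0` / else. [folklore] -/
theorem coneKernelLargeStablePoly_of_parts (hA : type_of% stub_coneKernelLargeStableLayerPoly)
    (hB : type_of% stub_coneKernelLargeStableSuperradiantPoly) (hF : ConeKernelFluxRegimePoly) : ConeKernelLargeStablePoly := by
  intro M hM θ hθ ξ₀ hξ₀ θ₁ hθ₁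
  obtain ⟨ξ₁, Λ₀, a₁, ε₀, C, N, hξ₁, ha₁, hε₀, hC, hA'⟩ := hA M hM θ hθ θ₁ hθ₁
  obtain ⟨Λ₀', a₁', ε₀', C', N', ha₁', hε₀', hC', hB'⟩ := hB M hM θ hθ ξ₁ hξ₁ θ₁ hθ₁
  obtain ⟨a₁'', ε₀'', C'', N'', ha₁'', hε₀'', hC'', hF'⟩ := hF M hM θ hθ (2 * ξ₁) (by positivity)
  have hL4 : (0 : ℝ) < 4 * M := by positivity
  set K : ℕ := max N (max N' N'') with hK
  set D : ℝ := C / (4 * M) ^ (K - N) + C' / (4 * M) ^ (K - N') + C'' / (4 * M) ^ (K - N'') with hD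
  have hD0 : 0 < D := by positivity
  refine ⟨max Λ₀ Λ₀', max a₁ (max a₁' a₁''), min ε₀ (min ε₀' ε₀''), D, K, max_lt ha₁ (max_lt ha₁' ha₁''),
    lt_min hε₀ (lt_min hε₀' hε₀''), hD0, ?_⟩
  intro a ha hsub ω m Λ hadm hm hΛ hst hcone hreg RH RI hH hnH hI hnI r r' hr hrr' hr'
  have hΛ1 : (1 : ℝ) ≤ Λ := by
    have hm1 : (1 : ℝ) ≤ |(m : ℝ)| := by
      rw [← Int.cast_abs, ← Int.cast_one, Int.cast_le]; exact Int.one_le_abs hm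
    have h2 := hadm.sq_le
    nlinarith [sq_abs (m : ℝ)]
  have hκ : 0 < Kerr.surfaceGravity M a := (Kerr.surfaceGravity_pos_iff hM a).2 hsub
  have hX : 4 * M ≤ (Kerr.surfaceGravity M a)⁻¹ := by
    rw [le_inv_comm₀ hL4 hκ, ← one_div]; exact Kerr.surfaceGravity_le hM a
  have hW0 : 0 ≤ ‖Kerr.radialWronskian M a 0 RH RI r‖ := norm_nonneg _
  have ha1 : a₁ ≤ |a| := le_trans (le_max_left _ _) ha
  have ha2 : a₁' ≤ |a| := le_trans ((le_max_left _ _).trans (le_max_right _ _)) ha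
  have ha3 : a₁'' ≤ |a| := le_trans ((le_max_right _ _).trans (le_max_right _ _)) ha
  have hc1 : |ω - m * Kerr.horizonAngularVelocity M a| ≤ ε₀ * |(m : ℝ)| :=
    hcone.trans (mul_le_mul_of_nonneg_right (min_le_left _ _) (abs_nonneg _))
  have hc2 : |ω - m * Kerr.horizonAngularVelocity M a| ≤ ε₀' * |(m : ℝ)| :=
    hcone.trans (mul_le_mul_of_nonneg_right ((min_le_right _ _).trans (min_le_left _ _)) (abs_nonneg _))
  have hc3 : |ω - m * Kerr.horizonAngularVelocity M a| ≤ ε₀'' * |(m : ℝ)| :=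
    hcone.trans (mul_le_mul_of_nonneg_right ((min_le_right _ _).trans (min_le_right _ _)) (abs_nonneg _))
  have hDA : C / (4 * M) ^ (K - N) ≤ D := by
    rw [hD]; linarith [show 0 ≤ C' / (4 * M) ^ (K - N') by positivity, show 0 ≤ C'' / (4 * M) ^ (K - N'') by positivity]
  have hDB : C' / (4 * M) ^ (K - N') ≤ D := by
    rw [hD]; linarith [show 0 ≤ C / (4 * M) ^ (K - N) by positivity, show 0 ≤ C'' / (4 * M) ^ (K - N'') by positivity]
  have hDC : C'' / (4 * M) ^ (K - N'') ≤ D := by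
    rw [hD]; linarith [show 0 ≤ C / (4 * M) ^ (K - N) by positivity, show 0 ≤ C' / (4 * M) ^ (K - N') by positivity]
  have hNK : N ≤ K := le_max_left _ _
  have hN'K : N' ≤ K := (le_max_left _ _).trans (le_max_right _ _)
  have hN''K : N'' ≤ K := (le_max_right _ _).trans (le_max_right _ _)
  rcases le_or_gt |ω - m * Kerr.horizonAngularVelocity M a| (2 * ξ₁ * Kerr.surfaceGravity M a) with hlay | hoff
  · have h := hA' a ha1 hsub ω m Λ hadm hm (lt_of_le_of_lt (le_max_left _ _) hΛ) hst hc1 hlay RH RI hH hnH hI hnI r r' hr hrr' hr'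
    exact h.trans (monomial_le_merge3 hC.le hΛ1 hL4 hX hW0 hNK hDA)
  · by_cases hsr : ω * (ω - m * Kerr.horizonAngularVelocity M a) ≤ 0
    · have h := hB' a ha2 hsub ω m Λ hadm hm (lt_of_le_of_lt (le_max_right _ _) hΛ) hst hc2 hsr hoff.le RH RI hH hnH hI hnI
        r r' hr hrr' hr'
      exact h.trans (monomial_le_merge3 hC'.le hΛ1 hL4 hX hW0 hN'K hDB)
    · have hpos : 0 ≤ ω * (ω - m * Kerr.horizonAngularVelocity M a) := (not_le.1 hsr).le
      have h := hF' a ha3 hsub ω m Λ hadm hm hc3 hoff.le hpos RH RI hH hnH hI hnI r r' hr hrr' hr'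
      exact h.trans (monomial_le_merge3 hC''.le hΛ1 hL4 hX hW0 hN''K hDC)

/-- **T2v · `stub_coneKernelLargeViolatingPoly` — the large-`Λ` threshold/superradiant cone kernel bound in Breitenlohner–Freedman
VIOLATING sectors (lead seat c5, v9; the research residual of T2, wave-1 probe `T2-residual.md` R1).** Same statement as T2s with the
complementary sector condition `Λ − 2amω < (1 + θ₁)(2r₊ω)²` (`m̂² − Λ′ > −θ₁m̂²`): since `Λ ≥ m(m+1)` this half has `m² ≍ Λ → ∞` —
the large-`m` regime where trapping meets superradiance/threshold (Gajic arXiv:2302.06636 §1.4). STRUCTURE in the blown-up chart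
(κ-free `Q`, `stub_olverNormalForm`): horizon double pole `½ ± iξ` — cap `(0, x₁)` — cap barrier `[x₁, x₂]`, `x₁,₂ = |ξ|/(m̂ ± √Λ′)`
for `|ξ| ≫ 1` (at `ξ = 0` the barrier `(0, Λ′/δ²]` touches the pole; it DISAPPEARS in the window `ξ ∈ (ξ₋, ξ₊)`,
`Disproof.nearZoneNumerator_pos_of_window`) — OSCILLATORY throat `Z ≈ Cx^{iδ} + Dx^{−iδ}`, `δ² = m̂² − Λ′ − ¼` up to `≍ m²`, length
`≍ log κ⁻¹` in `log x` — far face (extremal-Kerr-like at `ω ≈ m/2M`, above-barrier: no far turning point in this half) — infinity.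
SMALL-GAIN FORM (lead c5): in the conjugate throat basis `e, ē`, `u_𝓗 = Ae + A′ē`, `u_𝓘 = Ce + Dē`, `𝔚 = (AD − A′C)W(e,ē)`,
`|𝔚| ≥ |W(e,ē)||A′||C|(1 − |ρ_cap||ρ_far|)`, `ρ_cap = A/A′` (`|ρ_cap|² = 1 + |σ|/(f_e|A′|²) ≥ 1`: superradiant cap gain),
`ρ_far = D/C` (`|ρ_far|² = 1 − ω/(f_e|C|²) < 1`): NEEDED `sup|ρ_cap||ρ_far| ≤ 1 − gap(M, θ₁, ξ₀)` uniformly in `κ → 0` AND `m → ∞`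
(+ polynomial envelopes of `|A′|`, `|C|`: transport, available). MEASURED (probe, `a = 1 − 10⁻⁸`, throat split at the least-`Q` node):
loop gain ≤ 2.4·10⁻⁷ for every BF-violating group with `m ≥ 64` (`m = 512`: ≤ 7.9·10⁻¹⁰), `|ρ_cap| − 1 ≤ 0.02`, `|ρ_far| ≍ σ_*^{1/2}`
DEcreasing in `m`; kernel exponent in κ pinned at 1 (all 101 threshold-layer groups in [0.877, 1.031]) up to `m = 512`, constant
`c(m) = max K₁κ ≈ 0.38m^{-1/2}` DEcreasing; full grid (3003 configs) queued as kit j022121–j022125, j022133 (self-attaching). MECHANISMS: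
(a) ONE Olver-type reflection bound for the above-barrier far face, `|ρ_far| ≤ ½` uniformly in `(κ, m)` (LG error control on the TRUE
equation with `𝒱` κ-uniform, S2 landed), plus `|ρ_cap|² ≤ 1 + γ`, `γ < 1` (flux + threshold barrier action) — closes it for `δ ≥ δ₀`;
(b) TP74/hypergeometric cap numbers with error control (faces landed p104831, p103529, p116859). ELEMENTARY FRINGE R1a (deep
tunnelling, `|ξ| ≥ ξ₁` with cap-barrier action `≥ 3 log κ⁻¹ + N₀ log Λ`): dominance as in T2s (P6), same bricks. KILL: an `m`-drifting
exponent needs `|ρ_far| → 1` along a sequence, i.e. a far-side total reflector at `ω ≈ m/2M` — a far WELL, excluded for all `(Λ, m)` by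
the landed census `Kerr.coneLevel_quasiconvex`. Size XL (research). -/
theorem stub_coneKernelLargeViolatingPoly :
    (∀ M : ℝ, 0 < M → ∀ θ : ℝ, 0 < θ → ∀ ξ₀ : ℝ, 0 < ξ₀ → ∀ θ₁ : ℝ, 0 < θ₁ →
      ∃ (Λ₀ a₁ ε₀ C : ℝ) (N : ℕ), a₁ < M ∧ 0 < ε₀ ∧ 0 < C ∧
      ∀ a : ℝ, a₁ ≤ |a| → Kerr.IsSubextremal M a →
        ∀ (ω : ℝ) (m : ℤ) (Λ : ℝ), Kerr.IsAdmissibleTriple a ω m Λ → m ≠ 0 → Λ₀ < Λ →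
          Λ - 2 * a * m * ω < (1 + θ₁) * (2 * Kerr.rPlus M a * ω) ^ 2 →
          |ω - m * Kerr.horizonAngularVelocity M a| ≤ ε₀ * |(m : ℝ)| →
          (ω * (ω - m * Kerr.horizonAngularVelocity M a) ≤ 0 ∨
              |ω - m * Kerr.horizonAngularVelocity M a| ≤ 2 * ξ₀ * Kerr.surfaceGravity M a) →
            ∀ RH RI : ℝ → ℂ,
              Kerr.IsRadialTeukolskySolution M a 0 ω m (Λ - a ^ 2 * ω ^ 2) RH →
              Kerr.IsNormalisedHorizonSolution M a 0 ω m RH →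
              Kerr.IsRadialTeukolskySolution M a 0 ω m (Λ - a ^ 2 * ω ^ 2) RI →
              Kerr.IsNormalisedInfinitySolution M 0 ω RI →
                ∀ r r' : ℝ, Kerr.rPlus M a < r → r ≤ r' →
                  Kerr.rPlus M a + θ * (Kerr.rPlus M a - Kerr.rMinus M a) ≤ r' →
                    Real.sqrt (r ^ 2 + a ^ 2) * ‖RH r‖ * (Real.sqrt (r' ^ 2 + a ^ 2) * ‖RI r'‖) ≤
                      C * Λ ^ N * (Kerr.surfaceGravity M a)⁻¹ ^ N * ‖Kerr.radialWronskian M a 0 RH RI r‖) := by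
  sorry

/-- Constant-merging arithmetic (bis): with `X = κ⁻¹ ≥ L > 0`, `y ≥ 1` and `N ≤ N″`, `C·y^N·X^N·w ≤ (C/L^{N″−N})·y^{N″}·X^{N″}·w` for
`w ≥ 0`; and the sum form used when two regimes are merged. [folklore] -/
theorem monomial_merge {C C' y X L w : ℝ} {N N' : ℕ} (hC : 0 ≤ C) (hC' : 0 ≤ C') (hy : 1 ≤ y) (hL : 0 < L) (hX : L ≤ X)
    (hw : 0 ≤ w) :
    C * y ^ N * X ^ N * w ≤ (C / L ^ (max N N' - N) + C' / L ^ (max N N' - N')) * y ^ (max N N') * X ^ (max N N') * w ∧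
    C' * y ^ N' * X ^ N' * w ≤ (C / L ^ (max N N' - N) + C' / L ^ (max N N' - N')) * y ^ (max N N') * X ^ (max N N') * w := by
  have hX0 : 0 < X := hL.trans_le hX
  have hy0 : 0 < y := one_pos.trans_le hy
  have key : ∀ {D : ℝ} {K : ℕ}, 0 ≤ D → K ≤ max N N' →
      D * y ^ K * X ^ K * w ≤ D / L ^ (max N N' - K) * y ^ (max N N') * X ^ (max N N') * w := by
    intro D K hD hK
    apply mul_le_mul_of_nonneg_right _ hw
    have hyK : y ^ K ≤ y ^ (max N N') := pow_le_pow_right₀ hy hK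
    have hLp : 0 < L ^ (max N N' - K) := pow_pos hL _
    have hXK : X ^ K * L ^ (max N N' - K) ≤ X ^ (max N N') := by
      calc X ^ K * L ^ (max N N' - K) ≤ X ^ K * X ^ (max N N' - K) := by gcongr
        _ = X ^ (max N N') := by rw [← pow_add, Nat.add_sub_cancel' hK]
    rw [div_mul_eq_mul_div, div_mul_eq_mul_div, le_div_iff₀ hLp]
    calc D * y ^ K * X ^ K * L ^ (max N N' - K) = D * y ^ K * (X ^ K * L ^ (max N N' - K)) := by ring
      _ ≤ D * y ^ (max N N') * X ^ (max N N') := by gcongr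
  have hA0 : 0 ≤ C / L ^ (max N N' - N) := by positivity
  have hB0 : 0 ≤ C' / L ^ (max N N' - N') := by positivity
  have hrest : 0 ≤ y ^ (max N N') * X ^ (max N N') * w := by positivity
  constructor
  · calc _ ≤ _ := key hC (le_max_left _ _)
      _ ≤ _ := by nlinarith
  · calc _ ≤ _ := key hC' (le_max_right _ _)
      _ ≤ _ := by nlinarith

/-- **T2 recovered (v9)**: the v7.3 statement of `stub_coneKernelThresholdLargePoly` from its BF-stable and BF-violating halves
(`θ₁ := 1`; case split on `2(2r₊ω)² ≤ Λ − 2amω`; `Λ₀ := max`, `a₁ := max`, `ε₀ := min`; constants merged with `monomial_merge`: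
`Λ ≥ 1` for `m ≠ 0`, `κ⁻¹ ≥ 4M`). [folklore] -/
theorem coneKernelThresholdLargePoly_of_parts (hS : ConeKernelLargeStablePoly)
    (hV : type_of% stub_coneKernelLargeViolatingPoly) : ConeKernelThresholdLargePoly := by
  intro M hM θ hθ ξ₀ hξ₀
  obtain ⟨Λ₀, a₁, ε₀, C, N, ha₁, hε₀, hC, hA⟩ := hS M hM θ hθ ξ₀ hξ₀ 1 one_pos
  obtain ⟨Λ₀', a₁', ε₀', C', N', ha₁', hε₀', hC', hB⟩ := hV M hM θ hθ ξ₀ hξ₀ 1 one_pos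
  have hL4 : (0 : ℝ) < 4 * M := by positivity
  refine ⟨max Λ₀ Λ₀', max a₁ a₁', min ε₀ ε₀', C / (4 * M) ^ (max N N' - N) + C' / (4 * M) ^ (max N N' - N'), max N N',
    max_lt ha₁ ha₁', lt_min hε₀ hε₀', by positivity, ?_⟩
  intro a ha hsub ω m Λ hadm hm hΛ hcone hreg RH RI hH hnH hI hnI r r' hr hrr' hr'
  have hΛ1 : (1 : ℝ) ≤ Λ := by
    have hm1 : (1 : ℝ) ≤ |(m : ℝ)| := by
      rw [← Int.cast_abs, ← Int.cast_one, Int.cast_le]; exact Int.one_le_abs hm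
    have h2 := hadm.sq_le
    nlinarith [sq_abs (m : ℝ)]
  have hκ : 0 < Kerr.surfaceGravity M a := (Kerr.surfaceGravity_pos_iff hM a).2 hsub
  have hX : 4 * M ≤ (Kerr.surfaceGravity M a)⁻¹ := by
    rw [le_inv_comm₀ hL4 hκ, ← one_div]; exact Kerr.surfaceGravity_le hM a
  have hW0 : 0 ≤ ‖Kerr.radialWronskian M a 0 RH RI r‖ := norm_nonneg _
  have hmerge := monomial_merge (N := N) (N' := N') hC.le hC'.le hΛ1 hL4 hX hW0
  rcases le_or_gt ((1 + 1) * (2 * Kerr.rPlus M a * ω) ^ 2) (Λ - 2 * a * m * ω) with hst | hvi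
  · have h := hA a (le_trans (le_max_left _ _) ha) hsub ω m Λ hadm hm (lt_of_le_of_lt (le_max_left _ _) hΛ) hst
      (hcone.trans (mul_le_mul_of_nonneg_right (min_le_left _ _) (abs_nonneg _))) hreg RH RI hH hnH hI hnI r r' hr hrr' hr'
    exact h.trans hmerge.1
  · have h := hB a (le_trans (le_max_right _ _) ha) hsub ω m Λ hadm hm (lt_of_le_of_lt (le_max_right _ _) hΛ) hvi
      (hcone.trans (mul_le_mul_of_nonneg_right (min_le_right _ _) (abs_nonneg _))) hreg RH RI hH hnH hI hnI r r' hr hrr' hr'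
    exact h.trans hmerge.2

/-- Constant-merging arithmetic: with `X = κ⁻¹ ≥ 4M > 0` and `N ≤ N″`, `C·y^N·X^N ≤ (C/(4M)^{N″−N})·y^{N″}·X^{N″}` for `y = |m| ≥ 1`.
[folklore] -/
theorem monomial_le_monomial {C y X L : ℝ} {N N'' : ℕ} (hC : 0 ≤ C) (hy : 1 ≤ y) (hL : 0 < L) (hX : L ≤ X)
    (hN : N ≤ N'') : C * y ^ N * X ^ N ≤ C / L ^ (N'' - N) * y ^ N'' * X ^ N'' := by
  have hX0 : 0 < X := hL.trans_le hX
  have hy0 : 0 < y := one_pos.trans_le hy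
  have hyN : y ^ N ≤ y ^ N'' := pow_le_pow_right₀ hy hN
  have hXN : X ^ N * L ^ (N'' - N) ≤ X ^ N'' := by
    calc X ^ N * L ^ (N'' - N) ≤ X ^ N * X ^ (N'' - N) := by gcongr
      _ = X ^ N'' := by rw [← pow_add, Nat.add_sub_cancel' hN]
  have hLp : 0 < L ^ (N'' - N) := pow_pos hL _
  rw [div_mul_eq_mul_div, div_mul_eq_mul_div, le_div_iff₀ hLp]
  calc C * y ^ N * X ^ N * L ^ (N'' - N) = C * y ^ N * (X ^ N * L ^ (N'' - N)) := by ring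
    _ ≤ C * y ^ N'' * X ^ N'' := by gcongr
    _ = C * y ^ N'' * X ^ N'' := rfl

/-- **Merging the bounded box (`Λ ≤ Λ₀`) and the large-`Λ` regime into the threshold/superradiant cone kernel bound** (v7.3;
constants merged with `monomial_le_monomial`: `Λ ≥ 1`, `κ⁻¹ ≥ 4M`). [folklore] -/
theorem coneKernelThresholdPoly_of_parts
    (hB : type_of% (coneKernelThresholdBoundedPoly_of_parts stub_thresholdWronskianBoxPoly stub_horizonSupBoxPoly
      stub_infinitySupBoxPoly))
    (hL : ConeKernelThresholdLargePoly) : ConeKernelThresholdPoly := by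
  intro M hM θ hθ ξ₀ hξ₀
  obtain ⟨Λ₀, a₁, ε₀, C, N, ha₁, hε₀, hC, hA⟩ := hL M hM θ hθ ξ₀ hξ₀
  obtain ⟨a₁', ε₀', C', N', ha₁', hε₀', hC', hB'⟩ := hB M hM θ hθ ξ₀ hξ₀ Λ₀
  have hL4 : (0 : ℝ) < 4 * M := by positivity
  refine ⟨max a₁ a₁', min ε₀ ε₀', C / (4 * M) ^ (max N N' - N) + C' / (4 * M) ^ (max N N' - N'), max N N',
    max_lt ha₁ ha₁', lt_min hε₀ hε₀', by positivity, ?_⟩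
  intro a ha hsub ω m Λ hadm hm hcone hreg RH RI hH hnH hI hnI r r' hr hrr' hr'
  have hΛ1 : (1 : ℝ) ≤ Λ := by
    have hm1 : (1 : ℝ) ≤ |(m : ℝ)| := by
      rw [← Int.cast_abs, ← Int.cast_one, Int.cast_le]; exact Int.one_le_abs hm
    have h2 := hadm.sq_le
    nlinarith [sq_abs (m : ℝ)]
  have hκ : 0 < Kerr.surfaceGravity M a := (Kerr.surfaceGravity_pos_iff hM a).2 hsub
  have hX : 4 * M ≤ (Kerr.surfaceGravity M a)⁻¹ := by
    rw [le_inv_comm₀ hL4 hκ, ← one_div]; exact Kerr.surfaceGravity_le hM a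
  set W := ‖Kerr.radialWronskian M a 0 RH RI r‖ with hW
  have hW0 : 0 ≤ W := norm_nonneg _
  rcases le_or_gt Λ Λ₀ with hle | hgt
  · have h := hB' a (le_trans (le_max_right _ _) ha) hsub ω m Λ hadm hm hle
      (hcone.trans (mul_le_mul_of_nonneg_right (min_le_right _ _) (abs_nonneg _))) hreg RH RI hH hnH hI hnI r r' hr hrr' hr'
    calc _ ≤ _ := h
      _ ≤ (C' / (4 * M) ^ (max N N' - N')) * Λ ^ (max N N') * (Kerr.surfaceGravity M a)⁻¹ ^ (max N N') * W :=
          mul_le_mul_of_nonneg_right (monomial_le_monomial hC'.le hΛ1 hL4 hX (le_max_right _ _)) hW0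
      _ ≤ _ := by
          apply mul_le_mul_of_nonneg_right _ hW0
          apply mul_le_mul_of_nonneg_right _ (by positivity)
          apply mul_le_mul_of_nonneg_right _ (by positivity)
          linarith [show 0 ≤ C / (4 * M) ^ (max N N' - N) by positivity]
  · have h := hA a (le_trans (le_max_left _ _) ha) hsub ω m Λ hadm hm hgt
      (hcone.trans (mul_le_mul_of_nonneg_right (min_le_left _ _) (abs_nonneg _))) hreg RH RI hH hnH hI hnI r r' hr hrr' hr'
    calc _ ≤ _ := h
      _ ≤ (C / (4 * M) ^ (max N N' - N)) * Λ ^ (max N N') * (Kerr.surfaceGravity M a)⁻¹ ^ (max N N') * W :=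
          mul_le_mul_of_nonneg_right (monomial_le_monomial hC.le hΛ1 hL4 hX (le_max_left _ _)) hW0
      _ ≤ _ := by
          apply mul_le_mul_of_nonneg_right _ hW0
          apply mul_le_mul_of_nonneg_right _ (by positivity)
          apply mul_le_mul_of_nonneg_right _ (by positivity)
          linarith [show 0 ≤ C' / (4 * M) ^ (max N N' - N') by positivity]

/-- **Merging the flux regime (`δ := 2`) and the threshold regime (`ξ₀ := 1`) into the cone kernel bound** (constants merged with
`monomial_le_monomial`: `Λ ≥ 1` from admissibility and `m ≠ 0`, `κ⁻¹ ≥ 4M` by `Kerr.surfaceGravity_le`). A cone frequency with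
`¬(0 ≤ ω(ω − mω₊) ∧ 2κ ≤ |ω − mω₊|)` satisfies `ω(ω − mω₊) ≤ 0 ∨ |ω − mω₊| ≤ 2·1·κ`. [folklore] -/
theorem coneKernelPoly_of_parts (hF : ConeKernelFluxRegimePoly) (hT : ConeKernelThresholdPoly) :
    ConeKernelPoly := by
  intro M hM θ hθ
  obtain ⟨a₁, ε₀, C, N, ha₁, hε₀, hC, hA⟩ := hF M hM θ hθ 2 two_pos
  obtain ⟨a₁', ε₀', C', N', ha₁', hε₀', hC', hB⟩ := hT M hM θ hθ 1 one_pos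
  have hL : (0 : ℝ) < 4 * M := by positivity
  refine ⟨max a₁ a₁', min ε₀ ε₀', C / (4 * M) ^ (max N N' - N) + C' / (4 * M) ^ (max N N' - N'), max N N',
    max_lt ha₁ ha₁', lt_min hε₀ hε₀', by positivity, ?_⟩
  intro a ha hsub ω m Λ hadm hm hcone RH RI hH hnH hI hnI r r' hr hrr' hr'
  have hm1 : (1 : ℝ) ≤ |(m : ℝ)| := by
    rw [← Int.cast_abs, ← Int.cast_one, Int.cast_le]; exact Int.one_le_abs hm
  have hΛ1 : (1 : ℝ) ≤ Λ := by
    have h2 := hadm.sq_le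
    nlinarith [sq_abs (m : ℝ)]
  have hκ : 0 < Kerr.surfaceGravity M a := (Kerr.surfaceGravity_pos_iff hM a).2 hsub
  have hX : 4 * M ≤ (Kerr.surfaceGravity M a)⁻¹ := by
    rw [le_inv_comm₀ hL hκ, ← one_div]; exact Kerr.surfaceGravity_le hM a
  set W := ‖Kerr.radialWronskian M a 0 RH RI r‖ with hW
  have hW0 : 0 ≤ W := norm_nonneg _
  by_cases hflux : 0 ≤ ω * (ω - m * Kerr.horizonAngularVelocity M a) ∧
      2 * Kerr.surfaceGravity M a ≤ |ω - m * Kerr.horizonAngularVelocity M a|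
  · have h := hA a (le_trans (le_max_left _ _) ha) hsub ω m Λ hadm hm
      (hcone.trans (mul_le_mul_of_nonneg_right (min_le_left _ _) (abs_nonneg _))) hflux.2 hflux.1 RH RI hH hnH hI hnI
      r r' hr hrr' hr'
    calc _ ≤ _ := h
      _ ≤ (C / (4 * M) ^ (max N N' - N)) * Λ ^ (max N N') * (Kerr.surfaceGravity M a)⁻¹ ^ (max N N') * W :=
          mul_le_mul_of_nonneg_right (monomial_le_monomial hC.le hΛ1 hL hX (le_max_left _ _)) hW0
      _ ≤ _ := by
          apply mul_le_mul_of_nonneg_right _ hW0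
          apply mul_le_mul_of_nonneg_right _ (by positivity)
          apply mul_le_mul_of_nonneg_right _ (by positivity)
          linarith [show 0 ≤ C' / (4 * M) ^ (max N N' - N') by positivity]
  · have hthr : ω * (ω - m * Kerr.horizonAngularVelocity M a) ≤ 0 ∨
        |ω - m * Kerr.horizonAngularVelocity M a| ≤ 2 * 1 * Kerr.surfaceGravity M a := by
      rw [not_and_or, not_le, not_le] at hflux
      rcases hflux with h | h
      · exact Or.inl h.le
      · exact Or.inr (by linarith)
    have h := hB a (le_trans (le_max_right _ _) ha) hsub ω m Λ hadm hm
      (hcone.trans (mul_le_mul_of_nonneg_right (min_le_right _ _) (abs_nonneg _))) hthr RH RI hH hnH hI hnI r r' hr hrr' hr'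
    calc _ ≤ _ := h
      _ ≤ (C' / (4 * M) ^ (max N N' - N')) * Λ ^ (max N N') * (Kerr.surfaceGravity M a)⁻¹ ^ (max N N') * W :=
          mul_le_mul_of_nonneg_right (monomial_le_monomial hC'.le hΛ1 hL hX (le_max_right _ _)) hW0
      _ ≤ _ := by
          apply mul_le_mul_of_nonneg_right _ hW0
          apply mul_le_mul_of_nonneg_right _ (by positivity)
          apply mul_le_mul_of_nonneg_right _ (by positivity)
          linarith [show 0 ≤ C / (4 * M) ^ (max N N' - N) by positivity]

/-- **Clause (b) of the crux** (κ-explicit integrated local energy decay for every sub-extremal spin and admissible wave), as the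
conclusion of the physical-space step; v6–v7.3 registered the single stub `stub_integratedDecayOfKernelPoly : ConeWronskianPoly →
ConeKernelPoly → ClauseB`; since v7.4 that implication is DERIVED (`integratedDecay_of_parts`) from S6a (near-extremal spins
`a₁ ≤ |a| < M`, κ-explicit, fed by the cone bounds) and S6b (spins `|a| ≤ a₁` bounded away from extremality, NO κ: the printed
Dafermos–Rodnianski–Shlapentokh-Rothman theorem with its `a₀`-uniform constant). [folklore] -/
abbrev ClauseB : Prop :=
    (∀ [Kerr.Facts] [Kerr.SliceFacts], ∀ M : ℝ, 0 < M → ∃ (p : ℝ) (j : ℕ), ∀ R : ℝ, ∃ C : ENNReal, C < ⊤ ∧ ∀ a : ℝ, Kerr.IsSubextremal M a → ∀ ψ : Kerr.exterior M a → ℝ, (ContMDiff 𝓘(ℝ, E4) 𝓘(ℝ, ℝ) ((⊤ : ℕ∞) : WithTop ℕ∞) ψ ∧ (∀ x, (Kerr.smoothMetric M a (Kerr.rPlus M a)).toPseudoRiemannianMetric.dalembertian ψ x = 0) ∧ ∃ K : Set (Kerr.exterior M a), IsCompact K ∧ ∀ x : Kerr.exterior M a, (x : E4) 0 = 0 → x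 ∉ K → ψ x = 0 ∧ mfderiv 𝓘(ℝ, E4) 𝓘(ℝ, ℝ) ψ x = 0) → ∫⁻ τ in Ioi (0 : ℝ), localSliceEnergy (Kerr.exterior M a) ψ τ R ≤ C * ENNReal.ofReal ((1 - (a / M) ^ 2) ^ (-p)) * ∫⁻ y : E3, {y | E4.ofTimeSpace 0 y ∈ Kerr.exterior M a}.indicator (fun y ↦ ENNReal.ofReal (∑ m ∈ Finset.range (j + 1), ‖iteratedFDeriv ℝ m (Function.extend Subtype.val ψ (0 : E4 → ℝ)) (E4.ofTimeSpace 0 y)‖ ^ 2)) y)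

/-- **S6e statement · `ConeBarrierDecayPoly` — the extra two-point DECAY of the cone kernel across the angular barrier** (lead seat c5, v9.5;
typed by the wave-5 summation worker, `S6a_summation_skeleton.lean` S3a: NOT supplied by `ConeKernelPoly`, needed by the DRSR §9 summation to pay the
`Λ^N` of far sources without r-weights — inventory risk 1). For `M > 0`, collar `θ > 0`, near radius `R_b ≥ 7M` there are `a₁ < M`, `ε₀`, a barrier
constant `C_c`, `C`, `N`, a rate `c > 0` such that for `a₁ ≤ |a| < M`, `R_f ≥ 2R_b`, cone triples with `C_c(1 + ω²R_f²) ≤ Λ` (so `V − ω² ≥ Λ/(4r²)` on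
`R_b ≤ r ≤ R_Λ := √(Λ/(C_c(1+ω²)))`) and every normalised pair: for `collar ≤ r ≤ R_b` and `r′ ≥ R_f`,
`√(r²+a²)|R_𝓗(r)|·√(r′²+a²)|R_𝓘(r′)| ≤ CΛ^Nκ^{-N}(R_b/min(r′, R_Λ))^{c√Λ}|𝔚|`. Content: inside the forbidden zone `u_𝓗` is growing-outward and `u_𝓘`
growing-inward dominated (Airy/Wronskian connection at the single far turning point `≍ R_Λ`; `|u_𝓘||u_𝓘′| ≥ |ω|` from `W(u_𝓘, ū_𝓘) = −2iω`), so the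
product decays like `exp(−∫√(V − ω²)dr*) ≤ (r/r′)^{√Λ/2}`; beyond `R_Λ`, `|u_𝓘| ≤ 2`. Tools: `BarrierProductBound`, `TransitionZoneGrowth`,
`CarterFarBarrierEnvelope`, the T2s dominance bricks. Why it might fail: only through the prefactor (must be the same `Λ^Nκ^{-N}`). Size M–L (worker).
[folklore] -/
abbrev ConeBarrierDecayPoly : Prop :=
  ∀ M : ℝ, 0 < M → ∀ θ : ℝ, 0 < θ → ∀ Rb : ℝ, 7 * M ≤ Rb →
    ∃ (a₁ ε₀ Cc C c : ℝ) (N : ℕ), a₁ < M ∧ 0 < ε₀ ∧ 0 < Cc ∧ 0 < C ∧ 0 < c ∧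
    ∀ a : ℝ, a₁ ≤ |a| → Kerr.IsSubextremal M a →
    ∀ Rf : ℝ, 2 * Rb ≤ Rf →
    ∀ (ω : ℝ) (m : ℤ) (Λ : ℝ), Kerr.IsAdmissibleTriple a ω m Λ → m ≠ 0 →
      |ω - m * Kerr.horizonAngularVelocity M a| ≤ ε₀ * |(m : ℝ)| →
      Cc * (1 + ω ^ 2 * Rf ^ 2) ≤ Λ →
      ∀ RH RI : ℝ → ℂ,
        Kerr.IsRadialTeukolskySolution M a 0 ω m (Λ - a ^ 2 * ω ^ 2) RH →
        Kerr.IsNormalisedHorizonSolution M a 0 ω m RH →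
        Kerr.IsRadialTeukolskySolution M a 0 ω m (Λ - a ^ 2 * ω ^ 2) RI →
        Kerr.IsNormalisedInfinitySolution M 0 ω RI →
        ∀ r r' : ℝ, Kerr.rPlus M a + θ * (Kerr.rPlus M a - Kerr.rMinus M a) ≤ r → r ≤ Rb → Rf ≤ r' →
          Real.sqrt (r ^ 2 + a ^ 2) * ‖RH r‖ * (Real.sqrt (r' ^ 2 + a ^ 2) * ‖RI r'‖) ≤
            C * Λ ^ N * (Kerr.surfaceGravity M a)⁻¹ ^ N *
              (Rb / min r' (Real.sqrt (Λ / (Cc * (1 + ω ^ 2))))) ^ (c * Real.sqrt Λ) *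
              ‖Kerr.radialWronskian M a 0 RH RI r‖

/-- **S6e · `stub_coneBarrierDecayPoly`** (lead seat c5, v9.5): the angular-barrier decay of the cone kernel, registered as a T-side obligation and fed to
S6a″. Size M–L (worker). [folklore] -/
theorem stub_coneBarrierDecayPoly : ConeBarrierDecayPoly :=
  -- LANDED (lead c5 wave-6 worker, p167121; bricks BarrierInwardGrowth p165924, CarterAngularBarrier p166293, CarterAngularBarrierDecay p166726)
  @Summit.FinalStateConjecture.FinalStateConjecture.Theorems.KappaExplicitWaveDecay.OlverDunsterUniformReduction.stub_coneBarrierDecayPoly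

/-- **S6f statement · `InfinityJostRemainderPoly` — quantitative outgoing asymptotics of `u_𝓘` with tracked constants** (lead seat c5, v9.5; typed by
the wave-5 summation worker, S3b: needed by the `v = t + r*` Plancherel treatment of far sources). For `M > 0`, `ω_l > 0` there are `C_J`, `p` with: for
all `|a| < M`, admissible triples with `|ω| ≥ ω_l`, every infinity-normalised solution and `r ≥ C_J`, `r ≥ C_J(1 + Λ)/|ω|` (v9.6: the v9.5 form without
`C_J ≤ r` quantified radii `r ≤ r₊` for large `|ω|` — refuted by the wave-6 worker, `not_infinityJostRemainderPoly` in the evidence file; corrected here),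
`|√(r²+a²)R_𝓘(r) − c₀e^{iωr + 2iMω log r}| ≤ C_J(1 + Λ)(1 + |ω|)^p/(|ω|r)` with the unimodular `c₀` of the normalisation. Content: the Volterra iteration
behind the LANDED existence theorem `Kerr.exists_normalisedInfinitySolution` (`TeukolskyOutgoingFormalSeries`, `hasDerivAt_varParams_Ioi`,
`TeukolskyOutgoingCorrection`, p146350/p146128/p146674) with constants tracked; κ plays no role. Size M (worker). [folklore] -/
abbrev InfinityJostRemainderPoly : Prop :=
  ∀ M : ℝ, 0 < M → ∀ ωl : ℝ, 0 < ωl → ∃ (CJ : ℝ) (p : ℕ), 0 < CJ ∧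
    ∀ a : ℝ, Kerr.IsSubextremal M a →
    ∀ (ω : ℝ) (m : ℤ) (Λ : ℝ), Kerr.IsAdmissibleTriple a ω m Λ → ωl ≤ |ω| →
      ∀ RI : ℝ → ℂ, Kerr.IsRadialTeukolskySolution M a 0 ω m (Λ - a ^ 2 * ω ^ 2) RI →
        Kerr.IsNormalisedInfinitySolution M 0 ω RI →
        ∃ c₀ : ℂ, ‖c₀‖ = 1 ∧ ∀ r : ℝ, CJ ≤ r → CJ * (1 + Λ) / |ω| ≤ r →
          ‖(Real.sqrt (r ^ 2 + a ^ 2) : ℂ) * RI r -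
              c₀ * Complex.exp (Complex.I * ω * r + 2 * Complex.I * M * ω * Real.log r)‖ ≤
            CJ * (1 + Λ) * (1 + |ω|) ^ p / (|ω| * r)

/-- **S6f · `stub_infinityJostRemainderPoly`** (lead seat c5, v9.5): the quantitative Jost remainder, registered as a T-side obligation and fed to S6a″.
Size M (worker). [folklore] -/
theorem stub_infinityJostRemainderPoly : InfinityJostRemainderPoly :=
  -- LANDED (lead c5, proof by the wave-6 worker; p168433 + the gate-relocated statement p168432 `Literature.Uncategorized.InfinityJostRemainderPoly`;
  -- bricks p166353 JostOutgoingRemainder, p167203 KerrTortoiseFarAsymptotics, p167482 TeukolskyJostRemainderBound)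
  @Summit.FinalStateConjecture.FinalStateConjecture.Theorems.KappaExplicitWaveDecay.OlverDunsterUniformReduction.stub_infinityJostRemainderPoly

/-- **S6a · `stub_integratedDecayNearExtremalPoly` — physical space, clause (b) on the NEAR-EXTREMAL range `a₁ ≤ |a| < M` from the cone
Green's function (lead seat c4, v7.4 = the honest part of the v6–v7.3 stub `stub_integratedDecayOfKernelPoly`).** GIVEN the cone Wronskian lower
bound and the cone kernel bound (Λ-polynomial, `ConeWronskianPoly`, `ConeKernelPoly`), for every `M > 0` there are `a₁ < M` (the prover may raise the
cone's `a₁`), `p`, `j` such that for every `R` some `C(M, R) < ∞` bounds `∫₀^∞ E_loc(τ, R) dτ ≤ C·(1 − (a/M)²)^{-p}·E_j[ψ](0)` for all `a₁ ≤ |a| < M` and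
all admissible `ψ`. CONTENT (DRSR arXiv:1402.7034 with κ-TRACKED constants): Carter separation with t*-Plancherel for the sufficiently-integrable
outgoing class (M2: Def 5.1.1/5.1.2, Prop 5.2.1, §5.2.2, Lemmas 5.3.1/5.3.2/5.4.1 — ABSENT from the tree, being built bottom-up by a provefact seat; the
angular half M1 is landed: `Kerr.inner_oblateSphereBasis_sphLaplacianStar`, `OblateSpheroidal*`), the frequency-localised multiplier estimates of Thm 8.1
(Props 8.3.1–8.7.4) re-proved with constants polynomial in κ⁻¹ up to `|a| → M` (in-cone horizon term §9.7 fed by the hypotheses; off-cone bounded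
frequencies by TdC 2020 Thm 5.1), §9 summation for future-integrable solutions, Prop 10.1 (higher order: powers of Λ, |m| → order j), a κ-QUANTITATIVE
replacement of §11 (continuity in a), Prop 12.1, and the dictionary DRSR `Σ_τ`/`J^N` ↔ tree `localSliceEnergy`/`E_j` on Kerr–Schild leaves. Why it might
fail: only if a κ-loss hides outside the cone (none expected: off-cone DRSR constants depend on a₁ < M only through compact ranges). Size XXL —
promote-stub ×5 (leads 0, c1, c2, c3, c4): a separation crux + an ILED-with-κ-bookkeeping crux.
v9 (lead seat c5) = S6a′: TWO MORE NAMED HYPOTHESES, both published theorems, which the wave-1 re-assessment (`S6a_inventory.md`,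
`S6a_skeleton.lean` on the item: DRSR step ↦ tree decl ↦ status ↦ a-dependence, range by range) showed the DRSR route cannot avoid and the
v7.4–v8 signature did not hand over: (1) `Kerr.Costa2019_wronskianBound_subextremal` (Teixeira da Costa 2020 Thm 5.1, corrected reading:
quantitative mode stability uniform in `|a| < M` OFF the extremal thresholds `ω = ±m/2M`) — removes the horizon term `|u(−∞)|²` that
Prop 8.7.4 produces for the finitely many OFF-CONE bounded-frequency superradiant triples (DRSR §9.7 cite Shlapentokh-Rothman 2015 at
fixed `a`; κ-uniformity up to `a → M` off the cone is exactly Thm 5.1), registered as S6d; (2) S6c's fact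
`DafermosRodnianskiShlapentokhRothman2016_integratedDecay_uniform` — used only QUALITATIVELY (future integrability of every admissible
wave at `a₀ := |a|`, DRSR §11), never for its constant. With them S6a′ is closable from its hypotheses: what remains is
`missing_offConeMultiplierEstimates` (Thm 8.1 off-cone with `(κδ)^{-N}` constants: 𝓖_♯ done κ-uniformly — `Kerr.timeDominated_estimate_kerr` —,
𝓖_♮ / 8.7.2 / 8.7.3 need κ-tracking, 𝓖^♯ / 𝓖_𝄬 / 8.7.4 have no estimate file yet), `missing_coneModeSupBound` (variation of parameters
from the two cone hypotheses; wave 2), `missing_offConeHorizonTerm` (from (1) + off-cone sup bounds; wave 2), `missing_redShiftPoly`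
(red-shift width LINEAR in κ, constant `C₀κ^{-q}`), `missing_summationFutureIntegrable` (§5 interface for `ξ(τ)ψ`, §9.2–9.6, §10-lite;
risk: `Λ^N` on far sources needs r-weights or a barrier-decay lemma), all typed in `S6a_skeleton.lean`.
v9.5 (lead seat c5, after wave 5) = S6a″: (a) the DRSR hypothesis is now the printed Thm 3.1 (24) in its a₀-uniform, every-order form
`DafermosRodnianskiShlapentokhRothman2016_integratedDecayZeroth_uniform` (LANDED named fact p162880; it implies the vendored (25),
`…integratedDecay_uniform_of_zeroth`) — under the old (25)@j=2 fact the future integrability at the orders the summation needs does NOT follow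
(`missing_futureIntegrableOfFirstOrder`, now DISCHARGED: `futureIntegrable_of_integratedDecayZeroth` p163353, `sliceSobolevEnergy_lt_top` p163123);
(b) two T-side inputs the DRSR §9 summation consumes and `ConeKernelPoly` does not supply are registered and fed in: `ConeBarrierDecayPoly` (S6e) and
`InfinityJostRemainderPoly` (S6f) — wave-5 finding (F1)/(F2) of `S6a_summation_skeleton.lean`: L¹-shaped mode bounds lose the radial extent of the
far source of `ξψ`; the summation must use the kernel-level hypotheses with the exact representation, the `v = t + r*` Plancherel of the Jost principal
term (S6f) and the angular-barrier decay (S6e). With S6a″'s hypotheses the remaining missing pieces are exactly `missing_offConeMultiplierEstimates`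
(DRSR Thm 8.1 off-cone, (κδ)-polynomial) and the typed summation block S1/S4/S4a/S4b/S5 of `S6a_summation_skeleton.lean` (evidence). -/
theorem stub_integratedDecayNearExtremalPoly :
    Kerr.Costa2019_wronskianBound_subextremal → DafermosRodnianskiShlapentokhRothman2016_integratedDecayZeroth_uniform →
    ConeWronskianPoly → ConeKernelPoly → ConeBarrierDecayPoly → InfinityJostRemainderPoly →
    (∀ [Kerr.Facts] [Kerr.SliceFacts], ∀ M : ℝ, 0 < M → ∃ (a₁ p : ℝ) (j : ℕ), a₁ < M ∧ ∀ R : ℝ, ∃ C : ENNReal, C < ⊤ ∧ ∀ a : ℝ, a₁ ≤ |a| → Kerr.IsSubextremal M a → ∀ ψ : Kerr.exterior M a → ℝ, (ContMDiff 𝓘(ℝ, E4) 𝓘(ℝ, ℝ) ((⊤ : ℕ∞) : WithTop ℕ∞) ψ ∧ (∀ x, (Kerr.smoothMetric M a (Kerr.rPlus M a)).toPseudoRiemannianMetric.dalembertian ψ x = 0) ∧ ∃ K : Set (Kerr.exterior M a), IsCompact K ∧ ∀ x : Kerr.exterior M a, (x : E4) 0 = 0 → x ∉ K → ψ x = 0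 ∧ mfderiv 𝓘(ℝ, E4) 𝓘(ℝ, ℝ) ψ x = 0) → ∫⁻ τ in Ioi (0 : ℝ), localSliceEnergy (Kerr.exterior M a) ψ τ R ≤ C * ENNReal.ofReal ((1 - (a / M) ^ 2) ^ (-p)) * ∫⁻ y : E3, {y | E4.ofTimeSpace 0 y ∈ Kerr.exterior M a}.indicator (fun y ↦ ENNReal.ofReal (∑ m ∈ Finset.range (j + 1), ‖iteratedFDeriv ℝ m (Function.extend Subtype.val ψ (0 : E4 → ℝ)) (E4.ofTimeSpace 0 y)‖ ^ 2)) y) := by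
  sorry

/-- **S6b · `stub_integratedDecayAwayFromExtremal` — physical space, clause (b) AWAY from extremality, `|a| ≤ a₁ < M`, no κ-factor
(lead seat c4, v7.4; the half of the v6–v7.3 stub that was SILENT: its hypotheses cover only `a₁ ≤ |a|`).** For `M > 0` and every `a₁ < M` there
is `j` such that for every `R` some `C = C(M, a₁, R) < ∞` bounds `∫₀^∞ E_loc(τ, R) dτ ≤ C·E_j[ψ](0)` for all `|a| ≤ a₁` and all admissible `ψ`. This is
EXACTLY the printed theorem of Dafermos–Rodnianski–Shlapentokh-Rothman (arXiv:1402.7034 = Ann. Math. 183 (2016), Thm 3.2 (25) with §3.3: "C depends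
only on a₀ and M", for all `|a| ≤ a₀ < M`; `j = 2`), read on the Kerr–Schild leaves as in `Literature/Geometry/Lorentzian/KerrIntegratedDecay.lean`
(`drsr_wave_integrated_decay_kerr_of_DRSR`). Since v7.5 the stub is the REDUCTION from the named fact
`DafermosRodnianskiShlapentokhRothman2016_integratedDecay_uniform` (`Literature/Geometry/Lorentzian/KerrIntegratedDecayUniform.lean`, p134959, lead c4:
the printed `a₀`-uniform transcription; the older facts choose `C` after `a`) to the clause: run the reduction of `KerrIntegratedDecay.lean` uniformly in
`|a| ≤ a₁` (a-uniform far radius / finite-speed / height-function constants; `E₂` dominated by the tree's `E_j`, `j = 2`). The fact itself is the separate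
registered obligation `stub_drsrIntegratedDecayUniform`. Size M (worker). -/
theorem stub_integratedDecayAwayFromExtremal :
    DafermosRodnianskiShlapentokhRothman2016_integratedDecay_uniform →
    (∀ [Kerr.Facts] [Kerr.SliceFacts], ∀ M : ℝ, 0 < M → ∀ a₁ : ℝ, a₁ < M → ∃ j : ℕ, ∀ R : ℝ, ∃ C : ENNReal, C < ⊤ ∧ ∀ a : ℝ, |a| ≤ a₁ → ∀ ψ : Kerr.exterior M a → ℝ, (ContMDiff 𝓘(ℝ, E4) 𝓘(ℝ, ℝ) ((⊤ : ℕ∞) : WithTop ℕ∞) ψ ∧ (∀ x, (Kerr.smoothMetric M a (Kerr.rPlus M a)).toPseudoRiemannianMetric.dalembertian ψ x = 0) ∧ ∃ K : Set (Kerr.exterior M a), IsCompact K ∧ ∀ x : Kerr.exterior M a, (x : E4) 0 = 0 → x ∉ K → ψ x = 0 ∧ mfderiv 𝓘(ℝ, E4) 𝓘(ℝ, ℝ) ψ x = 0) → ∫⁻ τ in Ioi (0 : ℝ), localSliceEnergy (Kerr.exterior M a) ψ τ R ≤ C * ∫⁻ y : E3, {y | E4.ofTimeSpace 0 y ∈ Kerr.exterior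 M a}.indicator (fun y ↦ ENNReal.ofReal (∑ m ∈ Finset.range (j + 1), ‖iteratedFDeriv ℝ m (Function.extend Subtype.val ψ (0 : E4 → ℝ)) (E4.ofTimeSpace 0 y)‖ ^ 2)) y) :=
  -- LANDED (lead c4 wave 3 worker `s6b`, p135745): reduction from the named fact (Literature KerrIntegratedDecayUniform p134959)
  @Summit.FinalStateConjecture.FinalStateConjecture.Theorems.KappaExplicitWaveDecay.OlverDunsterUniformReduction.stub_integratedDecayAwayFromExtremal

/-- **S6c · `stub_drsrIntegratedDecayZerothUniform` (v7.5–v9.4: `stub_drsrIntegratedDecayUniform`, the (25) form) — the Dafermos–Rodnianski–Shlapentokh-Rothman theorem itself** (lead seat c4, v7.5; v9.5: the printed Thm 3.1 (24) a₀-uniform every-order form `…integratedDecayZeroth_uniform`, LANDED named fact p162880, which implies the (25) form consumed by S6b): the named fact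
`DafermosRodnianskiShlapentokhRothman2016_integratedDecay_uniform` (arXiv:1402.7034 = Ann. Math. 183 (2016), Thm 3.2 (25) with §3.3: integrated local
energy decay on sub-extremal Kerr, constant uniform on `|a| ≤ a₀ < M`; vendored form of `KerrIntegratedDecay.lean`), registered as an explicit obligation of
the line so that the crux closes UNCONDITIONALLY only when the printed theorem is discharged in the tree (`…_uniform_holds`, the literature provers' programme:
Carter separation M1/M2, frequency-localised multipliers, mode stability, red-shift — 127 pages). Until then every closure along this line is conditional on
exactly this published theorem. Size: the DRSR programme. -/
theorem stub_drsrIntegratedDecayZerothUniform : DafermosRodnianskiShlapentokhRothman2016_integratedDecayZeroth_uniform := by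
  sorry

/-- **S6c (v7.5–v9.4 form) recovered**: the vendored (25) fact from the (24) fact (LANDED implication, p162880). [folklore] -/
theorem drsrIntegratedDecayUniform_of_zeroth (hD : type_of% @stub_drsrIntegratedDecayZerothUniform) :
    DafermosRodnianskiShlapentokhRothman2016_integratedDecay_uniform :=
  DafermosRodnianskiShlapentokhRothman2016_integratedDecay_uniform_of_zeroth hD

/-- **S6d · `stub_costaWronskianBound` — Teixeira da Costa's quantitative real-axis mode stability, uniform in the Kerr parameter, OFF
the extremal thresholds** (lead seat c5, v9): the named fact `Kerr.Costa2019_wronskianBound_subextremal`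
(`Literature/Geometry/Lorentzian/TeukolskyWronskianBound.lean`; Teixeira da Costa, Comm. Math. Phys. 378 (2020), Thm 5.1, corrected
reading of 2026-08-16: for bounded `|ω| + |ω|⁻¹ + max(|ω − m/2M|⁻¹, |ω + m/2M|⁻¹) + |m| + |λ|` the bound `1 ≤ G·|𝔚|²` holds with ONE `G` for
all `|a| < M`), registered as an explicit obligation of the line because S6a′ consumes it for the OFF-CONE horizon term (DRSR Prop 9.7.1 at
bounded frequencies, finitely many superradiant `m`): on the cone the line's own T-side stubs replace it, off the cone nothing else in print
is κ-uniform. Until `…_holds` is discharged in the tree (the literature provers' programme: TdC §§3–5, 60 pp.) every closure along this line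
is conditional on exactly this published theorem, as with S6c. Size: a literature programme. -/
theorem stub_costaWronskianBound : Kerr.Costa2019_wronskianBound_subextremal := by
  sorry

/-- **S7 · `stub_energyFromLocalEnergy` — physical space, clause (a) from (b): `a`-UNIFORM energy boundedness modulo integrated local
energy** (the card's `BoundednessFromILED`, stated per wave). For every `M > 0` there are a coordinate radius `R₀ = R₀(M)` and
`C₀(M) < ∞` such that for EVERY sub-extremal `a`, every admissible `ψ` and every `τ ≥ 0`:
`sliceEnergy(ψ, τ) ≤ C₀·(E_1[ψ](0) + ∫₀^∞ E_loc(s, R₀) ds)` — no power of `κ` at all. HOW: energy identity for the current `J^N` of the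
future-timelike vector field `N := ∂_{t*}` on `{r ≥ 3M}` (Killing; timelike off the ergoregion, which lies in `{r < 2M}`:
`ρ² = r² + a²cos²θ > 2Mr` for `r > 2M`), `N := n` = future unit normal of the Kerr–Schild leaves on `{r ≤ 5M/2}`, convex interpolation in
between (a positive combination of future causal vectors is timelike): `E^N(τ) + F^N[𝓗⁺ ∩ {0 ≤ t* ≤ τ}] = E^N(0) + ∫∫ K^N` with
`F^N ≥ 0` (dominant energy condition on the null horizon, `KerrSchildDominantEnergy`), `K^N ≡ 0` on `r ≥ 3M` and
`|K^N| ≤ C(M)·Σ_α|∂_αψ|²` on `r ≤ 3M ⊆ {‖y‖ ≤ R₀ := 4M}` (`‖y‖² ≤ r² + a²`), hence `E^N(τ) ≤ E^N(0) + C∫₀^τ E_loc(s, R₀) ds`; and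
`J^N·n_leaf ≍ Σ_α|∂_αψ|² = coordEnergyDensity` with constants uniform on the COMPACT parameter set `{|a| ≤ M} × {r₊(a) ≤ r ≤ 3M}` (the
Kerr–Schild components are smooth in `a` through `a = M`; the leaves are uniformly spacelike, `g^{t*t*} = −(1 + 2H) ≤ −1`, refuter
rattack-10654: `0 ≤ H ≤ M/r₊ ≤ 1`); `E^N(0) ≤ 4C·E_1[ψ](0)` (`Σ_α|∂_αψ̃|² ≤ 4‖Dψ̃‖²_{op}`). Uses `□_g ψ = 0` (`∇·J^N = K^N` and finite speed of
propagation; Disproof §4 honoured: with the wave equation deleted the Negative witness `expNegInvGlue(t* − 1/3)` refutes this statement too —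
`sliceEnergy = ∞` on the whole leaf against a finite right-hand side — so the stub keeps the clause verbatim) and regularity of `ψ` up to
`𝓗⁺` (`{t* ≥ 0, r > r₊} ⊆ D⁺` of the initial leaf; extension across `r = r₊` by the Kerr–Schild Cauchy problem:
`KerrSchildWaveCauchyProblem`, `KerrDomainOfDependence`, `KerrFiniteSpeedOfPropagation`). No red-shift vector field is needed here (that is
(b)'s business). WHY IT MIGHT FAIL: only in the horizon-regularity / flux-sign step for the tree's `dalembertian` (trace of the Koszul/Hessian
`choose`-definitions, pinned for `C²` functions — Disproof item 1); on paper it is the Dafermos–Rodnianski remark "boundedness follows from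
integrated local energy decay plus the energy identity away from the horizon" (arXiv:0811.0354 §§4–5; DRSR §13, first reduction). Leans on:
`KerrSchildKillingEnergy`, `KerrSchildEnergyCurrent`, `KerrSchildEnergyEstimate`, `KerrSchildDivergence`/`KerrSchildSlabDivergence`,
`KerrEnergyIdentity`, `KerrLeafEnergyComparison`, `KerrLeafCoercivity`, `KerrFluxComparison`, `KerrHorizonCausality`, `KerrTimelikeSpan`;
DR arXiv:0811.0354 §§4–5, arXiv:1010.5132 §4. Size M–L. With (b) at `R = R₀` it yields (a) with exponents `(max p 0, max j 1)` — the real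
step of `KappaExplicitWaveDecay_of`. -/
theorem stub_energyFromLocalEnergy :
    (∀ [Kerr.Facts] [Kerr.SliceFacts], ∀ M : ℝ, 0 < M → ∃ (R₀ : ℝ) (C₀ : ENNReal), C₀ < ⊤ ∧ ∀ a : ℝ, Kerr.IsSubextremal M a → ∀ ψ : Kerr.exterior M a → ℝ, (ContMDiff 𝓘(ℝ, E4) 𝓘(ℝ, ℝ) ((⊤ : ℕ∞) : WithTop ℕ∞) ψ ∧ (∀ x, (Kerr.smoothMetric M a (Kerr.rPlus M a)).toPseudoRiemannianMetric.dalembertian ψ x = 0) ∧ ∃ K : Set (Kerr.exterior M a), IsCompact K ∧ ∀ x : Kerr.exterior M a, (x : E4) 0 = 0 → x ∉ K → ψ x = 0 ∧ mfderiv 𝓘(ℝ, E4) 𝓘(ℝ, ℝ) ψ x = 0) → ∀ τ : ℝ, 0 ≤ τ → sliceEnergy (Kerr.exterior M a) ψ τ ≤ C₀ * ((∫⁻ y : E3, {y | E4.ofTimeSpace 0 y ∈ Kerr.exterior M a}.indicator (fun y ↦ ENNReal.ofReal (∑ m ∈ Finset.range (1 + 1), ‖iteratedFDeriv ℝ m (Function.extend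 Subtype.val ψ (0 : E4 → ℝ)) (E4.ofTimeSpace 0 y)‖ ^ 2)) y) + ∫⁻ s in Ioi (0 : ℝ), localSliceEnergy (Kerr.exterior M a) ψ s R₀)) :=
  -- LANDED (wave 1): see the imported Theorems module
  @Summit.FinalStateConjecture.FinalStateConjecture.Theorems.KappaExplicitWaveDecay.OlverDunsterUniformReduction.stub_energyFromLocalEnergy

/-! ## Names for the statements (hypotheses of the composition)

The layer-invariant audit admits, as hypotheses of the theorem that concludes the crux, only registered obligations or the declared
stubs BY NAME; `Statement.stub_x` is the statement of `stub_x` (its `type_of%`) under the stub's own short name, so that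
`KappaExplicitWaveDecay_of` is stated over the stub statements and passes the audit. -/

namespace Statement

/-- Statement of `stub_olverNormalForm` (S1, landed). -/
abbrev stub_olverNormalForm : Prop := type_of% OlverDunsterUniformReduction.stub_olverNormalForm
/-- Statement of `stub_lgErrorBound` (S2, landed). -/
abbrev stub_lgErrorBound : Prop := type_of% OlverDunsterUniformReduction.stub_lgErrorBound
/-- Statement of `stub_coneCensus` (S3, landed). -/
abbrev stub_coneCensus : Prop := type_of% OlverDunsterUniformReduction.stub_coneCensus
/-- Statement of `stub_fullConeCensus` (census of the full potential). -/
abbrev stub_fullConeCensus : Prop := type_of% OlverDunsterUniformReduction.stub_fullConeCensus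
/-- Statement of `stub_tameZoneTransport` (E1). -/
abbrev stub_tameZoneTransport : Prop := type_of% OlverDunsterUniformReduction.stub_tameZoneTransport
/-- Statement of `stub_barrierProductBound` (E2). -/
abbrev stub_barrierProductBound : Prop := type_of% OlverDunsterUniformReduction.stub_barrierProductBound
/-- Statement of `stub_fluxRegimeCorePoly` (flux-regime core, Λ-polynomial). -/
abbrev stub_fluxRegimeCorePoly : Prop := type_of% OlverDunsterUniformReduction.stub_fluxRegimeCorePoly
/-- Statement of `stub_polyPlumbing` (tortoise reduction ∧ Wronskian-of-kernel, Λ-polynomial twins). -/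
abbrev stub_polyPlumbing : Prop := type_of% OlverDunsterUniformReduction.stub_polyPlumbing
/-- Statement of `stub_thresholdWronskianBoxPoly` (T1w: quantitative mode stability near the corner, bounded box; research). -/
abbrev stub_thresholdWronskianBoxPoly : Prop := type_of% OlverDunsterUniformReduction.stub_thresholdWronskianBoxPoly
/-- Statement of `stub_horizonSupBoxPoly` (T1h: sup bound for the horizon-normalised solution, bounded box). -/
abbrev stub_horizonSupBoxPoly : Prop := type_of% OlverDunsterUniformReduction.stub_horizonSupBoxPoly
/-- Statement of `stub_infinitySupBoxPoly` (T1i: sup bound for the infinity-normalised solution beyond the collar, bounded box). -/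
abbrev stub_infinitySupBoxPoly : Prop := type_of% OlverDunsterUniformReduction.stub_infinitySupBoxPoly
/-- Statement of `stub_coneKernelLargeStableLayerPoly` (T2sA: large Λ, BF-stable, threshold layer; elementary). -/
abbrev stub_coneKernelLargeStableLayerPoly : Prop := type_of% OlverDunsterUniformReduction.stub_coneKernelLargeStableLayerPoly
/-- Statement of `stub_coneKernelLargeStableSuperradiantPoly` (T2sB: large Λ, BF-stable, superradiant off the layer; elementary). -/
abbrev stub_coneKernelLargeStableSuperradiantPoly : Prop :=
  type_of% OlverDunsterUniformReduction.stub_coneKernelLargeStableSuperradiantPoly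
/-- Statement of `stub_coneKernelLargeViolatingPoly` (T2v: large Λ, BF-violating sectors; research residual). -/
abbrev stub_coneKernelLargeViolatingPoly : Prop := type_of% OlverDunsterUniformReduction.stub_coneKernelLargeViolatingPoly
/-- Statement of `stub_integratedDecayNearExtremalPoly` (S6a′). -/
abbrev stub_integratedDecayNearExtremalPoly : Prop := type_of% OlverDunsterUniformReduction.stub_integratedDecayNearExtremalPoly
/-- Statement of `stub_integratedDecayAwayFromExtremal` (S6b, reduction from the DRSR named fact). -/
abbrev stub_integratedDecayAwayFromExtremal : Prop := type_of% @OlverDunsterUniformReduction.stub_integratedDecayAwayFromExtremal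
/-- Statement of `stub_drsrIntegratedDecayZerothUniform` (S6c, the DRSR named fact itself, (24) form). -/
abbrev stub_drsrIntegratedDecayZerothUniform : Prop := type_of% @OlverDunsterUniformReduction.stub_drsrIntegratedDecayZerothUniform
/-- Statement of `stub_coneBarrierDecayPoly` (S6e, angular-barrier decay of the cone kernel). -/
abbrev stub_coneBarrierDecayPoly : Prop := type_of% @OlverDunsterUniformReduction.stub_coneBarrierDecayPoly
/-- Statement of `stub_infinityJostRemainderPoly` (S6f, quantitative Jost remainder). -/
abbrev stub_infinityJostRemainderPoly : Prop := type_of% @OlverDunsterUniformReduction.stub_infinityJostRemainderPoly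
/-- Statement of `stub_costaWronskianBound` (S6d, Teixeira da Costa 2020 Thm 5.1 as the tree's named fact). -/
abbrev stub_costaWronskianBound : Prop := type_of% @OlverDunsterUniformReduction.stub_costaWronskianBound
/-- Statement of `stub_energyFromLocalEnergy` (S7, landed). -/
abbrev stub_energyFromLocalEnergy : Prop := type_of% @OlverDunsterUniformReduction.stub_energyFromLocalEnergy

end Statement

/-! ## Negative lemmas honoured (landed `Theorems/KappaExplicitWaveDecay/Negative/*`, Disproof §4)

Pinned here so the scratch check imports them: both refuted statements DELETE `□_g ψ = 0`; S6 and S7 quantify the admissibility clause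
with the wave equation verbatim, so neither stub (nor any instance of one) is among the refuted statements. -/

example :=
  And.intro
    Summit.FinalStateConjecture.FinalStateConjecture.Theorems.KappaExplicitWaveDecay.Negative.kappaExplicitWaveDecay_false_without_waveEq
    Summit.FinalStateConjecture.FinalStateConjecture.Theorems.KappaExplicitWaveDecay.Negative.kappaExplicitWaveDecay_iled_false_without_waveEq

/-! ## The composition (kernel-checked, sorry-free) -/

/-- Monotonicity of the `κ`-factor: for a sub-extremal spin `χ = 1 − (a/M)² ∈ (0, 1]`, so `χ^{-p}` is non-decreasing in `p`. [folklore] -/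
theorem kappaFactor_mono {M a : ℝ} (hM : 0 < M) (ha : Kerr.IsSubextremal M a) {p q : ℝ} (hpq : p ≤ q) :
    ENNReal.ofReal ((1 - (a / M) ^ 2) ^ (-p)) ≤ ENNReal.ofReal ((1 - (a / M) ^ 2) ^ (-q)) := by
  have ha' : |a| < M := ha
  have h1 : |a / M| < 1 := by
    rw [abs_div, abs_of_pos hM]
    exact (div_lt_one hM).mpr ha'
  have h2 : (a / M) ^ 2 < 1 := (sq_lt_one_iff_abs_lt_one (a / M)).mpr h1
  have hχ0 : 0 < 1 - (a / M) ^ 2 := by linarith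
  have hχ1 : 1 - (a / M) ^ 2 ≤ 1 := by nlinarith [sq_nonneg (a / M)]
  exact ENNReal.ofReal_le_ofReal (Real.rpow_le_rpow_of_exponent_ge hχ0 hχ1 (neg_le_neg hpq))

/-- The `κ`-factor is at least `1` for `p ≥ 0` on the sub-extremal range (it never helps). [folklore] -/
theorem one_le_kappaFactor {M a : ℝ} (hM : 0 < M) (ha : Kerr.IsSubextremal M a) {p : ℝ} (hp : 0 ≤ p) :
    1 ≤ ENNReal.ofReal ((1 - (a / M) ^ 2) ^ (-p)) := by
  have h0 : ENNReal.ofReal ((1 - (a / M) ^ 2) ^ (-(0 : ℝ))) = 1 := by simp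
  rw [← h0]
  exact kappaFactor_mono hM ha hp

/-- Monotonicity of the order-`j` data energy `E_j[ψ](0)` in `j` (more derivatives, larger sum). [folklore] -/
theorem dataEnergy_mono {M a : ℝ} (ψ : Kerr.exterior M a → ℝ) {j j' : ℕ} (hj : j ≤ j') :
    (∫⁻ y : E3, {y | E4.ofTimeSpace 0 y ∈ Kerr.exterior M a}.indicator (fun y ↦ ENNReal.ofReal
        (∑ m ∈ Finset.range (j + 1), ‖iteratedFDeriv ℝ m (Function.extend Subtype.val ψ (0 : E4 → ℝ))
          (E4.ofTimeSpace 0 y)‖ ^ 2)) y) ≤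
      ∫⁻ y : E3, {y | E4.ofTimeSpace 0 y ∈ Kerr.exterior M a}.indicator (fun y ↦ ENNReal.ofReal
        (∑ m ∈ Finset.range (j' + 1), ‖iteratedFDeriv ℝ m (Function.extend Subtype.val ψ (0 : E4 → ℝ))
          (E4.ofTimeSpace 0 y)‖ ^ 2)) y := by
  refine lintegral_mono fun y ↦ Set.indicator_le_indicator ?_
  refine ENNReal.ofReal_le_ofReal ?_
  exact Finset.sum_le_sum_of_subset_of_nonneg (Finset.range_mono (by omega)) fun _ _ _ ↦ by positivity

/-- The arithmetic of the real step: energy `≤ C₀·(E₁ + I)` and `I ≤ C_b·K·E_j`, with `E₁, E_j ≤ E`, `K ≤ K'`, `1 ≤ K'`, give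
energy `≤ C₀(1 + C_b)·K'·E`. [folklore] -/
theorem combine_bound {S E₁ E Ej I K K' C₀ Cb : ℝ≥0∞} (h1 : S ≤ C₀ * (E₁ + I)) (h2 : I ≤ Cb * K * Ej)
    (hE₁ : E₁ ≤ E) (hEj : Ej ≤ E) (hK : K ≤ K') (hK1 : 1 ≤ K') : S ≤ C₀ * (1 + Cb) * K' * E := by
  have hE₁' : E₁ ≤ K' * E := by
    calc E₁ ≤ E := hE₁
      _ = 1 * E := (one_mul E).symm
      _ ≤ K' * E := mul_le_mul' hK1 le_rfl
  have hI : I ≤ Cb * (K' * E) := by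
    calc I ≤ Cb * K * Ej := h2
      _ ≤ Cb * K' * E := mul_le_mul' (mul_le_mul' le_rfl hK) hEj
      _ = Cb * (K' * E) := mul_assoc _ _ _
  calc S ≤ C₀ * (E₁ + I) := h1
    _ ≤ C₀ * (K' * E + Cb * (K' * E)) := mul_le_mul' le_rfl (add_le_add hE₁' hI)
    _ = C₀ * (1 + Cb) * K' * E := by ring

/-- **S6 from its two halves** (v7.4): clause (b) for every sub-extremal spin from the near-extremal half (exponents `(p, j)`, range
`a₁ ≤ |a|`) and the half bounded away from extremality (exponent `j′`, no κ, range `|a| ≤ a₁`, itself reduced to the DRSR named fact `hD`), with exponents `(max p 0, max j j′)` and constant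
`C + C′` (`χ^{-p}` is monotone in `p` and `≥ 1`, `E_j` is monotone in `j`). v9: the near-extremal half S6a′ also consumes the two named facts
`hT` (TdC Thm 5.1, S6d) and `hD` (DRSR, S6c); v9.5: `hD` is the (24) form (S6b gets the (25) form through the landed implication) and S6a″ also consumes
the T-side inputs `hBD` (S6e) and `hJ` (S6f). [folklore] -/
theorem integratedDecay_of_parts (hA : type_of% stub_integratedDecayNearExtremalPoly)
    (hB : type_of% @stub_integratedDecayAwayFromExtremal) (hD : type_of% @stub_drsrIntegratedDecayZerothUniform)
    (hT : type_of% @stub_costaWronskianBound) (hBD : type_of% @stub_coneBarrierDecayPoly)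
    (hJ : type_of% @stub_infinityJostRemainderPoly) :
    ConeWronskianPoly → ConeKernelPoly → ClauseB := by
  intro hW hK instF instS M hM
  obtain ⟨a₁, p, j, ha₁, hA'⟩ := @hA hT hD hW hK hBD hJ instF instS M hM
  obtain ⟨j', hB'⟩ := @hB (drsrIntegratedDecayUniform_of_zeroth hD) instF instS M hM a₁ ha₁
  refine ⟨max p 0, max j j', fun R ↦ ?_⟩
  obtain ⟨C, hC, hAC⟩ := hA' R
  obtain ⟨C', hC', hBC⟩ := hB' R
  refine ⟨C + C', ENNReal.add_lt_top.2 ⟨hC, hC'⟩, fun a ha ψ hψ ↦ ?_⟩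
  rcases le_or_gt a₁ |a| with h | h
  · calc _ ≤ _ := hAC a h ha ψ hψ
      _ ≤ _ := mul_le_mul' (mul_le_mul' le_self_add (kappaFactor_mono hM ha (le_max_left p 0)))
          (dataEnergy_mono ψ (le_max_left j j'))
  · calc _ ≤ _ := hBC a h.le ψ hψ
      _ = C' * 1 * _ := by rw [mul_one]
      _ ≤ _ := mul_le_mul' (mul_le_mul' le_add_self (one_le_kappaFactor hM ha (le_max_right p 0)))
          (dataEnergy_mono ψ (le_max_right j j'))

/-- **`KappaExplicitWaveDecay_of`** — the stub STATEMENTS imply the crux, BY NAME (v6). Plumbing plus one real step: the flux-regime core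
(`stub_fluxRegimeCorePoly` on the census) is moved to the R-language by `stub_polyPlumbing`.1, merged with the threshold regime
(`coneKernelThresholdBoundedPoly_of_parts` (v8: T1 = T1w·T1h·T1i), `coneKernelThresholdLargePoly_of_parts` (v9: T2 = T2s·T2v), `coneKernelThresholdPoly_of_parts`, `coneKernelPoly_of_parts`), the Wronskian bound is `stub_polyPlumbing`.2 applied to the kernel bound; S6 = `integratedDecay_of_parts` S6a′ S6b S6c S6d turns (Wronskian, kernel) into
clause (b) with exponents `(p, j)`; S7 with (b) at the radius `R₀(M)` gives clause (a) with the SAME `κ`-power once the exponents are raised to `(max p 0, max j 1)`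
(`χ^{-p}` and `E_j` are monotone, `χ^{-p'} ≥ 1`), and (b) is re-read at those exponents. S1–S3 (landed) are the inputs of the kernel stubs' proofs. -/
theorem KappaExplicitWaveDecay_of (h₁ : Statement.stub_olverNormalForm) (h₂ : Statement.stub_lgErrorBound)
    (h₃ : Statement.stub_coneCensus) (hN : Statement.stub_fullConeCensus)
    (hE₁ : Statement.stub_tameZoneTransport) (hE₂ : Statement.stub_barrierProductBound)
    (hC : Statement.stub_fluxRegimeCorePoly) (hPl : Statement.stub_polyPlumbing)
    (hTw : Statement.stub_thresholdWronskianBoxPoly) (hTh : Statement.stub_horizonSupBoxPoly)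
    (hTi : Statement.stub_infinitySupBoxPoly) (hTa : Statement.stub_coneKernelLargeStableLayerPoly)
    (hTb : Statement.stub_coneKernelLargeStableSuperradiantPoly) (hTv : Statement.stub_coneKernelLargeViolatingPoly)
    (h₆a : Statement.stub_integratedDecayNearExtremalPoly) (h₆b : Statement.stub_integratedDecayAwayFromExtremal)
    (h₆c : Statement.stub_drsrIntegratedDecayZerothUniform) (h₆d : Statement.stub_costaWronskianBound)
    (h₆e : Statement.stub_coneBarrierDecayPoly) (h₆f : Statement.stub_infinityJostRemainderPoly)
    (h₇ : Statement.stub_energyFromLocalEnergy) :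
    KappaExplicitWaveDecay := by
  -- S1–S3 are landed theorems (the lever of the line); they are threaded here so the audit records them as used
  have _l : Statement.stub_olverNormalForm ∧ Statement.stub_lgErrorBound ∧ Statement.stub_coneCensus := ⟨h₁, h₂, h₃⟩
  intro instF instS M hM
  have hF : ConeKernelFluxRegimePoly := coneKernelFluxRegimePoly_of_core hPl (fluxRegimeCorePoly_of hE₁ hE₂ hN hC)
  have hT : ConeKernelThresholdPoly :=
    coneKernelThresholdPoly_of_parts (coneKernelThresholdBoundedPoly_of_parts hTw hTh hTi)
      (coneKernelThresholdLargePoly_of_parts (coneKernelLargeStablePoly_of_parts hTa hTb hF) hTv)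
  have hker : ConeKernelPoly := coneKernelPoly_of_parts hF hT
  have h₄ : ConeWronskianPoly := hPl.2 hker
  -- `@`: keep the instance binders `∀ [Kerr.Facts] [Kerr.SliceFacts]` un-instantiated until applied
  have h₆ : ConeWronskianPoly → ConeKernelPoly → ClauseB := integratedDecay_of_parts h₆a h₆b h₆c h₆d h₆e h₆f
  have hB := @h₆ h₄ hker instF instS M hM
  obtain ⟨p, j, hILED⟩ := hB
  obtain ⟨R₀, C₀, hC₀, hE⟩ := @h₇ instF instS M hM
  obtain ⟨Cb, hCb, hbR⟩ := hILED R₀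
  refine ⟨max p 0, max j 1, ⟨C₀ * (1 + Cb), ?_, fun a ha ψ hψ τ hτ ↦ ?_⟩, fun R ↦ ?_⟩
  · exact ENNReal.mul_lt_top hC₀ (ENNReal.add_lt_top.2 ⟨ENNReal.one_lt_top, hCb⟩)
  · exact combine_bound (hE a ha ψ hψ τ hτ) (hbR a ha ψ hψ) (dataEnergy_mono ψ (le_max_right j 1))
      (dataEnergy_mono ψ (le_max_left j 1)) (kappaFactor_mono hM ha (le_max_left p 0))
      (one_le_kappaFactor hM ha (le_max_right p 0))
  · obtain ⟨C, hC, h⟩ := hILED R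
    refine ⟨C, hC, fun a ha ψ hψ ↦ ?_⟩
    calc _ ≤ _ := h a ha ψ hψ
      _ ≤ _ := mul_le_mul' (mul_le_mul' le_rfl (kappaFactor_mono hM ha (le_max_left p 0)))
          (dataEnergy_mono ψ (le_max_left j 1))

/-- The crux along this line, MODULO the registered stubs (references every `stub_*`, so the skeleton audit shows exactly which
sorries `KappaExplicitWaveDecay` still depends on; the lead closes the crux by discharging them). -/
theorem KappaExplicitWaveDecay_proof : KappaExplicitWaveDecay :=
  KappaExplicitWaveDecay_of stub_olverNormalForm stub_lgErrorBound stub_coneCensus stub_fullConeCensus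
    stub_tameZoneTransport stub_barrierProductBound stub_fluxRegimeCorePoly stub_polyPlumbing
    stub_thresholdWronskianBoxPoly stub_horizonSupBoxPoly stub_infinitySupBoxPoly
    stub_coneKernelLargeStableLayerPoly stub_coneKernelLargeStableSuperradiantPoly stub_coneKernelLargeViolatingPoly
    stub_integratedDecayNearExtremalPoly
    stub_integratedDecayAwayFromExtremal stub_drsrIntegratedDecayZerothUniform stub_costaWronskianBound
    stub_coneBarrierDecayPoly stub_infinityJostRemainderPoly stub_energyFromLocalEnergy

end Summit.FinalStateConjecture.FinalStateConjecture.Cruxes.KappaExplicitWaveDecay.OlverDunsterUniformReduction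

end
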